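/-
Copyright: lit-balaban Phase-2 proof seat p34 (gen 20).  Statement-level skeleton of a published paper; no proof claims beyond what the
kernel checks below.
-/
import Literature.MathematicalPhysics.QuantumFieldTheory.BalabanImbrieJaffe1984to88.BIJ88NeumannPropagatorSmoothNearRegion
import Literature.MathematicalPhysics.QuantumFieldTheory.BalabanImbrieJaffe1984to88.BIJ88NeumannPropagatorSmallFieldRegionHolder

/-!
# [BalabanImbrieJaffe1988] p. 263 (2.31) and *"covariant derivatives and Hölder derivatives … of order less than two"* WITH THEIR PRINTED
# LOCAL HYPOTHESIS (2.32)/(2.33) — **the [6] (1.10) covariant-derivative member (operator form, deep bonds) and the [6] (1.9) Hölder member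
# of the region Neumann propagators `G_k(Ω,u)` on EVERY `k`-block union `Ω` when the gauge field is smooth ONLY NEAR `Ω`** (plaquette
# smallness on the plaquettes based within `2L^k` of `Ω`, nothing assumed elsewhere; and under the printed (2.32)
# `BIJ88Sect2Statements.SmoothOn` near `Ω`) — file B-II of the TAKING (file B-I = `BIJ88NeumannPropagatorSmoothNearRegion`: the local tree-gauge
# lemmas, the blockwise gauge from plaquettes near `Ω`, the value members and the `D_u` kernel member, (2.32) ⟹ local plaquette smallness)

T. Bałaban, J. Imbrie, A. Jaffe, *Effective action and cluster properties of the abelian Higgs model*, Commun. Math. Phys. **114** (1988)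
257–315 [BalabanImbrieJaffe1988], Sect. 2 p. 263 [PDF 7]: *"|(G_{k,loc}(u)f − G_k(Ω,u)f)(x)| ≦ e^{−cr(e_k)}e^{−c dist(suppt f,x)}‖f‖_∞ for
dist(x, Ω^c) ≧ O(r(e_k)). (2.31) We assume that u is smooth in the □_α's entering the sum in (2.27); for (2.31) we assume smoothness
throughout the subset Ω ⊂ T_η. This means that in a neighborhood of each □_α there exists an A, λ such that u = exp[ie_kη(A + ∂λ)] with
|∂A|, |∂*A| ≦ O(p(e_k)). (2.32) Here [(2.33)] is our logarithmic scale for small fields. Bounds analogous to (2.30), (2.31)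
hold for covariant derivatives and Hölder derivatives of G_{k,loc}(u) of order less than two."*; [I] = T. Bałaban, J. Imbrie, A. Jaffe,
*Renormalization of the Higgs model: minimizers, propagators and the stability of mean field theory*, Commun. Math. Phys. **97** (1985)
299–329 [BalabanImbrieJaffe1985], §7.3 p. 326 [PDF 28]: *"The propagators arising from Δ_k(u_k) … also satisfy the regularity and decay
estimates of [7]. In order to remain within the framework of this reference, we remark that by change of gauge u_k can be transformed in a
local region Λ into a configuration of the form exp[ie_kηA], where A is smooth and small."*; [6] = [7] of [I] = T. Bałaban, *Regularity and
decay of lattice Green's functions*, Commun. Math. Phys. **89** (1983) 571–597 [Balaban1983RegularityDecay], Theorem p. 573 [PDF 3]: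
*"|x−x′|^{−α}|U(A(Γ_{x,x′}))(D^η_{A,μ}G_k(Ω,A)f)(x′) − (D^η_{A,μ}G_k(Ω,A)f)(x)| ≦ c₀ exp(−δ₀ dist({x,x′}, supp f))‖f‖_∞ (1.9) …
|(D^η_{A,μ}G_k(Ω,A)f)(x)| ≦ c₀ exp(−δ₀ dist(x, supp f))‖f‖_∞ (1.10) … for x, x′ ∈ Ω, and satisfying the condition dist({x,x′},Ω^c) ≧ R₀"*;
the tree ("axial") gauge of a box: T. Bałaban, *Averaging operations for lattice gauge theories*, Commun. Math. Phys. **98** (1985) 17–51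
[Balaban1985Averaging], pp. 24–25.

statement-level skeleton of published theorems with citation tags; proofs where landed; nothing here is a claim about the Yang–Mills mass gap

PDFs held: `paper:balaban1988-cmp114-bij-abelian-higgs-effective-action` (journal page = PDF page + 256; p. 263 [PDF 7]);
`paper:balaban1985-cmp97-bij-higgs-minimizers` (p. 326 [PDF 28]); `paper:balaban1983-cmp89-regularity-decay` (p. 573 [PDF 3]).

CITATION HEADER (lean-in-tree rule).  Part of the lit-balaban TYPED SKELETON (HOME `run/shared/lean/pub/lit-balaban/`), PHASE-2 proof seat
p34 gen 20 (unit `lit-balaban-p34-g20`; TAKING #2 line HOME/STATUS.md 2026-08-23T10:48Z, window honoured; free-target protocol G.5-34(d)).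
WHAT IS REPRODUCED: located MEMBERS of rows **C2.Eq2.31** / **C2.Claim@263** (owner r18) and consumers BY NAME of the definition row
**C2.Eq2.32** (`SmoothOn`), and of **C1.Claim@326** (owner r15; *"change of gauge … in a local region Λ"*): the covariant-derivative member of
[6] (1.10) in operator form at the `L^k`-deep bonds and the Hölder member of [6] (1.9) (order `1 + α`, `0 ≤ α < 1`, all `3L^k`-deep pairs,
transport `stairHol`) for the region propagator `G_k(Ω,u)` on EVERY `k`-block union `Ω`, under plaquette smallness of `u` NEAR `Ω` ONLY —
whereas every non-flat `D_u` / Hölder member of the tree so far (p34 gens 17–20 `…SmallFieldCubeDeriv` / `…RegionDeriv` / `…RegionHolder`,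
p27's cube files) takes `‖u(∂p) − 1‖ ≤ θ` on the WHOLE torus.  No row is restated and no head changes.  USED BY NAME, never restated: B-I's
`dist1_centredGaugeDir_le_supDist_of_near` / `_of_near` / `_min_of_near`, `blockGauge_of_near`, `plaqSmall_near_of_smoothOn`
(`BIJ88NeumannPropagatorSmoothNearRegion`); p34 gen 18's REGION value member `decay110_smallField_region` (`BIJ88NeumannPropagatorSmallFieldRegionSup`;
bondwise `(T, δ)` inside `Ω` only — no plaquette hypothesis); p30's `local_gradient_bound` / `local_holder_bound`, `centredGaugeDir`, `stairHol` /
`stair_telescope` / `axisHol_gaugeAct` / `covD_gaugeAct`; p26's `flat_kernel_diffs`, p30's `flat_kernel_holder`; p27's `source_eq_on_ball` /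
`deep_of_ball` / `stairHol_gaugeAct`; p34 gen 17's `nOp_univ_mulVec_apply_eq_of_interior` / `nOp_gaugeAct_mulVec_apply` /
`norm_covD_gBox_gaugeAct_mulVec` / `gBox_gaugeAct_mulVec` / `norm_toC_plaqHol_gaugeAct_sub_one`; r09's `supDist_shift_le_succ` /
`supDist_unshift_le_succ` / `supDist_shift_le_one'` (`BIJ85TorusTentCutoff`); r18's `SmoothOn`.  Kind: theorems only (no definition, no
`Prop`-valued fact).

THE MATHEMATICS (as in B-I: why the local hypothesis suffices).  The proofs of the tree's `D_u` and Hölder members at small non-flat fields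
(p30's interior estimates `local_gradient_bound` / `local_holder_bound` run on a gauge copy `u^h`) use the plaquette hypothesis at exactly two
places: (a) the bond estimate `|u^h_b − 1| ≤ (d−1)|z − x₀|_∞θ` of p30's tree gauge `h = centredGaugeDir u x₀ R i` on the ball of radius
`R = 2r ≤ L^k/4` about a point `x₀ ∈ Ω` (the maximal bond of the weighted maximum in the `D_u` member; the deep end point in the Hölder member) —
by [Balaban1985Averaging] p. 25 this reads only the plaquettes of the box `[x₀ − R − 2, x₀ + R + 2]`, all based within `R + 2 ≤ 2L^k` of
`x₀ ∈ Ω` (B-I `dist1_centredGaugeDir_le…_of_near`); (b) the blockwise gauge removing the bondwise `(T, δ)` hypotheses, which reads only the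
plaquettes based within `L^k + 1` of a corner of a block of `Ω` (B-I `blockGauge_of_near`).  Everything else (the value member, the flat
kernel, the absorption arithmetic) involves no plaquette.  Hence p34 gen 18's `decay110_smallField_region_deriv` proof and p34 gen 20's
`BIJ88NeumannPropagatorSmallFieldRegionHolder` proofs go through VERBATIM with the two local lemmas substituted — this file is that transcript.

WHAT IS PROVED (theorems only; 0 `sorry`; standard axioms).
* §0 private scalar kernels (gen 17/18's absorption arithmetic, copied: `min_div_two_le`, `min_div_four_le`, `weight_mem`, `absorb_step`,
  `budget_step`, `shallow_step`).
* §A **`decay110_smoothNear_region_deriv`** — [6] (1.10) `D_u` member in OPERATOR form at the `L^k`-deep bonds of EVERY `k`-block union, `P.d = d+1 ≤ 3`,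
  `L` odd `> 1`, `k`-uniform constants, under: plaquettes based within `2L^k` of `Ω` within `θ` of `1`, `2(d+1)³(L^{2k}θ)² ≤ 1`, bondwise `(T, δ)`
  inside `Ω` with `2(L^k−1)L^k(d+1)T² + 2δ² ≤ 1/2`: `‖(D_uG_k(Ω,u)f)(⟨x,μ⟩)‖ ≤ c₁(L^kε)e^{−t₀D/L^k}‖f‖_∞` (gen 18's proof verbatim, (a) localised).
* §B **`decay110_smoothNear_region_deriv_uniform`** (the `(T, δ)` hypotheses discharged by the blockwise gauge from plaquettes near `Ω`:
  `2(L^k−1)+4 < |T|`, `T ≥ d(L^k−1)θ`, `2(L^k−1)L^k(d+1)T² + 2((d+1)(L^k−1)T)² ≤ 1/2` — NO gauge condition) and **`decay110_smoothOn_region_deriv`**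
  (the same UNDER THE PRINTED (2.32): `SmoothOn e_k η C 𝓅 X B Pl (cfg u)`, `Pl ⊇` the plaquettes based within `2L^k` of `Ω`, `B ⊇` their bonds,
  `θ = e_kη²C𝓅`).
* §C **`holder19_smoothNear_region_leg_gauged`**, §D **`holder19_smoothNear_region_leg`**, **`holder19_smoothNear_region`** (ALL `3L^k`-deep pairs:
  `(L^k/|x₀−x₁|_∞)^α‖U(Γ_{x₀,x₁})(D_uG_k(Ω,u)f)(x₁,μ) − (D_uG_k(Ω,u)f)(x₀,μ)‖ ≤ c₀(L^kε)e^{−t₀D/L^k}‖f‖_∞`), **`_input`** ((H1.9)-input binders),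
  **`_H6`** (VERBATIM the (H6) binder of p27's `derivHolder231_region_of_inputs_of_smooth`, every `ρ ≥ 3L^k`) — p34's `…RegionHolder` §§1–3
  verbatim with (a) localised and §A as the `D_u` input.
* §E **`holder19_smoothNear_region_uniform`** / **`_uniform_input`** / **`_uniform_H6`** (plaquette smallness near `Ω` ONLY, threshold in
  `(d, L^k)`, NO gauge condition — (b)), private `threshold_smallness'` (p31's arithmetic), **`holder19_smoothNear_region_H6_of500`** (the (H6)
  shape in the `plaqC` / `((L^k)²θ)² ≤ 1/500` currency of the hypothesis-free chain, the `plaqC` hypothesis only at sites within `2L^k` of `Ω`).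
* §F **`holder19_smoothOn_region_uniform`** / **`holder19_smoothOn_region_uniform_H6`** — the Hölder member UNDER THE PRINTED (2.32) near `Ω`.
HONEST SCOPE.  (i) As in B-I: the hypothesis is local as printed, in the tree's currency (plaquette smallness on the plaquettes BASED within
sup-distance `2L^k` of `Ω`; resp. `SmoothOn` with `Pl ⊇` those plaquettes, `B ⊇` their four bonds — the divergence clause `|∂*A|` and the
site set `X` of (2.32) are not used); thresholds `θ ≲ 1/((d+1)^{3/2}L^{2k})` etc. exactly as in the global members, i.e. on `L^{2k}e_kη²C𝓅`;
nothing is asserted about the size of `C𝓅(e_k)` beyond the displayed inequalities.  (ii) `U(1)`, `P.d = d + 1 ∈ {2, 3}`, `L` odd `> 1`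
(p30's flat kernel inputs), `1 ≤ k ≤ K`; the DEEP condition is [6]'s `dist({x,x′},Ω^c) ≥ R₀` with `R₀ = L^k` (`D_u`) / `3L^k` (Hölder) — three
units of the `L^{−k}`-lattice, an `O(1)`-block collar inside print's `O(r(e_k))` collars; the members are for `G_k(Ω,u)` itself ((1.9)/(1.10)
of [6] as invoked at p. 263), not for the difference (2.31) (p27's `BIJ88LocDerivHolder231…` files combine them).  (iii) One power of the block
spacing `L^kε` in both members, as in the global files (p27/p34 convention; [6] prints none — scale convention of `D^η`, disclosed there).
(iv) The axis-rooted gauge `centredGaugeDir` and the blockwise gauge are our devices ([I] p. 326 says only *"by change of gauge … in a local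
region"*); DIVERGENCE OF METHOD from [6]'s random-walk expansion as disclosed in gens 16–18.  (v) Constants depend on `(d, L, a, α)` only.
(vi) `set_option maxHeartbeats 800000` on §A and §C, `400000` on §D's all-pairs theorem (as in the global files).  Literature + Mathlib only.
Nothing here is summit progress, continuum or Clay.  Unit `lit-balaban-p34` (literature-prover-lit-balaban-p34-g20-0), HOME
`run/shared/lean/pub/lit-balaban/`, 2026-08-23.  (Reader's note, NOT on p. 263: "`u` smooth NEAR `Ω`" below abbreviates the hypothesis (2.32)
in the tree's currency — plaquette smallness on the plaquettes based within `2L^k` of `Ω`; the display (2.33) defines the scale `p(e_k)`.)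
v1.1 (p34 gen 21, 2026-08-23): DOCFIX ONLY (referee ref-5 D-g73-1, pseudo-quote class): the sentence «Let the gauge field u be smooth near □ in
the sense described above», not on p. 263, removed from the quotation block above (the printed «Here (2.33) is our logarithmic scale for small
fields.» put in its place); «(2.27), and for (2.31)» → the printed «(2.27); for (2.31)».  Declarations untouched.
-/

open scoped BigOperators ComplexConjugate
open Finset Matrix

namespace Literature.MathematicalPhysics.QuantumFieldTheory.BalabanImbrieJaffe1984to88.BIJ88NeumannPropagatorSmoothNearRegionHolder

open Literature.MathematicalPhysics.QuantumFieldTheory.Balaban1983to89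
open LatticeFieldCalculus (supDist)
open B3TorusRadialSums (cdist cdist_le_supDist supDist_comm supDist_eq_sup_cdist supDist_eq_zero_iff cdist_neg cdist_le_val cdist_eq_zero_iff)
open BIJ85Ineq722Torus (supDist_triangle)
open BIJ88Sect3Statements (U1 toC cfg covD starB mem_starB norm_toC toC_one)
open BIJ88NeumannNoZeroModesTorus (IsBlockUnion)
open BIJ85BiCentredAxialGauge (centredGaugeDir)
open BIJ85TorusTentCutoff (supDist_shift_le_succ supDist_unshift_le_succ supDist_shift_le_one')
open BIJ88NeumannPropagatorSmoothNearRegion (dist1_centredGaugeDir_le_supDist_of_near dist1_centredGaugeDir_le_of_near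
  dist1_centredGaugeDir_le_min_of_near blockGauge_of_near plaqSmall_near_of_smoothOn)
open BIJ88Sect2Statements (SmoothOn)

noncomputable section

variable {P : Params}

section DerivMember

open BIJ85BlockAveragesTorus BIJ85BlockAveragesTorusK
open BIJ88NeumannPropagator227Torus (nOp gBox dN qMatK proj nOp_eq qMatK_apply qMatK_mulVec proj_mulVec)
open BIJ88NeumannPropagatorSmallFieldRegion (nOp_mulVec_gBox_mulVec gBox_mulVec_eq_zero_of_not_mem)
open BIJ88DeltaLoc234Torus (mulOp gBox_gaugeAct conjTranspose_mul_mulOp)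
open BIJ85CovariantHiggsDictionary (gram_dN_mulVec_apply_region)
open BIJ85ScalarPropagatorSupDecayDeriv (local_gradient_bound cfg_gaugeAct_apply norm_covDiff_gaugeAct dist1_plaqHol_le_of_plaqC
  two_mul_pow_le_sitesPerDir gamma_nsq_le_one)
open BIJ88NeumannPropagatorSmallFieldCubeDeriv (nOp_univ_mulVec_apply_eq_of_interior nOp_gaugeAct_mulVec_apply norm_covD_gBox_gaugeAct_mulVec
  norm_toC_plaqHol_gaugeAct_sub_one)
open BIJ88NeumannPropagatorSmallFieldRegionSup (decay110_smallField_region)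

/-! ## §0 Scalar bookkeeping (private copies of gen 17/18's arithmetic of the absorption step; the torus bookkeeping is r09's public
`BIJ85TorusTentCutoff.supDist_shift_le_succ` / `supDist_unshift_le_succ` / `supDist_shift_le_one'`) -/

/-- kernel: `min(A, B)/2 ≤ min(A, B/2)` for `A ≥ 0`. [folklore] -/
private theorem min_div_two_le {A B : ℝ} (hA : 0 ≤ A) : min A B / 2 ≤ min A (B / 2) := by
  rcases le_total A B with h | h
  · rw [min_eq_left h]; exact le_min (by linarith) (by linarith)
  · rw [min_eq_right h]; exact le_min (by linarith) (by linarith)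

/-- kernel: `min(A, B)/4 ≤ min(A, B/2 − 1)` for `A ≥ 0`, `B ≥ 4`. [folklore] -/
private theorem min_div_four_le {A B : ℝ} (hA : 0 ≤ A) (hB : 4 ≤ B) : min A B / 4 ≤ min A (B / 2 - 1) := by
  rcases le_total A B with h | h
  · rw [min_eq_left h]; exact le_min (by linarith) (by linarith)
  · rw [min_eq_right h]; exact le_min (by linarith) (by linarith)

/-- kernel: the weight `min(R, max(0, ρ))/R` lies in `[0, 1]` (`R > 0`). [folklore] -/
private theorem weight_mem {R ρ : ℝ} (hR : 0 < R) : 0 ≤ min R (max 0 ρ) / R ∧ min R (max 0 ρ) / R ≤ 1 :=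
  ⟨div_nonneg (le_min hR.le (le_max_left _ _)) hR.le, by rw [div_le_one hR]; exact min_le_left _ _⟩

/-- kernel: the ABSORPTION STEP — the local estimate `M·E/W ≤ C(F_loc ε²r + γr²·M_loc + (γr + 1/r + αε²(r+n))S)` with `F_loc = F·E·e`,
`M_loc = 2M·E·e/W`, `S = S₀·E` and the contraction `2C·e·γr² ≤ 1/2` give `M ≤ 2·C·W·(F·e·ε²r + (γr + 1/r + αε²(r+n))S₀)`. [folklore] -/
private theorem absorb_step {M E W e C F ε r γ S₀ α n : ℝ} (hE : 0 < E) (hW : 0 < W) (hM : 0 ≤ M) (hr : 0 < r)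
    (hκ : C * (γ * r ^ 2) * (2 * e) ≤ 1 / 2)
    (h : M * E / W ≤ C * ((F * E * e) * ε ^ 2 * r + γ * r ^ 2 * (2 * M * E * e / W) + γ * r * (S₀ * E) + (S₀ * E) / r +
      α * ε ^ 2 * (r + n) * (S₀ * E))) :
    M ≤ 2 * (C * W * (F * e * ε ^ 2 * r + (γ * r + 1 / r + α * ε ^ 2 * (r + n)) * S₀)) := by
  set A : ℝ := C * W * (F * e * ε ^ 2 * r + (γ * r + 1 / r + α * ε ^ 2 * (r + n)) * S₀) with hA
  have h2 : M = (M * E / W) * (W / E) := by field_simp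
  have h3 : C * ((F * E * e) * ε ^ 2 * r + γ * r ^ 2 * (2 * M * E * e / W) + γ * r * (S₀ * E) + (S₀ * E) / r +
      α * ε ^ 2 * (r + n) * (S₀ * E)) * (W / E) = A + (C * (γ * r ^ 2) * (2 * e)) * M := by
    rw [hA]; field_simp; ring
  have h4 : M * E / W * (W / E) ≤ C * ((F * E * e) * ε ^ 2 * r + γ * r ^ 2 * (2 * M * E * e / W) + γ * r * (S₀ * E) + (S₀ * E) / r +
      α * ε ^ 2 * (r + n) * (S₀ * E)) * (W / E) := mul_le_mul_of_nonneg_right h (by positivity)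
  rw [← h2, h3] at h4
  have h5 : (C * (γ * r ^ 2) * (2 * e)) * M ≤ (1 / 2) * M := mul_le_mul_of_nonneg_right hκ hM
  linarith

/-- kernel: the BUDGET of the absorbed terms — with `W ≤ 1`, `r ≤ cb·n ≤ n/8`, `γn² ≤ 1`, `W/r ≤ 8/(cb·n)`, `α·sp² ≤ a`, `sp = nε`:
`W·(F·e·ε²r + (γr + 1/r + αε²(r+n))·c_v·sp²·F·e³) ≤ K₁·nε²F`, `K₁ = e·cb + c_v e³(cb + 8/cb + 2a)`. [folklore] -/
private theorem budget_step {W F e ε r γ cb n c_v sp α a : ℝ} (hW1 : W ≤ 1) (hF : 0 ≤ F) (he : 0 ≤ e)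
    (hr : 0 < r) (hγ : 0 ≤ γ) (hcb : 0 < cb) (hn : 0 < n) (hcv : 0 ≤ c_v) (hα : 0 ≤ α) (ha : 0 ≤ a)
    (hrc : r ≤ cb * n) (hrn : r ≤ n / 8) (hγn : γ * n ^ 2 ≤ 1) (hWr : W / r ≤ 8 / (cb * n)) (hαa : α * sp ^ 2 ≤ a)
    (hsp : sp = n * ε) :
    W * (F * e * ε ^ 2 * r + (γ * r + 1 / r + α * ε ^ 2 * (r + n)) * (c_v * sp ^ 2 * F * e ^ 3)) ≤
      (e * cb + c_v * e ^ 3 * (cb + 8 / cb + 2 * a)) * (n * ε ^ 2 * F) := by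
  have hsp2 : sp ^ 2 = n ^ 2 * ε ^ 2 := by rw [hsp]; ring
  have q1 : W * (F * e * ε ^ 2 * r) ≤ (e * cb) * (n * ε ^ 2 * F) := by
    calc W * (F * e * ε ^ 2 * r) ≤ 1 * (F * e * ε ^ 2 * (cb * n)) := by gcongr
      _ = (e * cb) * (n * ε ^ 2 * F) := by ring
  have q2 : W * (γ * r * (c_v * sp ^ 2 * F * e ^ 3)) ≤ (c_v * e ^ 3 * cb) * (n * ε ^ 2 * F) := by
    have h1 : γ * r * n ^ 2 ≤ cb * n := by
      calc γ * r * n ^ 2 ≤ γ * (cb * n) * n ^ 2 := by gcongr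
        _ = cb * n * (γ * n ^ 2) := by ring
        _ ≤ cb * n * 1 := mul_le_mul_of_nonneg_left hγn (by positivity)
        _ = cb * n := mul_one _
    calc W * (γ * r * (c_v * sp ^ 2 * F * e ^ 3)) ≤ 1 * (γ * r * (c_v * sp ^ 2 * F * e ^ 3)) := by gcongr
      _ = (γ * r * n ^ 2) * (c_v * ε ^ 2 * F * e ^ 3) := by rw [hsp2]; ring
      _ ≤ (cb * n) * (c_v * ε ^ 2 * F * e ^ 3) := mul_le_mul_of_nonneg_right h1 (by positivity)
      _ = (c_v * e ^ 3 * cb) * (n * ε ^ 2 * F) := by ring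
  have q3 : W * (1 / r * (c_v * sp ^ 2 * F * e ^ 3)) ≤ (c_v * e ^ 3 * (8 / cb)) * (n * ε ^ 2 * F) := by
    have h3 : W / r * n ^ 2 ≤ (8 / cb) * n := by
      calc W / r * n ^ 2 ≤ (8 / (cb * n)) * n ^ 2 := mul_le_mul_of_nonneg_right hWr (by positivity)
        _ = (8 / cb) * n := by field_simp
    calc W * (1 / r * (c_v * sp ^ 2 * F * e ^ 3)) = (W / r * n ^ 2) * (c_v * ε ^ 2 * F * e ^ 3) := by rw [hsp2]; ring
      _ ≤ ((8 / cb) * n) * (c_v * ε ^ 2 * F * e ^ 3) := mul_le_mul_of_nonneg_right h3 (by positivity)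
      _ = (c_v * e ^ 3 * (8 / cb)) * (n * ε ^ 2 * F) := by ring
  have q4 : W * (α * ε ^ 2 * (r + n) * (c_v * sp ^ 2 * F * e ^ 3)) ≤ (c_v * e ^ 3 * (2 * a)) * (n * ε ^ 2 * F) := by
    have h1 : r + n ≤ 2 * n := by linarith
    calc W * (α * ε ^ 2 * (r + n) * (c_v * sp ^ 2 * F * e ^ 3)) ≤ 1 * (α * ε ^ 2 * (r + n) * (c_v * sp ^ 2 * F * e ^ 3)) := by gcongr
      _ = (α * sp ^ 2) * (r + n) * (c_v * ε ^ 2 * F * e ^ 3) := by ring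
      _ ≤ a * (2 * n) * (c_v * ε ^ 2 * F * e ^ 3) := by gcongr
      _ = (c_v * e ^ 3 * (2 * a)) * (n * ε ^ 2 * F) := by ring
  have hexp : W * (F * e * ε ^ 2 * r + (γ * r + 1 / r + α * ε ^ 2 * (r + n)) * (c_v * sp ^ 2 * F * e ^ 3))
      = W * (F * e * ε ^ 2 * r) + W * (γ * r * (c_v * sp ^ 2 * F * e ^ 3)) + W * (1 / r * (c_v * sp ^ 2 * F * e ^ 3)) +
        W * (α * ε ^ 2 * (r + n) * (c_v * sp ^ 2 * F * e ^ 3)) := by ring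
  have hK : (e * cb + c_v * e ^ 3 * (cb + 8 / cb + 2 * a)) * (n * ε ^ 2 * F) = (e * cb) * (n * ε ^ 2 * F) +
      (c_v * e ^ 3 * cb) * (n * ε ^ 2 * F) + (c_v * e ^ 3 * (8 / cb)) * (n * ε ^ 2 * F) + (c_v * e ^ 3 * (2 * a)) * (n * ε ^ 2 * F) := by
    ring
  rw [hexp, hK]; linarith [q1, q2, q3, q4]

/-- kernel: the SHALLOW-BOND budget — `(8/rm)·(2e·c_v·sp²·F) ≤ (32e·c_v/cb)·nε²F` when `rm ≥ cb·n/2`, `sp = nε`. [folklore] -/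
private theorem shallow_step {rm cb n e c_v sp ε F : ℝ} (hrm : 0 < rm) (hcb : 0 < cb) (hn : 0 < n) (he : 0 ≤ e) (hcv : 0 ≤ c_v)
    (hF : 0 ≤ F) (hrm2 : cb * n / 2 ≤ rm) (hsp : sp = n * ε) :
    (8 / rm) * (2 * e * c_v * sp ^ 2 * F) ≤ (32 * e * c_v / cb) * (n * ε ^ 2 * F) := by
  have hsp2 : sp ^ 2 = n ^ 2 * ε ^ 2 := by rw [hsp]; ring
  have h4 : 8 / rm * n ≤ 16 / cb := by
    rw [div_mul_eq_mul_div, div_le_div_iff₀ hrm hcb]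
    nlinarith [hrm2, hn.le, hcb.le]
  have h5 : 0 ≤ 2 * e * c_v * (n * ε ^ 2 * F) := by positivity
  calc 8 / rm * (2 * e * c_v * sp ^ 2 * F) = (8 / rm * n) * (2 * e * c_v * (n * ε ^ 2 * F)) := by rw [hsp2]; ring
    _ ≤ (16 / cb) * (2 * e * c_v * (n * ε ^ 2 * F)) := mul_le_mul_of_nonneg_right h4 h5
    _ = (32 * e * c_v / cb) * (n * ε ^ 2 * F) := by ring



/-! ## §A [6] (1.10), covariant-derivative member in OPERATOR form at the `L^k`-deep bonds of a GENERAL `k`-block union, under plaquette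
smallness NEAR `Ω` only -/

set_option maxHeartbeats 800000 in
/-- **[Balaban1983RegularityDecay] Thm p.573 (1.10), COVARIANT-DERIVATIVE MEMBER IN OPERATOR FORM for the region propagator `G_k(Ω,u)` of
[BalabanImbrieJaffe1988] (2.27)/(2.31) on a GENERAL `k`-block union `Ω`, at the `L^k`-deep bonds, when the `U(1)` gauge field is smooth ONLY
NEAR `Ω`** ([BalabanImbrieJaffe1988] (2.32) p.263 *"in a neighborhood of each □_α … throughout the subset Ω"*; [I] p.326 *"by change of gauge
u_k can be transformed in a local region Λ into … exp[ie_kηA], where A is smooth and small"*): p34 gen 18's `decay110_smallField_region_deriv`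
VERBATIM except that the plaquette hypothesis is assumed only on the plaquettes based within `2L^k` of `Ω` — `∀ p, (∃ y ∈ Ω, |y − p.src|_∞ ≤
2L^k) → ‖u(∂p) − 1‖ ≤ θ` (the local tree gauge of the proof, of radius `2r ≤ L^k/4` about a point of `Ω`, reads only those:
`dist1_centredGaugeDir_le_supDist_of_near`).  For `P.d = d + 1 ≤ 3`, `P.L = L` odd `> 1`, `a > 0` there are `t₀, c₁ > 0` depending only on
`(d, L, a)` such that for `1 ≤ k ≤ K`, every `k`-block union `Ω`, every `u` with that local plaquette bound, `2(d+1)³(L^{2k}θ)² ≤ 1`, the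
bondwise `(T, δ)` hypotheses inside `Ω` with `2(L^k−1)L^k(d+1)T² + 2δ² ≤ 1/2`, every `f` with `‖f‖_∞ ≤ F` supported at sup-distance `≥ D`
from `x`, and every bond `⟨x, x+e_μ⟩` with `dist(x, Ωᶜ) ≥ L^k`:
`‖(D_uG_k(Ω,u)f)(⟨x, μ⟩)‖ ≤ c₁·(L^kε)·e^{−t₀D/L^k}·F`.
[cite: Balaban1983RegularityDecay, Thm p.573 (1.10)] [cite: BalabanImbrieJaffe1988, (2.31)/(2.32) p.263] [cite: BalabanImbrieJaffe1985, p.326] -/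
theorem decay110_smoothNear_region_deriv (d L : ℕ) (hd1 : 1 ≤ d) (hd3 : d + 1 ≤ 3) (hL : Odd L ∧ 1 < L) {a : ℝ} (ha : 0 < a) :
    ∃ t₀ c₁ : ℝ, 0 < t₀ ∧ 0 < c₁ ∧ ∀ (P : Params), P.d = d + 1 → P.L = L →
      ∀ k : ℕ, 1 ≤ k → k ≤ P.K → ∀ Ω : Finset (Balaban1983to89.Site P 0), IsBlockUnion k Ω →
        ∀ (U : GaugeField P 0 U1) (θ T δ : ℝ), 0 ≤ θ →
          (∀ p : Balaban1983to89.Plaq P 0, (∃ y ∈ Ω, supDist y p.src ≤ 2 * P.L ^ k) → ‖toC (GaugeField.plaqHol U p) - 1‖ ≤ θ) →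
          2 * (P.d : ℝ) ^ 3 * (((P.L : ℝ) ^ k) ^ 2 * θ) ^ 2 ≤ 1 →
          (∀ b ∈ starB Ω, blkIter k b.src = blkIter k b.tgt → ‖toC (U b) - 1‖ ≤ T) →
          (∀ y ∈ Ω, ‖holCK U k y - 1‖ ≤ δ) →
          2 * (((P.L : ℝ) ^ k - 1) * (P.L : ℝ) ^ k) * P.d * T ^ 2 + 2 * δ ^ 2 ≤ 1 / 2 →
          ∀ (x : Balaban1983to89.Site P 0) (μ : Fin P.d) (f : Balaban1983to89.Site P 0 → ℂ) (F D : ℝ),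
            (∀ z, ‖f z‖ ≤ F) → (∀ z, f z ≠ 0 → D ≤ (supDist x z : ℝ)) →
            (∀ w, w ∉ Ω → P.L ^ k ≤ supDist x w) →
            ‖covD P.eps⁻¹ (cfg U) (gBox (B1RG242Torus.α P a k * (P.L : ℝ) ^ (k * P.d)) P.eps⁻¹ U k Ω *ᵥ f) ⟨x, μ⟩‖
              ≤ c₁ * P.spacing k * Real.exp (-(t₀ * D / (P.L : ℝ) ^ k)) * F := by
  classical
  obtain ⟨t₁, c_v, ht₁, hc_v, hval⟩ := decay110_smallField_region d (L - 1) hd3 (by omega) ha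
  obtain ⟨C_K, hCK, hker⟩ := BIJ85FlatPropagatorKernelDiffs.flat_kernel_diffs (d + 1) L (by omega) hL ha (le_refl (0 : ℝ))
  obtain ⟨C_L, hCL, hloc⟩ := local_gradient_bound (d + 1) (by omega) C_K hCK.le
  -- the rate, the ball fraction and the constant
  set t : ℝ := min t₁ 1 with htdef
  have ht : 0 < t := lt_min ht₁ one_pos
  have ht1 : t ≤ 1 := min_le_right _ _
  have htt₁ : t ≤ t₁ := min_le_left _ _
  set e : ℝ := Real.exp 1 with hedef
  have he1 : 1 ≤ e := by rw [hedef]; exact Real.one_le_exp (by norm_num)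
  have he0 : 0 < e := Real.exp_pos 1
  set cb : ℝ := min (1 / 8) (1 / (4 * (C_L * e + 1))) with hcbdef
  have hc0 : 0 < cb := lt_min (by norm_num) (by positivity)
  have hc8 : cb ≤ 1 / 8 := min_le_left _ _
  have hc1 : cb ≤ 1 := hc8.trans (by norm_num)
  have hcC : C_L * e * cb ≤ 1 / 4 := by
    have h1 : cb ≤ 1 / (4 * (C_L * e + 1)) := min_le_right _ _
    have h2 : 0 ≤ C_L * e := by positivity
    calc C_L * e * cb ≤ C_L * e * (1 / (4 * (C_L * e + 1))) := mul_le_mul_of_nonneg_left h1 h2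
      _ ≤ 1 / 4 := by rw [mul_one_div, div_le_iff₀ (by positivity)]; linarith
  set K₁ : ℝ := e * cb + c_v * e ^ 3 * (cb + 8 / cb + 2 * a) with hK₁
  have hK₁0 : 0 ≤ K₁ := by positivity
  refine ⟨t, 2 * C_L * K₁ + 32 * e * c_v / cb + 1, ht, by positivity, ?_⟩
  intro P hPd hPL k hk1 hkK Q hΩ U θ T δ hθ0 hplaq hsmall hInt hTree hsmallT x μ f F D hF hsupp hdeep
  have hk : k ≤ P.m + P.K := hkK.trans (Nat.le_add_left _ _)
  have hPL' : P.L = L - 1 + 1 := by omega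
  have hvalP := hval P hPd hPL' k hk1 hk Q hΩ U T δ hInt hTree hsmallT
  have hkerP := hker P hPd hPL k hk1 hkK
  -- basic quantities
  have hd1' : 1 ≤ P.d := by omega
  have hk0 : 0 + k ≤ P.m + P.K := by omega
  have hLpos : (0 : ℝ) < P.L := P.cast_L_pos
  have hL1 : (1 : ℝ) < P.L := B1RG242Torus.one_lt_cast_L P
  have hε : 0 < P.eps := P.eps_pos
  set n : ℝ := (P.L : ℝ) ^ k with hndef
  have hn : 0 < n := pow_pos hLpos k
  have hn1 : 1 ≤ n := one_le_pow₀ hL1.le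
  have hncast : ((P.L ^ k : ℕ) : ℝ) = n := by rw [hndef]; push_cast; rfl
  have hn3 : 3 ≤ n := by
    have h3 : 3 ≤ P.L := by
      obtain ⟨hodd, hlt⟩ := hL
      rw [hPL]
      rcases hodd with ⟨m, hm⟩
      omega
    have h3' : (3 : ℝ) ≤ P.L := by exact_mod_cast h3
    calc (3 : ℝ) = 3 ^ 1 := by norm_num
      _ ≤ (P.L : ℝ) ^ 1 := by gcongr
      _ ≤ (P.L : ℝ) ^ k := pow_le_pow_right₀ hL1.le hk1
  have hsp : P.spacing k = n * P.eps := rfl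
  have hsp0 : 0 < P.spacing k := P.spacing_pos k
  have hα : 0 < B1RG242Torus.α P a k := mul_pos (B1.aSeq_pos ha hL1 hk1) (inv_pos.2 (pow_pos hsp0 2))
  have hαa : B1RG242Torus.α P a k * P.spacing k ^ 2 ≤ a := by
    show B1.aSeq a P.L k * (P.spacing k ^ 2)⁻¹ * P.spacing k ^ 2 ≤ a
    rw [inv_mul_cancel_right₀ (pow_ne_zero 2 hsp0.ne')]
    exact B1.aSeq_le ha hL1 k hk1
  set a' : ℝ := B1RG242Torus.α P a k * (P.L : ℝ) ^ (k * P.d) with ha'def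
  have ha' : 0 < a' := mul_pos hα (pow_pos hLpos _)
  have hc' : P.eps⁻¹ ≠ 0 := inv_ne_zero hε.ne'
  have hF0 : 0 ≤ F := (norm_nonneg _).trans (hF x)
  set φ := gBox a' P.eps⁻¹ U k Q *ᵥ f with hφ
  have hexpD : ∀ {D₁ D₂ : ℝ}, D₂ ≤ D₁ → Real.exp (-(t * D₁ / n)) ≤ Real.exp (-(t * D₂ / n)) := fun h =>
    Real.exp_le_exp.2 (by rw [neg_le_neg_iff]; exact div_le_div_of_nonneg_right (mul_le_mul_of_nonneg_left h ht.le) hn.le)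
  have hexp_t₁ : ∀ {D' : ℝ}, 0 ≤ D' → Real.exp (-(t₁ * D' / n)) ≤ Real.exp (-(t * D' / n)) := fun hD' =>
    Real.exp_le_exp.2 (by rw [neg_le_neg_iff]; exact div_le_div_of_nonneg_right (mul_le_mul_of_nonneg_right htt₁ hD') hn.le)
  -- the target, spelled out
  have hgoal : ‖covD P.eps⁻¹ (cfg U) φ ⟨x, μ⟩‖ = P.eps⁻¹ * ‖cfg U ⟨x, μ⟩ * φ (x.shift μ) - φ x‖ := by
    show ‖((P.eps⁻¹ : ℝ) : ℂ) * (cfg U ⟨x, μ⟩ * φ (x.shift μ) - φ x)‖ = _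
    rw [norm_mul, Complex.norm_real, Real.norm_of_nonneg (inv_nonneg.2 hε.le)]
  rw [hgoal]
  -- two values of `φ` bound a covariant difference: `‖u_bφ(b₊) − φ(b₋)‖ ≤ 2e·c_v·(L^kε)²e^{−tD_y/n}F` at any bond `⟨y, y+e_ν⟩` when `f`
  -- vanishes within `D_y` of `y`
  have htwo : ∀ (y : Balaban1983to89.Site P 0) (ν : Fin P.d) (Dy : ℝ), (∀ z, f z ≠ 0 → Dy ≤ (supDist y z : ℝ)) →
      ‖cfg U ⟨y, ν⟩ * φ (y.shift ν) - φ y‖ ≤ 2 * e * c_v * P.spacing k ^ 2 * Real.exp (-(t * Dy / n)) * F := by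
    intro y ν Dy hsy
    have hφy : ‖φ y‖ ≤ c_v * P.spacing k ^ 2 * Real.exp (-(t * Dy / n)) * F := by
      have h1 := hvalP y f F (max Dy 0) hF (fun z hz => max_le (hsy z hz) (Nat.cast_nonneg _))
      refine h1.trans ?_
      have h2 : Real.exp (-(t₁ * max Dy 0 / n)) ≤ Real.exp (-(t * Dy / n)) := (hexp_t₁ (le_max_right _ _)).trans (hexpD (le_max_left _ _))
      gcongr
    have hφy' : ‖φ (y.shift ν)‖ ≤ c_v * P.spacing k ^ 2 * (e * Real.exp (-(t * Dy / n))) * F := by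
      have h1 := hvalP (y.shift ν) f F (max (Dy - 1) 0) hF (fun z hz => ?_)
      · refine h1.trans ?_
        have h2 : Real.exp (-(t₁ * max (Dy - 1) 0 / n)) ≤ e * Real.exp (-(t * Dy / n)) := by
          refine ((hexp_t₁ (le_max_right _ _)).trans (hexpD (le_max_left _ _))).trans ?_
          rw [hedef, ← Real.exp_add]
          refine Real.exp_le_exp.2 ?_
          rw [show -(t * (Dy - 1) / n) = -(t * Dy / n) + t / n by ring]
          have : t / n ≤ 1 := by rw [div_le_one hn]; exact ht1.trans hn1
          linarith only [this]
        gcongr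
      · have h3 := hsy z hz
        have h4 : supDist y z ≤ supDist y (y.shift ν) + supDist (y.shift ν) z := supDist_triangle y (y.shift ν) z
        have h5 := supDist_shift_le_one' y ν
        have h6 : (supDist y z : ℝ) ≤ 1 + supDist (y.shift ν) z := by
          have : ((supDist y z : ℕ) : ℝ) ≤ ((supDist y (y.shift ν) + supDist (y.shift ν) z : ℕ) : ℝ) := by exact_mod_cast h4
          have h5' : ((supDist y (y.shift ν) : ℕ) : ℝ) ≤ 1 := by exact_mod_cast h5
          push_cast at this; linarith only [this, h5']
        exact max_le (by linarith only [h3, h6]) (Nat.cast_nonneg _)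
    refine (norm_sub_le _ _).trans ?_
    rw [norm_mul, show ‖cfg U ⟨y, ν⟩‖ = 1 from norm_toC _, one_mul]
    have hE : 0 ≤ Real.exp (-(t * Dy / n)) := (Real.exp_pos _).le
    have e1x : c_v * P.spacing k ^ 2 * Real.exp (-(t * Dy / n)) * F ≤ c_v * P.spacing k ^ 2 * (e * Real.exp (-(t * Dy / n))) * F := by
      have : Real.exp (-(t * Dy / n)) ≤ e * Real.exp (-(t * Dy / n)) := le_mul_of_one_le_left hE he1
      gcongr
    linarith only [hφy, hφy', e1x]
  -- the radius of record of the interior estimate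
  set rm : ℕ := ⌊cb * n⌋₊ with hrmdef
  have hrmc : (rm : ℝ) ≤ cb * n := Nat.floor_le (by positivity)
  by_cases hrm4 : rm < 4
  · ----------------------------------------------------------------------------------------------------------------
    -- SMALL CASE `cb·L^k < 4`: the trivial bound by two values of `φ`
    have hn4 : n < 4 / cb := by
      have h1 : cb * n < rm + 1 := Nat.lt_floor_add_one _
      have h2 : (rm : ℝ) + 1 ≤ 4 := by exact_mod_cast hrm4
      rw [lt_div_iff₀ hc0]; linarith only [h1, h2]
    have hδ := htwo x μ D hsupp
    have hcoef : 2 * e * c_v * n ≤ 32 * e * c_v / cb := by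
      rw [show 32 * e * c_v / cb = 2 * e * c_v * (16 / cb) by ring]
      refine mul_le_mul_of_nonneg_left ?_ (by positivity)
      have : 4 / cb ≤ 16 / cb := div_le_div_of_nonneg_right (by norm_num) hc0.le
      linarith only [this, hn4]
    calc P.eps⁻¹ * ‖cfg U ⟨x, μ⟩ * φ (x.shift μ) - φ x‖ ≤ P.eps⁻¹ * (2 * e * c_v * P.spacing k ^ 2 * Real.exp (-(t * D / n)) * F) :=
          mul_le_mul_of_nonneg_left hδ (inv_nonneg.2 hε.le)
      _ = (2 * e * c_v * n) * P.spacing k * Real.exp (-(t * D / n)) * F := by rw [hsp]; field_simp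
      _ ≤ (32 * e * c_v / cb) * P.spacing k * Real.exp (-(t * D / n)) * F := by gcongr
      _ ≤ _ := mul_le_mul_of_nonneg_right (mul_le_mul_of_nonneg_right (mul_le_mul_of_nonneg_right
          (by linarith only [show (0 : ℝ) ≤ 2 * C_L * K₁ by positivity]) hsp0.le) (Real.exp_pos _).le) hF0
  ----------------------------------------------------------------------------------------------------------------
  -- MAIN CASE `rm = ⌊cb·L^k⌋ ≥ 4`
  push Not at hrm4
  have hrm0 : (0 : ℝ) < rm := by exact_mod_cast (show 0 < rm by omega)
  have hcn4 : 4 ≤ cb * n := le_trans (by exact_mod_cast hrm4) hrmc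
  have hrm2 : cb * n / 2 ≤ rm := by have h1 : cb * n < rm + 1 := Nat.lt_floor_add_one _; linarith only [h1, hcn4]
  have hrmn : (rm : ℝ) ≤ n / 8 := hrmc.trans (by have := mul_le_mul_of_nonneg_right hc8 hn.le; linarith only [this])
  -- the trivial sub-case `f = 0`
  by_cases hf0 : ∀ z, f z = 0
  · have hφ0 : φ = 0 := by rw [hφ, show f = 0 from funext hf0, mulVec_zero]
    rw [hφ0]; simp only [Pi.zero_apply, mul_zero, sub_zero, norm_zero, mul_zero]
    positivity
  push Not at hf0
  -- the distance to the support
  set supp : Finset (Balaban1983to89.Site P 0) := univ.filter fun w => f w ≠ 0 with hsuppdef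
  have hne : supp.Nonempty := by obtain ⟨w, hw⟩ := hf0; exact ⟨w, by rw [hsuppdef, mem_filter]; exact ⟨mem_univ _, hw⟩⟩
  have hmem : ∀ {w}, f w ≠ 0 → w ∈ supp := fun hw => by rw [hsuppdef, mem_filter]; exact ⟨mem_univ _, hw⟩
  set Df : Balaban1983to89.Site P 0 → ℕ := fun z => supp.inf' hne fun w => supDist z w with hDf
  have hDf_le : ∀ z w, f w ≠ 0 → Df z ≤ supDist z w := fun z w hw => Finset.inf'_le _ (hmem hw)
  have hDf_ex : ∀ z, ∃ w, f w ≠ 0 ∧ Df z = supDist z w := fun z => by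
    obtain ⟨w, hw, h⟩ := Finset.exists_mem_eq_inf' hne (fun w => supDist z w)
    rw [hsuppdef, mem_filter] at hw
    exact ⟨w, hw.2, h⟩
  have hDf_tri : ∀ y z, Df y ≤ supDist y z + Df z := fun y z => by
    obtain ⟨w, hw, h⟩ := hDf_ex z
    rw [h]
    exact (hDf_le y w hw).trans (supDist_triangle y z w)
  -- the depth in the cube (distance to the complement; `L^k` if the complement is empty)
  set Qc : Finset (Balaban1983to89.Site P 0) := univ.filter fun w => w ∉ Q with hQcdef
  set dep : Balaban1983to89.Site P 0 → ℕ := fun z => if hq : Qc.Nonempty then Qc.inf' hq (fun w => supDist z w) else P.L ^ k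
    with hdepdef
  have hdep_app : ∀ z, dep z = if hq : Qc.Nonempty then Qc.inf' hq (fun w => supDist z w) else P.L ^ k := fun z => rfl
  have hdep_le : ∀ z w, w ∉ Q → dep z ≤ supDist z w := by
    intro z w hw
    have hwQc : w ∈ Qc := by rw [hQcdef, mem_filter]; exact ⟨mem_univ _, hw⟩
    have hq : Qc.Nonempty := ⟨w, hwQc⟩
    rw [hdep_app, dif_pos hq]
    exact Finset.inf'_le _ hwQc
  have hdep_in : ∀ z w, supDist z w < dep z → w ∈ Q := fun z w h => by
    by_contra hw
    exact absurd (hdep_le z w hw) (not_le.2 h)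
  have hdep_tri : ∀ y z, dep y ≤ supDist y z + dep z := by
    intro y z
    by_cases hq : Qc.Nonempty
    · obtain ⟨w, hw, h⟩ := Finset.exists_mem_eq_inf' hq (fun w => supDist z w)
      have hwQ : w ∉ Q := by rw [hQcdef, mem_filter] at hw; exact hw.2
      have h1 : dep z = supDist z w := by rw [hdep_app, dif_pos hq]; exact h
      rw [h1]
      exact (hdep_le y w hwQ).trans (supDist_triangle y z w)
    · rw [hdep_app y, hdep_app z, dif_neg hq, dif_neg hq]; omega
  have hdep_x : (n : ℝ) ≤ dep x := by
    rw [← hncast]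
    have h1 : P.L ^ k ≤ dep x := by
      by_cases hq : Qc.Nonempty
      · rw [hdep_app, dif_pos hq]
        refine Finset.le_inf' _ _ fun w hw => hdeep w ?_
        rw [hQcdef, mem_filter] at hw; exact hw.2
      · rw [hdep_app, dif_neg hq]
    exact_mod_cast h1
  -- the admissible half-radius `ρ(z) = (depth − 2)/2` and the depth weight `W(z) = min(rm, max(0, ρ))/rm`
  set ρf : Balaban1983to89.Site P 0 → ℝ := fun z => ((dep z : ℝ) - 2) / 2 with hρfdef
  have hρf_app : ∀ z, ρf z = ((dep z : ℝ) - 2) / 2 := fun z => rfl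
  set W : Balaban1983to89.Site P 0 → ℝ := fun z => min (rm : ℝ) (max 0 (ρf z)) / rm with hWdef
  have hW_app : ∀ z, W z = min (rm : ℝ) (max 0 (ρf z)) / rm := fun z => rfl
  have hW01 : ∀ z, 0 ≤ W z ∧ W z ≤ 1 := fun z => by rw [hW_app]; exact weight_mem hrm0
  -- the weighted maximum over bonds
  set g : PBond P 0 → ℝ := fun b => W b.src * (Real.exp (t * Df b.src / n) * ‖cfg U b * φ b.tgt - φ b.src‖) with hgdef
  have hg_app : ∀ (z : Balaban1983to89.Site P 0) (ν : Fin P.d),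
      g ⟨z, ν⟩ = W z * (Real.exp (t * Df z / n) * ‖cfg U ⟨z, ν⟩ * φ (z.shift ν) - φ z‖) := fun z ν => rfl
  obtain ⟨b₀, -, hb₀⟩ := exists_max_image (univ : Finset (PBond P 0)) g ⟨⟨x, μ⟩, mem_univ _⟩
  obtain ⟨y₀, μ₀⟩ := b₀
  set Mx : ℝ := g ⟨y₀, μ₀⟩ with hMxdef
  have hMb : ∀ (z : Balaban1983to89.Site P 0) (ν : Fin P.d), g ⟨z, ν⟩ ≤ Mx := fun z ν => hb₀ ⟨z, ν⟩ (mem_univ _)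
  have hMxeq : Mx = W y₀ * (Real.exp (t * Df y₀ / n) * ‖cfg U ⟨y₀, μ₀⟩ * φ (y₀.shift μ₀) - φ y₀‖) := by rw [hMxdef, hg_app]
  have hM0 : 0 ≤ Mx := by rw [hMxeq]; exact mul_nonneg (hW01 _).1 (by positivity)
  -- how the weighted maximum controls a covariant difference
  have hMuse : ∀ (z : Balaban1983to89.Site P 0) (ν : Fin P.d),
      W z * ‖cfg U ⟨z, ν⟩ * φ (z.shift ν) - φ z‖ ≤ Mx * Real.exp (-(t * Df z / n)) := by
    intro z ν
    have h1 := hMb z ν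
    rw [hg_app] at h1
    have h2 : Real.exp (t * Df z / n) * Real.exp (-(t * Df z / n)) = 1 := by rw [← Real.exp_add, add_neg_cancel, Real.exp_zero]
    calc W z * ‖cfg U ⟨z, ν⟩ * φ (z.shift ν) - φ z‖
        = W z * ‖cfg U ⟨z, ν⟩ * φ (z.shift ν) - φ z‖ * (Real.exp (t * Df z / n) * Real.exp (-(t * Df z / n))) := by
          rw [h2, mul_one]
      _ = (W z * (Real.exp (t * Df z / n) * ‖cfg U ⟨z, ν⟩ * φ (z.shift ν) - φ z‖)) * Real.exp (-(t * Df z / n)) := by ring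
      _ ≤ Mx * Real.exp (-(t * Df z / n)) := mul_le_mul_of_nonneg_right h1 (Real.exp_pos _).le
  -- REDUCTION: it suffices to bound the weighted maximum, `Mx ≤ C·L^kε²F`, since the weight of the target bond is `1`
  have hWx : W x = 1 := by
    have hρx : (rm : ℝ) ≤ ρf x := by
      rw [hρf_app, le_div_iff₀ (by norm_num : (0:ℝ) < 2)]
      linarith only [hdep_x, hrmn, hn3]
    rw [hW_app, max_eq_right (hrm0.le.trans hρx), min_eq_left hρx, div_self hrm0.ne']
  have hDx : D ≤ (Df x : ℝ) := by
    obtain ⟨w, hw, h⟩ := hDf_ex x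
    rw [h]; exact hsupp w hw
  suffices hMfin : Mx ≤ (2 * C_L * K₁ + 32 * e * c_v / cb) * (n * P.eps ^ 2 * F) by
    have hδx : ‖cfg U ⟨x, μ⟩ * φ (x.shift μ) - φ x‖ ≤
        (2 * C_L * K₁ + 32 * e * c_v / cb) * (n * P.eps ^ 2 * F) * Real.exp (-(t * D / n)) := by
      have h1 := hMuse x μ
      rw [hWx, one_mul] at h1
      exact h1.trans (mul_le_mul hMfin (hexpD hDx) (Real.exp_pos _).le (by positivity))
    calc P.eps⁻¹ * ‖cfg U ⟨x, μ⟩ * φ (x.shift μ) - φ x‖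
        ≤ P.eps⁻¹ * ((2 * C_L * K₁ + 32 * e * c_v / cb) * (n * P.eps ^ 2 * F) * Real.exp (-(t * D / n))) :=
          mul_le_mul_of_nonneg_left hδx (inv_nonneg.2 hε.le)
      _ = (2 * C_L * K₁ + 32 * e * c_v / cb) * P.spacing k * Real.exp (-(t * D / n)) * F := by rw [hsp]; field_simp
      _ ≤ _ := mul_le_mul_of_nonneg_right (mul_le_mul_of_nonneg_right (mul_le_mul_of_nonneg_right (lt_add_one _).le hsp0.le)
          (Real.exp_pos _).le) hF0
  ----------------------------------------------------------------------------------------------------------------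
  -- THE BOUND ON THE WEIGHTED MAXIMUM, at the maximal bond `⟨y₀, y₀ + e_{μ₀}⟩`
  set D₀ : ℝ := (Df y₀ : ℝ) with hD₀
  set E : ℝ := Real.exp (-(t * D₀ / n)) with hEdef
  have hE0 : 0 < E := Real.exp_pos _
  have hEinv : Real.exp (t * D₀ / n) * E = 1 := by rw [hEdef, ← Real.exp_add, add_neg_cancel, Real.exp_zero]
  set W₀ : ℝ := W y₀ with hW₀def
  have hW₀_app : W₀ = min (rm : ℝ) (max 0 (ρf y₀)) / rm := hW_app y₀
  set ρ₀ : ℝ := ρf y₀ with hρ₀def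
  have hρ₀_app : ρ₀ = ((dep y₀ : ℝ) - 2) / 2 := hρf_app y₀
  by_cases hρ8 : ρ₀ < 8
  · ----------------------------------------------------------------------------------------------------------------
    -- SHALLOW MAXIMAL BOND (depth `< 18`): weight `< 8/rm ≤ 16/(cb·n)`, two values of `φ`
    have hW₀le : W₀ ≤ 8 / rm := by
      rw [hW₀_app]
      refine div_le_div_of_nonneg_right ((min_le_right _ _).trans (max_le (by norm_num) hρ8.le)) hrm0.le
    have hδ₀ := htwo y₀ μ₀ D₀ (fun z hz => by rw [hD₀]; exact_mod_cast hDf_le y₀ z hz)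
    have h1 : Mx ≤ (8 / rm) * (2 * e * c_v * P.spacing k ^ 2 * F) := by
      rw [hMxeq]
      have h2 : Real.exp (t * D₀ / n) * ‖cfg U ⟨y₀, μ₀⟩ * φ (y₀.shift μ₀) - φ y₀‖ ≤ 2 * e * c_v * P.spacing k ^ 2 * F := by
        calc Real.exp (t * D₀ / n) * ‖cfg U ⟨y₀, μ₀⟩ * φ (y₀.shift μ₀) - φ y₀‖
            ≤ Real.exp (t * D₀ / n) * (2 * e * c_v * P.spacing k ^ 2 * Real.exp (-(t * D₀ / n)) * F) :=
              mul_le_mul_of_nonneg_left hδ₀ (Real.exp_pos _).le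
          _ = 2 * e * c_v * P.spacing k ^ 2 * F * (Real.exp (t * D₀ / n) * E) := by rw [hEdef]; ring
          _ = 2 * e * c_v * P.spacing k ^ 2 * F := by rw [hEinv, mul_one]
      exact mul_le_mul hW₀le h2 (by positivity) (by positivity)
    have h3 := shallow_step (sp := P.spacing k) hrm0 hc0 hn he0.le hc_v.le hF0 hrm2 hsp
    have h6 : 0 ≤ 2 * C_L * K₁ * (n * P.eps ^ 2 * F) := by positivity
    linarith only [h1, h3, h6]
  ----------------------------------------------------------------------------------------------------------------
  -- DEEP MAXIMAL BOND (`ρ₀ ≥ 8`): the interior estimate on the ball of half the admissible radius, and absorption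
  push Not at hρ8
  have hρ₀0 : 0 ≤ ρ₀ := by linarith only [hρ8]
  have hW₀pos : 0 < W₀ := by
    rw [hW₀_app]
    exact div_pos (lt_min hrm0 (lt_max_of_lt_right (by linarith only [hρ8]))) hrm0
  have hW₀1 : W₀ ≤ 1 := (hW01 y₀).2
  have hdep₀ : (18 : ℝ) ≤ dep y₀ := by linarith only [hρ8, hρ₀_app]
  -- the working radius `r = min(rm, ⌊ρ₀/2⌋)`
  set r : ℕ := min rm ⌊ρ₀ / 2⌋₊ with hrdef
  have hfl : (⌊ρ₀ / 2⌋₊ : ℝ) ≤ ρ₀ / 2 := Nat.floor_le (by positivity)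
  have hfl' : ρ₀ / 2 - 1 ≤ (⌊ρ₀ / 2⌋₊ : ℝ) := by have := Nat.lt_floor_add_one (ρ₀ / 2); linarith only [this]
  have hfl4 : 4 ≤ ⌊ρ₀ / 2⌋₊ := Nat.le_floor (by push_cast; linarith only [hρ8])
  have hr4 : 4 ≤ r := le_min hrm4 hfl4
  have hr0 : (0 : ℝ) < r := by exact_mod_cast (show 0 < r by omega)
  have hrrm : r ≤ rm := min_le_left _ _
  have hrrmR : (r : ℝ) ≤ rm := by exact_mod_cast hrrm
  have hrc : (r : ℝ) ≤ cb * n := hrrmR.trans hrmc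
  have hrn : (r : ℝ) ≤ n / 8 := hrrmR.trans hrmn
  have hrρ : (r : ℝ) ≤ ρ₀ / 2 := by
    have h1 : (r : ℝ) ≤ (⌊ρ₀ / 2⌋₊ : ℝ) := by exact_mod_cast (min_le_right _ _ : r ≤ ⌊ρ₀ / 2⌋₊)
    exact h1.trans hfl
  have hrlow : min (rm : ℝ) ρ₀ / 4 ≤ r := by
    have h1 : ((r : ℕ) : ℝ) = min (rm : ℝ) (⌊ρ₀ / 2⌋₊ : ℝ) := by rw [hrdef]; push_cast; rfl
    rw [h1]
    exact (min_div_four_le hrm0.le (by linarith only [hρ8])).trans (min_le_min le_rfl hfl')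
  have hN : 4 * r + 6 ≤ P.sitesPerDir 0 := by
    have h1 := two_mul_pow_le_sitesPerDir (P := P) hk
    have h2 : 8 * (r : ℝ) ≤ (P.L ^ k : ℕ) := by rw [hncast]; linarith only [hrn]
    have h3 : 8 * r ≤ P.L ^ k := by exact_mod_cast h2
    omega
  -- every site within `2r + 1` of `y₀` lies in the cube
  have hball : ∀ z, supDist y₀ z ≤ 2 * r + 1 → z ∈ Q := by
    intro z hz
    refine hdep_in y₀ z ?_
    have h1 : ((supDist y₀ z : ℕ) : ℝ) ≤ 2 * r + 1 := by exact_mod_cast hz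
    have h2 : (2 * r + 1 : ℝ) < dep y₀ := by linarith only [hrρ, hdep₀, hρ₀_app]
    exact_mod_cast h1.trans_lt h2
  -- the plaquettes based within `2r + 2` of `y₀` are within `2L^k` of the point `y₀ ∈ Ω`: THE LOCAL HYPOTHESIS suffices
  have hy₀Q : y₀ ∈ Q := hball y₀ (by rw [(supDist_eq_zero_iff y₀ y₀).2 rfl]; exact Nat.zero_le _)
  have hnear : ∀ p : Balaban1983to89.Plaq P 0, supDist y₀ p.src ≤ 2 * r + 2 → dist1 (GaugeField.plaqHol U p) ≤ θ := by
    intro p hp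
    rw [BIJ88Smooth43Axial.dist1_eq_norm_toC_sub_one]
    refine hplaq p ⟨y₀, hy₀Q, hp.trans ?_⟩
    have h1 : (2 * r + 2 : ℝ) ≤ 2 * n := by linarith only [hrn, hn3]
    have h2 : ((2 * r + 2 : ℕ) : ℝ) ≤ ((2 * P.L ^ k : ℕ) : ℝ) := by push_cast; linarith only [h1, hndef]
    exact_mod_cast h2
  -- the depth weight on the `2r`-ball is at least `W₀/2`
  have hWball : ∀ z, supDist y₀ z ≤ 2 * r → W₀ / 2 ≤ W z := by
    intro z hz
    have h1 : ((supDist y₀ z : ℕ) : ℝ) ≤ 2 * r := by exact_mod_cast hz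
    have h2 : ((dep y₀ : ℕ) : ℝ) ≤ supDist y₀ z + dep z := by exact_mod_cast hdep_tri y₀ z
    have h3 : ρ₀ / 2 ≤ ρf z := by rw [hρf_app]; linarith only [h1, h2, hrρ, hρ₀_app]
    have h4 : min (rm : ℝ) (max 0 ρ₀) / 2 ≤ min (rm : ℝ) (max 0 (ρf z)) := by
      refine (min_div_two_le hrm0.le).trans (min_le_min le_rfl ?_)
      rw [max_eq_right hρ₀0]
      exact le_max_of_le_right h3
    rw [hW₀_app, hW_app, div_div, div_le_div_iff₀ (by positivity) hrm0]
    have h5 := mul_le_mul_of_nonneg_right h4 (by positivity : (0:ℝ) ≤ (rm : ℝ) * 2)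
    linarith only [h5]
  -- the local exponential slack factors
  have hslack1 : Real.exp (t * (2 * r) / n) ≤ e := by
    rw [hedef]; refine Real.exp_le_exp.2 ?_
    rw [div_le_one hn]
    have h1 : t * (2 * r) ≤ 1 * (2 * r) := mul_le_mul_of_nonneg_right ht1 (by positivity)
    linarith only [h1, hrn]
  have hslack3 : Real.exp (t * (2 * r + n + 1) / n) ≤ e ^ 3 := by
    rw [hedef, ← Real.exp_nat_mul]; refine Real.exp_le_exp.2 ?_
    rw [div_le_iff₀ hn]
    have h1 : t * (2 * r + n + 1) ≤ 1 * (2 * r + n + 1) := mul_le_mul_of_nonneg_right ht1 (by positivity)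
    push_cast
    linarith only [h1, hrn, hn1]
  -- the gauge, the gauge copy, its source in the TORUS problem
  set hg := centredGaugeDir U y₀ (2 * r) μ with hhg
  set U' := GaugeField.gaugeAct hg U with hU'
  set ψ : Balaban1983to89.Site P 0 → ℂ := fun z => toC (hg z) * φ z with hψdef
  set f' : Balaban1983to89.Site P 0 → ℂ := nOp a' P.eps⁻¹ U' k univ *ᵥ ψ with hf'def
  have hψeq : nOp a' P.eps⁻¹ U' k univ *ᵥ ψ = f' := rfl
  have hnormψ : ∀ z, ‖ψ z‖ = ‖φ z‖ := fun z => by rw [show ψ z = toC (hg z) * φ z from rfl, norm_mul, norm_toC, one_mul]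
  have hcov : ∀ z ν, ‖cfg U' ⟨z, ν⟩ * ψ (z.shift ν) - ψ z‖ = ‖cfg U ⟨z, ν⟩ * φ (z.shift ν) - φ z‖ := fun z ν =>
    norm_covDiff_gaugeAct hg U φ z ν
  -- the source of the torus problem agrees with `h·f` on the `2r`-ball (its bonds lie in the cube)
  have hf'eq : ∀ z, supDist y₀ z ≤ 2 * r → f' z = toC (hg z) * f z := by
    intro z hz
    have hzQ : z ∈ Q := hball z (by omega)
    have hsQ : ∀ ν, z.shift ν ∈ Q := fun ν => hball _ ((supDist_shift_le_succ y₀ z ν).trans (by omega))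
    have huQ : ∀ ν, z.unshift ν ∈ Q := fun ν => hball _ ((supDist_unshift_le_succ y₀ z ν).trans (by omega))
    rw [← hψeq, nOp_univ_mulVec_apply_eq_of_interior a' P.eps⁻¹ U' hΩ ψ hzQ hsQ huQ]
    exact nOp_gaugeAct_mulVec_apply hk0 hc' ha' hg U hΩ f hzQ
  set γ : ℝ := ((P.d - 1 : ℕ) : ℝ) * θ with hγdef
  have hγ0 : 0 ≤ γ := by positivity
  have hγn : γ * n ^ 2 ≤ 1 := gamma_nsq_le_one hθ0 hd1' hsmall
  have hgauge : ∀ z ν, supDist y₀ z ≤ 2 * r → ‖cfg U' ⟨z, ν⟩ - 1‖ ≤ γ * supDist y₀ z := by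
    intro z ν hz
    have hR : 2 * (2 * r) + 4 < P.sitesPerDir 0 := by omega
    have h1 := dist1_centredGaugeDir_le_supDist_of_near U hθ0 y₀ hnear hR μ z hz ν
    rw [BIJ88Smooth43Axial.dist1_eq_norm_toC_sub_one] at h1
    calc ‖cfg U' ⟨z, ν⟩ - 1‖ = ‖toC (GaugeField.gaugeAct hg U ⟨z, ν⟩) - 1‖ := rfl
      _ ≤ ((P.d - 1 : ℕ) : ℝ) * (supDist y₀ z : ℝ) * θ := h1
      _ = γ * supDist y₀ z := by rw [hγdef]; ring
  -- the local data
  set S₀ : ℝ := c_v * P.spacing k ^ 2 * F * e ^ 3 with hS₀def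
  set S : ℝ := S₀ * E with hSdef
  have hS0 : 0 ≤ S := by positivity
  have hSψ : ∀ z, supDist y₀ z ≤ 2 * r + P.L ^ k + 1 → ‖ψ z‖ ≤ S := by
    intro z hz
    rw [hnormψ]
    have hsup : ∀ w, f w ≠ 0 → max (D₀ - supDist y₀ z) 0 ≤ (supDist z w : ℝ) := fun w hw => by
      refine max_le ?_ (Nat.cast_nonneg _)
      have h1 := (hDf_le y₀ w hw).trans (supDist_triangle y₀ z w)
      have : ((Df y₀ : ℕ) : ℝ) ≤ ((supDist y₀ z + supDist z w : ℕ) : ℝ) := by exact_mod_cast h1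
      push_cast at this; rw [hD₀]; linarith only [this]
    refine (hvalP z f F _ hF hsup).trans ?_
    have h2 : Real.exp (-(t₁ * max (D₀ - supDist y₀ z) 0 / n)) ≤ E * e ^ 3 := by
      refine ((hexp_t₁ (le_max_right _ _)).trans (hexpD (le_max_left _ _))).trans ?_
      have hz' : (supDist y₀ z : ℝ) ≤ 2 * r + n + 1 := by
        have : ((supDist y₀ z : ℕ) : ℝ) ≤ ((2 * r + P.L ^ k + 1 : ℕ) : ℝ) := by exact_mod_cast hz
        push_cast at this; rw [hndef]; exact this
      calc Real.exp (-(t * (D₀ - supDist y₀ z) / n)) = E * Real.exp (t * supDist y₀ z / n) := by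
            rw [hEdef, ← Real.exp_add]; congr 1; ring
        _ ≤ E * Real.exp (t * (2 * r + n + 1) / n) := by
            refine mul_le_mul_of_nonneg_left (Real.exp_le_exp.2 ?_) hE0.le
            exact div_le_div_of_nonneg_right (mul_le_mul_of_nonneg_left hz' ht.le) hn.le
        _ ≤ E * e ^ 3 := mul_le_mul_of_nonneg_left hslack3 hE0.le
    calc c_v * P.spacing k ^ 2 * Real.exp (-(t₁ * max (D₀ - ↑(supDist y₀ z)) 0 / n)) * F
        ≤ c_v * P.spacing k ^ 2 * (E * e ^ 3) * F := by gcongr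
      _ = S := by rw [hSdef, hS₀def]; ring
  set Mloc : ℝ := 2 * Mx * E * e / W₀ with hMlocdef
  have hMloc0 : 0 ≤ Mloc := by positivity
  have hMψ : ∀ z ν, supDist y₀ z ≤ 2 * r → ‖cfg U' ⟨z, ν⟩ * ψ (z.shift ν) - ψ z‖ ≤ Mloc := by
    intro z ν hz
    rw [hcov]
    have hWz : W₀ / 2 ≤ W z := hWball z hz
    have hWz0 : 0 < W z := lt_of_lt_of_le (by positivity) hWz
    have h1 : Real.exp (-(t * Df z / n)) ≤ E * e := by
      have h2 : (D₀ - 2 * r : ℝ) ≤ Df z := by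
        have h3 : ((Df y₀ : ℕ) : ℝ) ≤ ((supDist y₀ z + Df z : ℕ) : ℝ) := by exact_mod_cast hDf_tri y₀ z
        have h4 : ((supDist y₀ z : ℕ) : ℝ) ≤ ((2 * r : ℕ) : ℝ) := by exact_mod_cast hz
        push_cast at h3 h4; rw [hD₀]; linarith only [h3, h4]
      refine (hexpD h2).trans ?_
      calc Real.exp (-(t * (D₀ - 2 * r) / n)) = E * Real.exp (t * (2 * r) / n) := by rw [hEdef, ← Real.exp_add]; congr 1; ring
        _ ≤ E * e := mul_le_mul_of_nonneg_left hslack1 hE0.le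
    have h5 : W z * ‖cfg U ⟨z, ν⟩ * φ (z.shift ν) - φ z‖ ≤ Mx * (E * e) := (hMuse z ν).trans (mul_le_mul_of_nonneg_left h1 hM0)
    rw [← le_div_iff₀' hWz0] at h5
    refine h5.trans ?_
    rw [hMlocdef, div_le_div_iff₀ hWz0 hW₀pos]
    have h6 : 0 ≤ Mx * (E * e) := by positivity
    have h7 : Mx * (E * e) * (W₀ / 2) ≤ Mx * (E * e) * W z := mul_le_mul_of_nonneg_left hWz h6
    linarith only [h7]
  set Floc : ℝ := F * E * e with hFlocdef
  have hFloc0 : 0 ≤ Floc := by positivity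
  have hFf' : ∀ z, supDist y₀ z ≤ 2 * r → ‖f' z‖ ≤ Floc := by
    intro z hz
    rw [hf'eq z hz, norm_mul, norm_toC, one_mul]
    by_cases hfz : f z = 0
    · rw [hfz, norm_zero]; exact hFloc0
    · have h1 : D₀ ≤ 2 * r := by
        have := (hDf_le y₀ z hfz).trans hz
        have h2 : ((Df y₀ : ℕ) : ℝ) ≤ ((2 * r : ℕ) : ℝ) := by exact_mod_cast this
        push_cast at h2; rw [hD₀]; exact h2
      have h2 : 1 ≤ E * e := by
        have h3 : Real.exp (-(t * (2 * r) / n)) ≤ E := hexpD h1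
        have h4 : Real.exp (-(t * (2 * r) / n)) * Real.exp (t * (2 * r) / n) = 1 := by
          rw [← Real.exp_add, neg_add_cancel, Real.exp_zero]
        calc (1 : ℝ) = Real.exp (-(t * (2 * r) / n)) * Real.exp (t * (2 * r) / n) := h4.symm
          _ ≤ E * e := mul_le_mul h3 hslack1 (Real.exp_pos _).le hE0.le
      calc ‖f z‖ ≤ F := hF z
        _ = F * 1 := (mul_one F).symm
        _ ≤ F * (E * e) := mul_le_mul_of_nonneg_left h2 hF0
        _ = Floc := by rw [hFlocdef]; ring
  -- THE LOCAL ESTIMATE (flat kernel envelopes in the torus dimension `P.d = d + 1`)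
  have hK1 : ∀ z, |(B1RG242Torus.tower P a 0).G k (y₀.shift μ₀) z - (B1RG242Torus.tower P a 0).G k y₀ z| ≤
      C_K * P.eps ^ 2 / (max (supDist y₀ z : ℝ) 1) ^ (P.d - 1) := fun z => by
    rw [hPd, Nat.add_sub_cancel]
    have h := hkerP.1 μ₀ y₀ z
    rwa [Nat.add_sub_cancel] at h
  have hK2 : ∀ (ν : Fin P.d) z, |(B1RG242Torus.tower P a 0).G k (y₀.shift μ₀) (z.shift ν) -
      (B1RG242Torus.tower P a 0).G k (y₀.shift μ₀) z - (B1RG242Torus.tower P a 0).G k y₀ (z.shift ν) +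
      (B1RG242Torus.tower P a 0).G k y₀ z| ≤ C_K * P.eps ^ 2 / (max (supDist y₀ z : ℝ) 1) ^ P.d := fun ν z => by
    rw [hPd]
    exact hkerP.2 μ₀ ν y₀ z
  have hmain := hloc P hPd ha hk1 hkK hr4 hN y₀ μ₀ U' ψ f' hψeq hγ0 hS0 hMloc0 hFloc0 hK1 hK2 hgauge hSψ hMψ hFf'
  -- its left-hand side is `Mx·E/W₀`
  have hLHS : ‖ψ (y₀.shift μ₀) - ψ y₀‖ = Mx * E / W₀ := by
    have hu1 : cfg U' ⟨y₀, μ₀⟩ = 1 := by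
      have h1 := hgauge y₀ μ₀ (by rw [(supDist_eq_zero_iff y₀ y₀).2 rfl]; exact Nat.zero_le _)
      rw [(supDist_eq_zero_iff y₀ y₀).2 rfl, Nat.cast_zero, mul_zero] at h1
      exact sub_eq_zero.1 (norm_le_zero_iff.1 h1)
    have h2 : ‖ψ (y₀.shift μ₀) - ψ y₀‖ = ‖cfg U ⟨y₀, μ₀⟩ * φ (y₀.shift μ₀) - φ y₀‖ := by rw [← hcov, hu1, one_mul]
    rw [h2, eq_div_iff hW₀pos.ne', hMxeq]
    calc ‖cfg U ⟨y₀, μ₀⟩ * φ (y₀.shift μ₀) - φ y₀‖ * W₀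
        = W₀ * (‖cfg U ⟨y₀, μ₀⟩ * φ (y₀.shift μ₀) - φ y₀‖ * (Real.exp (t * D₀ / n) * E)) := by rw [hEinv]; ring
      _ = W₀ * (Real.exp (t * D₀ / n) * ‖cfg U ⟨y₀, μ₀⟩ * φ (y₀.shift μ₀) - φ y₀‖) * E := by ring
  rw [hLHS] at hmain
  -- `γ r² ≤ cb²`, the contraction factor `2·C_L·e·γ r² ≤ 1/2`
  have hγr : γ * (r : ℝ) ^ 2 ≤ cb ^ 2 := by
    calc γ * (r : ℝ) ^ 2 ≤ γ * (cb * n) ^ 2 := mul_le_mul_of_nonneg_left (pow_le_pow_left₀ hr0.le hrc 2) hγ0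
      _ = cb ^ 2 * (γ * n ^ 2) := by ring
      _ ≤ cb ^ 2 * 1 := mul_le_mul_of_nonneg_left hγn (sq_nonneg cb)
      _ = cb ^ 2 := mul_one _
  have hκ : C_L * (γ * (r : ℝ) ^ 2) * (2 * e) ≤ 1 / 2 := by
    calc C_L * (γ * (r : ℝ) ^ 2) * (2 * e) ≤ C_L * cb ^ 2 * (2 * e) := by gcongr
      _ = 2 * ((C_L * e * cb) * cb) := by ring
      _ ≤ 2 * ((1 / 4) * 1) := by
          refine mul_le_mul_of_nonneg_left (mul_le_mul hcC hc1 hc0.le (by norm_num)) (by norm_num)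
      _ = 1 / 2 := by norm_num
  -- absorb: `Mx ≤ 2·C_L·W₀·(F e ε² r + (γ r + 1/r + α ε²(r + n))·S₀)`
  have hmain' : Mx * E / W₀ ≤ C_L * ((F * E * e) * P.eps ^ 2 * r + γ * r ^ 2 * (2 * Mx * E * e / W₀) + γ * r * (S₀ * E) +
      (S₀ * E) / r + B1RG242Torus.α P a k * P.eps ^ 2 * (r + n) * (S₀ * E)) := by
    have h := hmain
    rw [hFlocdef, hMlocdef, hSdef] at h
    exact h
  have hM_le := absorb_step hE0 hW₀pos hM0 hr0 hκ hmain'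
  -- the budget of the absorbed terms
  have hWr : W₀ / r ≤ 8 / (cb * n) := by
    have h1 : W₀ / r ≤ 4 / rm := by
      rw [div_le_div_iff₀ hr0 hrm0]
      have h2 : W₀ * (rm : ℝ) = min (rm : ℝ) (max 0 ρ₀) := by rw [hW₀_app]; field_simp
      rw [h2, max_eq_right hρ₀0]
      linarith only [hrlow]
    have h4 : 4 / (rm : ℝ) ≤ 8 / (cb * n) := by
      rw [div_le_div_iff₀ hrm0 (by positivity)]; linarith only [hrm2]
    exact h1.trans h4
  have hbudget := budget_step hW₀1 hF0 he0.le hr0 hγ0 hc0 hn hc_v.le hα.le ha.le hrc hrn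
    hγn hWr hαa hsp
  have h7 : 0 ≤ 32 * e * c_v / cb * (n * P.eps ^ 2 * F) := by positivity
  have h8 : C_L * W₀ * (F * e * P.eps ^ 2 * r + (γ * r + 1 / r + B1RG242Torus.α P a k * P.eps ^ 2 * (r + n)) * S₀) ≤
      C_L * (K₁ * (n * P.eps ^ 2 * F)) := by
    rw [mul_assoc C_L]
    refine mul_le_mul_of_nonneg_left ?_ hCL.le
    rw [hS₀def, hK₁]
    exact hbudget
  linarith only [hM_le, h8, h7]


/-! ## §B The `D_u` member under plaquette smallness NEAR `Ω` ONLY (no gauge condition: the blockwise tree gauge of B-I §2), and under the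
printed (2.32) near `Ω` -/

/-- **THE COVARIANT-DERIVATIVE MEMBER OF [6] (1.10) FOR THE REGION PROPAGATORS ON EVERY `k`-BLOCK UNION UNDER PLAQUETTE SMALLNESS NEAR `Ω`
ONLY, THRESHOLD IN `(d, L^k)`** — p34 gen 18's `decay110_smallPlaquette_region_deriv_uniform` with its global plaquette hypothesis replaced by
the printed local one ([BalabanImbrieJaffe1988] (2.32) *"in a neighborhood of each □_α … throughout the subset Ω"*): for `d + 1 ∈ {2, 3}`, `L` odd
`> 1`, `a > 0` there are `t₀, c₁ > 0` (from `(d, L, a)` only) such that for every volume with `2(L^k − 1) + 4 < |T|`, every `1 ≤ k ≤ K`, every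
`k`-block union `Ω`, every `U(1)` field with `‖u(∂p) − 1‖ ≤ θ` for the plaquettes based within `2L^k` of `Ω` and `2(d+1)³(L^{2k}θ)² ≤ 1`, every
`T ≥ d(L^k − 1)θ` with `2(L^k−1)L^k(d+1)T² + 2((d+1)(L^k−1)T)² ≤ 1/2`, every bond `⟨x, x+e_μ⟩` with `dist_∞(x, T∖Ω) ≥ L^k`, every `f` with
`|f| ≤ F` vanishing at sup-distance `< D` from `x`: `‖(D_uG_k(Ω,u)f)(⟨x, μ⟩)‖ ≤ c₁(L^kε)e^{−t₀D/L^k}F`.  Proof: §A at `u^h` in the blockwise tree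
gauge from the plaquettes near `Ω` (`blockGauge_of_near`), the plaquettes and `|D_u·|` being gauge invariant.
[cite: Balaban1983RegularityDecay, Thm p.573 (1.10)] [cite: BalabanImbrieJaffe1988, (2.31)/(2.32) p.263] [cite: BalabanImbrieJaffe1985, p.326] -/
theorem decay110_smoothNear_region_deriv_uniform (d L : ℕ) (hd1 : 1 ≤ d) (hd3 : d + 1 ≤ 3) (hL : Odd L ∧ 1 < L) {a : ℝ} (ha : 0 < a) :
    ∃ t₀ c₁ : ℝ, 0 < t₀ ∧ 0 < c₁ ∧ ∀ (P : Params), P.d = d + 1 → P.L = L →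
      ∀ k : ℕ, 1 ≤ k → k ≤ P.K → 2 * (P.L ^ k - 1) + 4 < P.sitesPerDir 0 →
      ∀ Ω : Finset (Balaban1983to89.Site P 0), IsBlockUnion k Ω →
      ∀ (U : GaugeField P 0 U1) (θ : ℝ), 0 ≤ θ →
        (∀ p : Balaban1983to89.Plaq P 0, (∃ y ∈ Ω, supDist y p.src ≤ 2 * P.L ^ k) → ‖toC (GaugeField.plaqHol U p) - 1‖ ≤ θ) →
        2 * (P.d : ℝ) ^ 3 * (((P.L : ℝ) ^ k) ^ 2 * θ) ^ 2 ≤ 1 →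
        ∀ (T : ℝ), ((P.d - 1 : ℕ) : ℝ) * ((P.L : ℝ) ^ k - 1) * θ ≤ T →
          2 * (((P.L : ℝ) ^ k - 1) * (P.L : ℝ) ^ k) * P.d * T ^ 2 + 2 * (P.d * ((P.L : ℝ) ^ k - 1) * T) ^ 2 ≤ 1 / 2 →
          ∀ (x : Balaban1983to89.Site P 0) (μ : Fin P.d) (f : Balaban1983to89.Site P 0 → ℂ) (F D : ℝ),
            (∀ z, ‖f z‖ ≤ F) → (∀ z, f z ≠ 0 → D ≤ (supDist x z : ℝ)) →
            (∀ w, w ∉ Ω → P.L ^ k ≤ supDist x w) →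
            ‖covD P.eps⁻¹ (cfg U) (gBox (B1RG242Torus.α P a k * (P.L : ℝ) ^ (k * P.d)) P.eps⁻¹ U k Ω *ᵥ f) ⟨x, μ⟩‖
              ≤ c₁ * P.spacing k * Real.exp (-(t₀ * D / (P.L : ℝ) ^ k)) * F := by
  obtain ⟨t₀, c₁, ht₀, hc₁, H⟩ := decay110_smoothNear_region_deriv d L hd1 hd3 hL ha
  refine ⟨t₀, c₁, ht₀, hc₁, ?_⟩
  intro P hPd hPL k hk1 hkK hR Ω hΩ U θ hθ hplaq hsmall T hT hsmallT x μ f F D hF hsupp hdeep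
  have hk : k ≤ P.m + P.K := hkK.trans (Nat.le_add_left _ _)
  have hk0 : 0 + k ≤ P.m + P.K := by omega
  have hL1 : (1 : ℝ) < P.L := B1RG242Torus.one_lt_cast_L P
  have ha' : 0 < B1RG242Torus.α P a k * (P.L : ℝ) ^ (k * P.d) :=
    mul_pos (mul_pos (B1.aSeq_pos ha hL1 hk1) (inv_pos.2 (pow_pos (P.spacing_pos k) 2))) (pow_pos P.cast_L_pos _)
  have hc' : P.eps⁻¹ ≠ 0 := inv_ne_zero P.eps_pos.ne'
  set i₀ : Fin P.d := ⟨0, lt_of_lt_of_le Nat.zero_lt_one P.hd⟩ with hi₀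
  obtain ⟨hInt, hTree⟩ := blockGauge_of_near hk0 U hθ hΩ hplaq hR hT i₀
  set h : GaugeTransf P 0 U1 := fun z => centredGaugeDir U (cornerIter k (blkIter k z)) (P.L ^ k - 1) i₀ z with hh
  rw [← norm_covD_gBox_gaugeAct_mulVec hk0 hc' ha' h U hΩ f x μ]
  exact H P hPd hPL k hk1 hkK Ω hΩ (GaugeField.gaugeAct h U) θ T (P.d * ((P.L : ℝ) ^ k - 1) * T) hθ
    (fun p hp => by rw [norm_toC_plaqHol_gaugeAct_sub_one]; exact hplaq p hp) hsmall hInt hTree hsmallT x μ _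
    F D (fun z => by rw [norm_mul, norm_toC, one_mul]; exact hF z) (fun z hz => hsupp z (fun hf => hz (by rw [hf, mul_zero]))) hdeep

/-- **THE COVARIANT-DERIVATIVE MEMBER OF [6] (1.10) FOR THE REGION PROPAGATORS UNDER THE PRINTED (2.32) NEAR `Ω`** — `u = exp[ie_kη(A + ∂λ)]`,
`|∂A| ≦ C𝓅(e_k)` on the plaquettes based within `2L^k` of `Ω` (`BIJ88Sect2Statements.SmoothOn e_k η C 𝓅 X B Pl (cfg u)` with `Pl ⊇` those
plaquettes and `B ⊇` their bonds; B-I's `plaqSmall_near_of_smoothOn`: `‖u(∂p) − 1‖ ≤ e_kη²C𝓅` there), thresholds on `θ = e_kη²C𝓅` as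
displayed, every `k`-block union, every `L^k`-deep bond: `‖(D_uG_k(Ω,u)f)(⟨x, μ⟩)‖ ≤ c₁(L^kε)e^{−t₀D/L^k}F`.
[cite: BalabanImbrieJaffe1988, (2.31)/(2.32) p.263] [cite: Balaban1983RegularityDecay, Thm p.573 (1.10)] -/
theorem decay110_smoothOn_region_deriv (d L : ℕ) (hd1 : 1 ≤ d) (hd3 : d + 1 ≤ 3) (hL : Odd L ∧ 1 < L) {a : ℝ} (ha : 0 < a) :
    ∃ t₀ c₁ : ℝ, 0 < t₀ ∧ 0 < c₁ ∧ ∀ (P : Params), P.d = d + 1 → P.L = L →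
      ∀ k : ℕ, 1 ≤ k → k ≤ P.K → 2 * (P.L ^ k - 1) + 4 < P.sitesPerDir 0 →
      ∀ Ω : Finset (Balaban1983to89.Site P 0), IsBlockUnion k Ω →
      ∀ (U : GaugeField P 0 U1) (ek η C pek : ℝ), 0 ≤ ek → 0 ≤ C * pek →
      ∀ (X : Finset (Balaban1983to89.Site P 0)) (B : Finset (PBond P 0)) (Pl : Finset (Balaban1983to89.Plaq P 0)),
        SmoothOn ek η C pek X B Pl (cfg U) →
        (∀ p : Balaban1983to89.Plaq P 0, (∃ y ∈ Ω, supDist y p.src ≤ 2 * P.L ^ k) → p ∈ Pl) →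
        (∀ p ∈ Pl, (⟨p.src, p.μ⟩ : PBond P 0) ∈ B ∧ (⟨p.src.shift p.μ, p.ν⟩ : PBond P 0) ∈ B ∧
          (⟨p.src.shift p.ν, p.μ⟩ : PBond P 0) ∈ B ∧ (⟨p.src, p.ν⟩ : PBond P 0) ∈ B) →
        2 * (P.d : ℝ) ^ 3 * (((P.L : ℝ) ^ k) ^ 2 * (ek * η ^ 2 * (C * pek))) ^ 2 ≤ 1 →
        ∀ (T : ℝ), ((P.d - 1 : ℕ) : ℝ) * ((P.L : ℝ) ^ k - 1) * (ek * η ^ 2 * (C * pek)) ≤ T →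
          2 * (((P.L : ℝ) ^ k - 1) * (P.L : ℝ) ^ k) * P.d * T ^ 2 + 2 * (P.d * ((P.L : ℝ) ^ k - 1) * T) ^ 2 ≤ 1 / 2 →
          ∀ (x : Balaban1983to89.Site P 0) (μ : Fin P.d) (f : Balaban1983to89.Site P 0 → ℂ) (F D : ℝ),
            (∀ z, ‖f z‖ ≤ F) → (∀ z, f z ≠ 0 → D ≤ (supDist x z : ℝ)) →
            (∀ w, w ∉ Ω → P.L ^ k ≤ supDist x w) →
            ‖covD P.eps⁻¹ (cfg U) (gBox (B1RG242Torus.α P a k * (P.L : ℝ) ^ (k * P.d)) P.eps⁻¹ U k Ω *ᵥ f) ⟨x, μ⟩‖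
              ≤ c₁ * P.spacing k * Real.exp (-(t₀ * D / (P.L : ℝ) ^ k)) * F := by
  obtain ⟨t₀, c₁, ht₀, hc₁, H⟩ := decay110_smoothNear_region_deriv_uniform d L hd1 hd3 hL ha
  refine ⟨t₀, c₁, ht₀, hc₁, ?_⟩
  intro P hPd hPL k hk1 hkK hR Ω hΩ U ek η C pek hek hCp X B Pl hS hPl hB hsmall T hT hsmallT x μ f F D hF hsupp hdeep
  exact H P hPd hPL k hk1 hkK hR Ω hΩ U (ek * η ^ 2 * (C * pek)) (by positivity) (plaqSmall_near_of_smoothOn hek hS hPl hB) hsmall T hT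
    hsmallT x μ f F D hF hsupp hdeep

end DerivMember

section Holder

open LatticeFieldCalculus (runSite runSite_zero runSite_succ)
open BIJ85Ineq722Torus (supDist_runSite_le)
open BIJ88Sect3Statements (toC_mul toC_inv)
open BIJ85BlockAveragesTorusK (blkIter cornerIter holCK)
open BIJ88NeumannPropagator227Torus (nOp gBox conj_mul_toC toC_mul_conj)
open GaugeField (gaugeAct plaqHol)
open BIJ85ScalarPropagatorSupDecayDeriv (norm_covDiff_gaugeAct dist1_plaqHol_le_of_plaqC two_mul_pow_le_sitesPerDir gamma_nsq_le_one)
open BIJ85ScalarPropagatorSupDecayHolder (local_holder_bound div_rpow_mul_eq rpow_neg_le_of_le_mul rpow_le_mul_rpow)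
open BIJ85ScalarPropagatorHolderDecay (axisHol axisHol_zero axisHol_gaugeAct toC_axisHol_eq_one covD_gaugeAct runSite_apply_ne
  supDist_runSite_eq stairPt stairPt_zero stairPt_of_le supDist_stairPt_le stairPt_succ_eq_runSite stairPt_eq_runSite_succ
  min_val_le_supDist legHol stairHol norm_stairHol stair_telescope)
open BIJ88NeumannPropagatorSmallFieldRegionSup (decay110_smallField_region)
open BIJ88NeumannPropagatorSmallFieldCubeDeriv (gBox_gaugeAct_mulVec norm_toC_plaqHol_gaugeAct_sub_one)
open BIJ88NeumannPropagatorSmallFieldCubeHolder (source_eq_on_ball deep_of_ball)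
open BIJ88NeumannPropagatorSmallFieldCubeHolderDecay (stairHol_gaugeAct)

/-! ## §C [6] (1.9): the HÖLDER member at an axis-parallel DEEP pair of a `k`-block union, in the axis-rooted gauge, plaquettes NEAR `Ω` only -/

section LegGauged

variable {d : ℕ}

set_option maxHeartbeats 800000 in
/-- **THE HÖLDER MEMBER OF [6] (1.9) FOR `D_uG_k(Ω,u)` ON A GENERAL `k`-BLOCK UNION, AXIS-PARALLEL DEEP PAIRS, IN THE AXIS-ROOTED GAUGE, WHEN
`u` IS PLAQUETTE-SMALL ONLY NEAR `Ω`** — for [BalabanImbrieJaffe1988] p. 263 *"Bounds analogous to (2.30), (2.31) hold for covariant derivatives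
and Hölder derivatives of G_{k,loc}(u) of order less than two"* under the printed LOCAL hypothesis (2.32) *"in a neighborhood of each □_α …
throughout the subset Ω"*, and [Balaban1983RegularityDecay] (1.9) *"|x−x′|^{−α}|U(A(Γ_{x,x′}))(D^η_{A,μ}G_k(Ω,A)f)(x′) − (D^η_{A,μ}G_k(Ω,A)f)(x)|
≤ c₀e^{−δ₀dist({x,x′},supp f)}‖f‖_∞ … dist({x,x′},Ω^c) ≥ R₀"*: p34's `BIJ88NeumannPropagatorSmallFieldRegionHolder.holder19_region_leg_gauged`
VERBATIM except that the plaquette hypothesis is assumed only on the plaquettes based within `2L^k` of `Ω`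
(`∀ p, (∃ y ∈ Ω, |y − p.src|_∞ ≤ 2L^k) → ‖u(∂p) − 1‖ ≤ θ`) — the proof's tree gauge `centredGaugeDir u x₀ (2⌊L^k/8⌋) i` about the deep point
`x₀ ∈ Ω` reads only the plaquettes based within `2⌊L^k/8⌋ + 2 ≤ 2L^k` of `x₀` (B-I's `dist1_centredGaugeDir_le_min_of_near` / `_of_near`), and
the `D_u` input is §A.  For `1 ≤ d`, `d + 1 ≤ 3`, `L` odd `> 1`, `a > 0`, `0 ≤ α < 1` there are `t₀, c₀ > 0` (on `d, L, a, α`) such that for every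
volume, every `1 ≤ k ≤ K`, every `k`-block union `Ω`, every such field with `2(d+1)³(L^{2k}θ)² ≤ 1` and the bondwise `(T, δ)` hypotheses inside
`Ω`, every AXIS-PARALLEL pair `x₀`, `x₁` with `1 ≤ |x₀−x₁|_∞`, `64|x₀−x₁|_∞ ≤ L^k`, `dist_∞(x₀, T∖Ω) ≥ 2L^k`, every `μ` and every `f` with `|f| ≤ F`
vanishing at sup-distance `< D` from `x₀`: in that gauge every bond based on the axis segment is trivial and, for `ψ = h·G_k(Ω,u)f`,
`‖(ψ(x₁+e_μ) − ψ(x₁)) − (ψ(x₀+e_μ) − ψ(x₀))‖ ≤ c₀(|x₀−x₁|_∞/L^k)^α(L^kε)·ε·e^{−t₀D/L^k}F`.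
[cite: Balaban1983RegularityDecay, Theorem p.573 (1.9)] [cite: BalabanImbrieJaffe1988, (2.31)/(2.32) p.263] [cite: BalabanImbrieJaffe1985, p.326] -/
theorem holder19_smoothNear_region_leg_gauged (d L : ℕ) (hd1 : 1 ≤ d) (hd3 : d + 1 ≤ 3) (hL : Odd L ∧ 1 < L) {a : ℝ} (ha : 0 < a) {α : ℝ}
    (hα0 : 0 ≤ α) (hα1 : α < 1) :
    ∃ t₀ c₀ : ℝ, 0 < t₀ ∧ 0 < c₀ ∧ ∀ (P : Params), P.d = d + 1 → P.L = L →
      ∀ k : ℕ, 1 ≤ k → k ≤ P.K → ∀ Ω : Finset (Balaban1983to89.Site P 0), IsBlockUnion k Ω →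
        ∀ (U : GaugeField P 0 U1) (θ T δ : ℝ), 0 ≤ θ →
          (∀ p : Balaban1983to89.Plaq P 0, (∃ y ∈ Ω, supDist y p.src ≤ 2 * P.L ^ k) → ‖toC (GaugeField.plaqHol U p) - 1‖ ≤ θ) →
          2 * (P.d : ℝ) ^ 3 * (((P.L : ℝ) ^ k) ^ 2 * θ) ^ 2 ≤ 1 →
          (∀ b ∈ starB Ω, blkIter k b.src = blkIter k b.tgt → ‖toC (U b) - 1‖ ≤ T) →
          (∀ y ∈ Ω, ‖holCK U k y - 1‖ ≤ δ) →
          2 * (((P.L : ℝ) ^ k - 1) * (P.L : ℝ) ^ k) * P.d * T ^ 2 + 2 * δ ^ 2 ≤ 1 / 2 →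
        ∀ (x₀ x₁ : Balaban1983to89.Site P 0) (i μ : Fin P.d), (∀ ν, ν ≠ i → x₁ ν = x₀ ν) →
          1 ≤ supDist x₀ x₁ → 64 * supDist x₀ x₁ ≤ P.L ^ k →
          (∀ w, w ∉ Ω → 2 * P.L ^ k ≤ supDist x₀ w) →
        ∀ (f : Balaban1983to89.Site P 0 → ℂ) (F D : ℝ),
          (∀ z, ‖f z‖ ≤ F) → (∀ z, f z ≠ 0 → D ≤ (supDist x₀ z : ℝ)) →
          (∀ (z : Balaban1983to89.Site P 0) (μ' : Fin P.d), (∀ ν, ν ≠ i → z ν = x₀ ν) → supDist x₀ z ≤ supDist x₀ x₁ →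
              cfg (GaugeField.gaugeAct (centredGaugeDir U x₀ (2 * (P.L ^ k / 8)) i) U) ⟨z, μ'⟩ = 1) ∧
          ‖(toC (centredGaugeDir U x₀ (2 * (P.L ^ k / 8)) i (x₁.shift μ)) *
                (gBox (B1RG242Torus.α P a k * (P.L : ℝ) ^ (k * P.d)) P.eps⁻¹ U k Ω *ᵥ f) (x₁.shift μ) -
              toC (centredGaugeDir U x₀ (2 * (P.L ^ k / 8)) i x₁) *
                (gBox (B1RG242Torus.α P a k * (P.L : ℝ) ^ (k * P.d)) P.eps⁻¹ U k Ω *ᵥ f) x₁) -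
            (toC (centredGaugeDir U x₀ (2 * (P.L ^ k / 8)) i (x₀.shift μ)) *
                (gBox (B1RG242Torus.α P a k * (P.L : ℝ) ^ (k * P.d)) P.eps⁻¹ U k Ω *ᵥ f) (x₀.shift μ) -
              toC (centredGaugeDir U x₀ (2 * (P.L ^ k / 8)) i x₀) *
                (gBox (B1RG242Torus.α P a k * (P.L : ℝ) ^ (k * P.d)) P.eps⁻¹ U k Ω *ᵥ f) x₀)‖
            ≤ c₀ * ((supDist x₀ x₁ : ℝ) / (P.L : ℝ) ^ k) ^ α * P.spacing k * P.eps * Real.exp (-(t₀ * D / (P.L : ℝ) ^ k)) * F := by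
  classical
  obtain ⟨t₁, c_v, ht₁, hc_v, hval⟩ := decay110_smallField_region d (L - 1) hd3 (by omega) ha
  obtain ⟨t₂, c_d, ht₂, hc_d, hder⟩ := decay110_smoothNear_region_deriv d L hd1 hd3 hL ha
  obtain ⟨C_H, hCH, hhol⟩ := BIJ85FlatPropagatorKernelHolder.flat_kernel_holder (d + 1) L (by omega) hL ha (le_refl (0 : ℝ)) hα0 hα1
  obtain ⟨C_L, hCL, hloc⟩ := local_holder_bound (d + 1) (by omega) hα0 hα1
  -- the rate and the constant
  set t : ℝ := min (min t₁ t₂) 1 with htdef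
  have ht : 0 < t := lt_min (lt_min ht₁ ht₂) one_pos
  have ht1 : t ≤ 1 := min_le_right _ _
  have htt₁ : t ≤ t₁ := (min_le_left _ _).trans (min_le_left _ _)
  have htt₂ : t ≤ t₂ := (min_le_left _ _).trans (min_le_right _ _)
  set e : ℝ := Real.exp 1 with hedef
  have he1 : 1 ≤ e := by rw [hedef]; exact Real.one_le_exp (by norm_num)
  have he0 : 0 < e := Real.exp_pos 1
  set K₁ : ℝ := C_L * C_H * (e + c_d * e + c_v * e ^ 3 + 256 * c_v * e ^ 3 + 2 * a * c_v * e ^ 3) with hK₁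
  refine ⟨t, K₁ + 1, ht, by positivity, ?_⟩
  intro P hPd hPL k hk1 hkK Ω hΩ U θ T δ hθ0 hθ hsmall hInt hTree hsmallT x₀ x₁ i μ hx₁ hρ1 hρ64 hdeep f F D hF hsupp
  have hk : k ≤ P.m + P.K := hkK.trans (Nat.le_add_left _ _)
  have hk0 : 0 + k ≤ P.m + P.K := by omega
  have hPL' : P.L = L - 1 + 1 := by omega
  have hvalP := hval P hPd hPL' k hk1 hk Ω hΩ U T δ hInt hTree hsmallT
  have hderP := hder P hPd hPL k hk1 hkK Ω hΩ U θ T δ hθ0 hθ hsmall hInt hTree hsmallT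
  have hholP := hhol P hPd hPL k hk1 hkK
  -- basic quantities
  have hd1' : 1 ≤ P.d := by omega
  have hLpos : (0 : ℝ) < P.L := P.cast_L_pos
  have hL1 : (1 : ℝ) < P.L := B1RG242Torus.one_lt_cast_L P
  have hε : 0 < P.eps := P.eps_pos
  set n : ℝ := (P.L : ℝ) ^ k with hndef
  have hn : 0 < n := pow_pos hLpos k
  have hnnat : ((P.L ^ k : ℕ) : ℝ) = n := by push_cast; rw [hndef]
  have hsp : P.spacing k = n * P.eps := rfl
  have hsp0 : 0 < P.spacing k := P.spacing_pos k
  have hα : 0 < B1RG242Torus.α P a k := mul_pos (B1.aSeq_pos ha hL1 hk1) (inv_pos.2 (pow_pos hsp0 2))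
  have hαa : B1RG242Torus.α P a k * P.spacing k ^ 2 ≤ a := by
    show B1.aSeq a P.L k * (P.spacing k ^ 2)⁻¹ * P.spacing k ^ 2 ≤ a
    rw [inv_mul_cancel_right₀ (pow_ne_zero 2 hsp0.ne')]
    exact B1.aSeq_le ha hL1 k hk1
  set a' : ℝ := B1RG242Torus.α P a k * (P.L : ℝ) ^ (k * P.d) with ha'def
  have ha' : 0 < a' := mul_pos hα (pow_pos hLpos _)
  have hc' : P.eps⁻¹ ≠ 0 := inv_ne_zero hε.ne'
  have hF0 : 0 ≤ F := (norm_nonneg _).trans (hF x₀)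
  set φ := gBox a' P.eps⁻¹ U k Ω *ᵥ f with hφ
  -- the pair distance and the radius
  set ρ : ℕ := supDist x₀ x₁ with hρdef
  have hρ0 : (0 : ℝ) < ρ := by exact_mod_cast hρ1
  have hρn : 64 * (ρ : ℝ) ≤ n := by rw [← hnnat]; exact_mod_cast hρ64
  set r : ℕ := P.L ^ k / 8 with hrdef
  have hr8 : 8 * r ≤ P.L ^ k := Nat.mul_div_le (P.L ^ k) 8
  have hr8' : P.L ^ k < 8 * (r + 1) := by rw [hrdef]; omega
  have hrn : 8 * (r : ℝ) ≤ n := by rw [← hnnat]; exact_mod_cast hr8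
  have hrn' : n ≤ 8 * r + 8 := by
    have h : ((P.L ^ k : ℕ) : ℝ) ≤ ((8 * (r + 1) : ℕ) : ℝ) := by exact_mod_cast hr8'.le
    rw [hnnat] at h; push_cast at h; linarith
  have hρ1' : (1 : ℝ) ≤ ρ := by exact_mod_cast hρ1
  have hn1 : (1 : ℝ) ≤ n := by linarith
  have hr7 : (7 : ℝ) ≤ r := by linarith
  have hr4 : 4 ≤ r := by exact_mod_cast (show (4 : ℝ) ≤ r by linarith)
  have hr0 : (0 : ℝ) < r := by linarith
  have hr16 : n ≤ 16 * r := by linarith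
  have hρr : 2 * ρ + 4 ≤ r := by
    have h1 : 2 * (ρ : ℝ) + 4 ≤ r := by linarith
    exact_mod_cast h1
  have hN' : 4 * r + 6 ≤ P.sitesPerDir 0 := by
    have h1 := two_mul_pow_le_sitesPerDir (P := P) hk
    omega
  have hRb : 2 * (2 * r) + 4 < P.sitesPerDir 0 := by omega
  -- the deep ball: the `(2r+1)`-ball lies in `□`, the bonds of the `2r`-ball are `L^k`-deep
  obtain ⟨hinΩ, hdeepz⟩ := deep_of_ball (P := P) hr8 hdeep
  -- the plaquettes based within `2r + 2` of `x₀` are within `2L^k` of `x₀ ∈ Ω`: THE LOCAL HYPOTHESIS suffices for the gauge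
  have hx₀Ω : x₀ ∈ Ω := hinΩ x₀ (by rw [(supDist_eq_zero_iff x₀ x₀).2 rfl]; exact Nat.zero_le _)
  have hnear : ∀ p : Balaban1983to89.Plaq P 0, supDist x₀ p.src ≤ 2 * r + 2 → dist1 (GaugeField.plaqHol U p) ≤ θ := by
    intro p hp
    rw [BIJ88Smooth43Axial.dist1_eq_norm_toC_sub_one]
    refine hθ p ⟨x₀, hx₀Ω, hp.trans ?_⟩
    omega
  -- exponential bookkeeping
  set E : ℝ := Real.exp (-(t * D / n)) with hEdef
  have hE0 : 0 < E := Real.exp_pos _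
  have hexpD : ∀ {D₁ D₂ : ℝ}, D₂ ≤ D₁ → Real.exp (-(t * D₁ / n)) ≤ Real.exp (-(t * D₂ / n)) := fun h =>
    Real.exp_le_exp.2 (by rw [neg_le_neg_iff]; exact div_le_div_of_nonneg_right (mul_le_mul_of_nonneg_left h ht.le) hn.le)
  have hexp_t₁ : ∀ {D' : ℝ}, 0 ≤ D' → Real.exp (-(t₁ * D' / n)) ≤ Real.exp (-(t * D' / n)) := fun hD' =>
    Real.exp_le_exp.2 (by rw [neg_le_neg_iff]; exact div_le_div_of_nonneg_right (mul_le_mul_of_nonneg_right htt₁ hD') hn.le)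
  have hexp_t₂ : ∀ {D' : ℝ}, 0 ≤ D' → Real.exp (-(t₂ * D' / n)) ≤ Real.exp (-(t * D' / n)) := fun hD' =>
    Real.exp_le_exp.2 (by rw [neg_le_neg_iff]; exact div_le_div_of_nonneg_right (mul_le_mul_of_nonneg_right htt₂ hD') hn.le)
  have hslack1 : Real.exp (t * (2 * r) / n) ≤ e := by
    rw [hedef]; refine Real.exp_le_exp.2 ?_
    rw [div_le_one hn]
    have h1 : t * (2 * r) ≤ 1 * (2 * r) := mul_le_mul_of_nonneg_right ht1 (by positivity)
    linarith
  have hslack3 : Real.exp (t * (2 * r + n + 1) / n) ≤ e ^ 3 := by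
    rw [hedef, ← Real.exp_nat_mul]; refine Real.exp_le_exp.2 ?_
    rw [div_le_iff₀ hn]
    have h1 : t * (2 * r + n + 1) ≤ 1 * (2 * r + n + 1) := mul_le_mul_of_nonneg_right ht1 (by positivity)
    push_cast
    linarith
  -- distance bookkeeping: `dist(z, supp f) ≥ D − |x₀ − z|_∞`
  have hsuppz : ∀ z w, f w ≠ 0 → max (D - supDist x₀ z) 0 ≤ (supDist z w : ℝ) := fun z w hw => by
    refine max_le ?_ (Nat.cast_nonneg _)
    have h1 := hsupp w hw
    have h2 := supDist_triangle x₀ z w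
    have : ((supDist x₀ w : ℕ) : ℝ) ≤ ((supDist x₀ z + supDist z w : ℕ) : ℝ) := by exact_mod_cast h2
    push_cast at this; linarith
  ----------------------------------------------------------------------------------------------------------------
  -- the gauge
  set hg := centredGaugeDir U x₀ (2 * r) i with hhg
  set U' := GaugeField.gaugeAct hg U with hU'
  set ψ : Balaban1983to89.Site P 0 → ℂ := fun z => toC (hg z) * φ z with hψdef
  -- the torus source of the gauge copy (`= h·f` on the deep ball)
  set f' : Balaban1983to89.Site P 0 → ℂ := nOp a' P.eps⁻¹ U' k univ *ᵥ ψ with hf'def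
  have hψeq : nOp a' P.eps⁻¹ U' k univ *ᵥ ψ = f' := rfl
  have hf'z : ∀ z, supDist x₀ z ≤ 2 * r → f' z = toC (hg z) * f z := by
    intro z hz
    have hzΩ : z ∈ Ω := hinΩ z (by omega)
    have hs : ∀ ν, z.shift ν ∈ Ω := fun ν => hinΩ _ ((supDist_shift_le_succ x₀ z ν).trans (by omega))
    have hu : ∀ ν, z.unshift ν ∈ Ω := fun ν => hinΩ _ ((supDist_unshift_le_succ x₀ z ν).trans (by omega))
    exact source_eq_on_ball hk0 hc' ha' hg U hΩ f hzΩ hs hu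
  have hnormψ : ∀ z, ‖ψ z‖ = ‖φ z‖ := fun z => by simp only [hψdef]; rw [norm_mul, norm_toC, one_mul]
  have hnormf' : ∀ z, supDist x₀ z ≤ 2 * r → ‖f' z‖ = ‖f z‖ := fun z hz => by rw [hf'z z hz, norm_mul, norm_toC, one_mul]
  have hcov : ∀ z ν, ‖cfg U' ⟨z, ν⟩ * ψ (z.shift ν) - ψ z‖ = ‖cfg U ⟨z, ν⟩ * φ (z.shift ν) - φ z‖ := fun z ν =>
    norm_covDiff_gaugeAct hg U φ z ν
  set γ : ℝ := ((P.d - 1 : ℕ) : ℝ) * θ with hγdef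
  have hγ0 : 0 ≤ γ := by positivity
  have hγn : γ * n ^ 2 ≤ 1 := gamma_nsq_le_one hθ0 hd1' hsmall
  have hgauge : ∀ z ν, supDist x₀ z ≤ 2 * r → ‖cfg U' ⟨z, ν⟩ - 1‖ ≤ γ * ((min (supDist x₀ z) (supDist x₁ z) : ℕ) : ℝ) := by
    intro z ν hz
    have h1 := dist1_centredGaugeDir_le_min_of_near U hθ0 x₀ hnear hRb i hx₁ z hz ν
    rw [BIJ88Smooth43Axial.dist1_eq_norm_toC_sub_one] at h1
    calc ‖cfg U' ⟨z, ν⟩ - 1‖ = ‖toC (GaugeField.gaugeAct hg U ⟨z, ν⟩) - 1‖ := rfl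
      _ ≤ ((P.d - 1 : ℕ) : ℝ) * ((min (supDist x₀ z) (supDist x₁ z) : ℕ) : ℝ) * θ := h1
      _ = γ * ((min (supDist x₀ z) (supDist x₁ z) : ℕ) : ℝ) := by rw [hγdef]; ring
  -- the axis bonds are trivial
  have haxis : ∀ (z : Balaban1983to89.Site P 0) (μ' : Fin P.d), (∀ ν, ν ≠ i → z ν = x₀ ν) → supDist x₀ z ≤ ρ →
      cfg U' ⟨z, μ'⟩ = 1 := by
    intro z μ' hz hzρ
    have hz2 : supDist x₀ z ≤ 2 * r := by omega
    have h1 := dist1_centredGaugeDir_le_of_near U hθ0 x₀ hnear hRb i z hz2 μ' (n := 0) (fun ν hν => by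
      rw [hz ν hν, sub_self]; exact le_of_eq ((B3TorusRadialSums.cdist_eq_zero_iff _).2 rfl))
    rw [Nat.cast_zero, mul_zero, zero_mul, BIJ88Smooth43Axial.dist1_eq_norm_toC_sub_one] at h1
    exact sub_eq_zero.1 (norm_le_zero_iff.1 h1)
  refine ⟨haxis, ?_⟩
  ----------------------------------------------------------------------------------------------------------------
  -- the local data
  set S : ℝ := c_v * P.spacing k ^ 2 * F * E * e ^ 3 with hSdef
  have hS0 : 0 ≤ S := by positivity
  have hSψ : ∀ z, supDist x₀ z ≤ 2 * r + P.L ^ k + 1 → ‖ψ z‖ ≤ S := by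
    intro z hz
    rw [hnormψ]
    refine (hvalP z f F _ hF (hsuppz z)).trans ?_
    have h2 : Real.exp (-(t₁ * max (D - supDist x₀ z) 0 / n)) ≤ E * e ^ 3 := by
      refine ((hexp_t₁ (le_max_right _ _)).trans (hexpD (le_max_left _ _))).trans ?_
      have hz' : (supDist x₀ z : ℝ) ≤ 2 * r + n + 1 := by
        have : ((supDist x₀ z : ℕ) : ℝ) ≤ ((2 * r + P.L ^ k + 1 : ℕ) : ℝ) := by exact_mod_cast hz
        push_cast at this; rw [hndef]; exact this
      calc Real.exp (-(t * (D - supDist x₀ z) / n)) = E * Real.exp (t * supDist x₀ z / n) := by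
            rw [hEdef, ← Real.exp_add]; congr 1; ring
        _ ≤ E * Real.exp (t * (2 * r + n + 1) / n) := by
            refine mul_le_mul_of_nonneg_left (Real.exp_le_exp.2 ?_) hE0.le
            exact div_le_div_of_nonneg_right (mul_le_mul_of_nonneg_left hz' ht.le) hn.le
        _ ≤ E * e ^ 3 := mul_le_mul_of_nonneg_left hslack3 hE0.le
    calc c_v * P.spacing k ^ 2 * Real.exp (-(t₁ * max (D - ↑(supDist x₀ z)) 0 / n)) * F
        ≤ c_v * P.spacing k ^ 2 * (E * e ^ 3) * F := by gcongr
      _ = S := by rw [hSdef]; ring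
  set Mloc : ℝ := P.eps * (c_d * P.spacing k * F * E * e) with hMlocdef
  have hMloc0 : 0 ≤ Mloc := by positivity
  have hMψ : ∀ z ν, supDist x₀ z ≤ 2 * r → ‖cfg U' ⟨z, ν⟩ * ψ (z.shift ν) - ψ z‖ ≤ Mloc := by
    intro z ν hz
    rw [hcov]
    have h1 := hderP z ν f F _ hF (hsuppz z) (hdeepz z hz)
    have hcovD : ‖covD P.eps⁻¹ (cfg U) φ ⟨z, ν⟩‖ = P.eps⁻¹ * ‖cfg U ⟨z, ν⟩ * φ (z.shift ν) - φ z‖ := by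
      show ‖((P.eps⁻¹ : ℝ) : ℂ) * (cfg U ⟨z, ν⟩ * φ (z.shift ν) - φ z)‖ = _
      rw [norm_mul, Complex.norm_real, Real.norm_of_nonneg (inv_nonneg.2 hε.le)]
    rw [hcovD] at h1
    have h2 : Real.exp (-(t₂ * max (D - supDist x₀ z) 0 / n)) ≤ E * e := by
      refine ((hexp_t₂ (le_max_right _ _)).trans (hexpD (le_max_left _ _))).trans ?_
      have hz' : (supDist x₀ z : ℝ) ≤ 2 * r := by exact_mod_cast hz
      calc Real.exp (-(t * (D - supDist x₀ z) / n)) = E * Real.exp (t * supDist x₀ z / n) := by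
            rw [hEdef, ← Real.exp_add]; congr 1; ring
        _ ≤ E * Real.exp (t * (2 * r) / n) := by
            refine mul_le_mul_of_nonneg_left (Real.exp_le_exp.2 ?_) hE0.le
            exact div_le_div_of_nonneg_right (mul_le_mul_of_nonneg_left hz' ht.le) hn.le
        _ ≤ E * e := mul_le_mul_of_nonneg_left hslack1 hE0.le
    have h3 : ‖cfg U ⟨z, ν⟩ * φ (z.shift ν) - φ z‖ ≤ P.eps * (c_d * P.spacing k * Real.exp (-(t₂ * max (D - ↑(supDist x₀ z)) 0 / n)) * F) := by
      have := mul_le_mul_of_nonneg_left h1 hε.le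
      rwa [← mul_assoc, mul_inv_cancel₀ hε.ne', one_mul] at this
    refine h3.trans ?_
    rw [hMlocdef]
    refine mul_le_mul_of_nonneg_left ?_ hε.le
    calc c_d * P.spacing k * Real.exp (-(t₂ * max (D - ↑(supDist x₀ z)) 0 / n)) * F ≤ c_d * P.spacing k * (E * e) * F := by gcongr
      _ = c_d * P.spacing k * F * E * e := by ring
  set Floc : ℝ := F * E * e with hFlocdef
  have hFloc0 : 0 ≤ Floc := by positivity
  have hFf' : ∀ z, supDist x₀ z ≤ 2 * r → ‖f' z‖ ≤ Floc := by
    intro z hz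
    rw [hnormf' z hz]
    by_cases hfz : f z = 0
    · rw [hfz, norm_zero]; exact hFloc0
    · have h1 : D ≤ 2 * r := by
        have := hsupp z hfz
        have h2 : ((supDist x₀ z : ℕ) : ℝ) ≤ ((2 * r : ℕ) : ℝ) := by exact_mod_cast hz
        push_cast at h2; linarith
      have h2 : 1 ≤ E * e := by
        have h3 : Real.exp (-(t * (2 * r) / n)) ≤ E := hexpD h1
        have h4 : Real.exp (-(t * (2 * r) / n)) * Real.exp (t * (2 * r) / n) = 1 := by
          rw [← Real.exp_add, neg_add_cancel, Real.exp_zero]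
        calc (1 : ℝ) = Real.exp (-(t * (2 * r) / n)) * Real.exp (t * (2 * r) / n) := h4.symm
          _ ≤ E * e := mul_le_mul h3 hslack1 (Real.exp_pos _).le hE0.le
      calc ‖f z‖ ≤ F := hF z
        _ = F * 1 := (mul_one F).symm
        _ ≤ F * (E * e) := mul_le_mul_of_nonneg_left h2 hF0
        _ = Floc := by rw [hFlocdef]; ring
  -- the Hölder envelopes of the difference kernel
  have hPdR : (P.d : ℝ) = ((d + 1 : ℕ) : ℝ) := by rw [hPd]
  set A : ℝ := C_H * P.eps ^ 2 * (ρ : ℝ) ^ α with hAdef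
  have hA0 : 0 ≤ A := by positivity
  have hK1 : ∀ z, |((B1RG242Torus.tower P a 0).G k (x₁.shift μ) z - (B1RG242Torus.tower P a 0).G k x₁ z) -
      ((B1RG242Torus.tower P a 0).G k (x₀.shift μ) z - (B1RG242Torus.tower P a 0).G k x₀ z)| ≤
      A / (max ((min (supDist x₀ z) (supDist x₁ z) : ℕ) : ℝ) 1) ^ ((P.d : ℝ) - 1 + α) := fun z => by
    rw [hAdef, hPdR]; exact hholP.1 μ x₀ x₁ z
  have hK2 : ∀ (ν : Fin P.d) z,
      |(((B1RG242Torus.tower P a 0).G k (x₁.shift μ) (z.shift ν) - (B1RG242Torus.tower P a 0).G k x₁ (z.shift ν)) -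
          ((B1RG242Torus.tower P a 0).G k (x₀.shift μ) (z.shift ν) - (B1RG242Torus.tower P a 0).G k x₀ (z.shift ν))) -
        (((B1RG242Torus.tower P a 0).G k (x₁.shift μ) z - (B1RG242Torus.tower P a 0).G k x₁ z) -
          ((B1RG242Torus.tower P a 0).G k (x₀.shift μ) z - (B1RG242Torus.tower P a 0).G k x₀ z))| ≤
      A / (max ((min (supDist x₀ z) (supDist x₁ z) : ℕ) : ℝ) 1) ^ ((P.d : ℝ) + α) := fun ν z => by
    have h := hholP.2 μ ν x₀ x₁ z
    rw [hAdef, hPdR]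
    refine le_trans (le_of_eq ?_) h
    congr 1; ring
  -- THE LOCAL ESTIMATE
  have hmain := hloc P hPd ha hk1 hkK hr4 hN' x₀ x₁ μ hρr U' ψ f' hψeq hA0 hγ0 hS0 hMloc0 hFloc0 hK1 hK2 hgauge hSψ hMψ hFf'
  -- its left-hand side is the target quantity
  have hLHS : (toC (hg (x₁.shift μ)) * φ (x₁.shift μ) - toC (hg x₁) * φ x₁) - (toC (hg (x₀.shift μ)) * φ (x₀.shift μ) - toC (hg x₀) * φ x₀) =
      (ψ (x₁.shift μ) - ψ x₁) - (ψ (x₀.shift μ) - ψ x₀) := rfl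
  rw [hLHS]
  refine hmain.trans ?_
  ----------------------------------------------------------------------------------------------------------------
  -- the powers
  set Pw : ℝ := (r : ℝ) ^ (1 - α) with hPw
  set Qw : ℝ := ((r : ℝ) + (P.L : ℝ) ^ k) ^ (1 - α) with hQw
  set W : ℝ := (ρ : ℝ) ^ α * n ^ (1 - α) with hWdef
  have h1α : 0 ≤ 1 - α := by linarith
  have hρα : 0 ≤ (ρ : ℝ) ^ α := Real.rpow_nonneg hρ0.le α
  have hnα : 0 < n ^ (1 - α) := Real.rpow_pos_of_pos hn _
  have hW0 : 0 ≤ W := by positivity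
  have hWeq : ((ρ : ℝ) / n) ^ α * n = W := div_rpow_mul_eq hρ0.le hn
  have p1 : Pw ≤ n ^ (1 - α) := Real.rpow_le_rpow hr0.le (by linarith) h1α
  have p2 : Qw ≤ 2 * n ^ (1 - α) := by
    rw [hQw, ← hndef]
    exact rpow_le_mul_rpow (by norm_num) (by positivity) hn.le (by linarith) h1α (by linarith)
  have p3 : (r : ℝ) ^ (-α) ≤ 16 * n ^ (-α) := rpow_neg_le_of_le_mul hr0 hn hr16 hα0 hα1.le
  have p4 : n ^ (-α) * n = n ^ (1 - α) := by
    rw [show (1 : ℝ) - α = -α + 1 by ring, Real.rpow_add hn, Real.rpow_one]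
  have hsp2 : P.spacing k ^ 2 = n ^ 2 * P.eps ^ 2 := by rw [hsp]; ring
  -- the five terms against `W ε² E F`
  have q1 : Floc * A * Pw ≤ (C_H * e) * (W * P.eps ^ 2 * E * F) := by
    calc Floc * A * Pw = (C_H * e) * ((ρ : ℝ) ^ α * Pw) * P.eps ^ 2 * E * F := by rw [hFlocdef, hAdef]; ring
      _ ≤ (C_H * e) * ((ρ : ℝ) ^ α * n ^ (1 - α)) * P.eps ^ 2 * E * F := by gcongr
      _ = (C_H * e) * (W * P.eps ^ 2 * E * F) := by rw [hWdef]; ring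
  have q2 : P.eps⁻¹ ^ 2 * (γ * A * (r * Pw * Mloc)) ≤ (C_H * (c_d * e)) * (W * P.eps ^ 2 * E * F) := by
    have e1 : P.eps⁻¹ ^ 2 * (γ * A * (r * Pw * Mloc)) = (C_H * (c_d * e)) * ((γ * (r * n)) * ((ρ : ℝ) ^ α * Pw)) * P.eps ^ 2 * E * F := by
      rw [hAdef, hMlocdef, hsp]; field_simp
    rw [e1]
    have h1 : γ * (r * n) ≤ 1 := by
      calc γ * (r * n) ≤ γ * (n * n) := by gcongr; linarith
        _ = γ * n ^ 2 := by ring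
        _ ≤ 1 := hγn
    have h2 : (γ * (r * n)) * ((ρ : ℝ) ^ α * Pw) ≤ 1 * ((ρ : ℝ) ^ α * n ^ (1 - α)) :=
      mul_le_mul h1 (mul_le_mul_of_nonneg_left p1 hρα) (by positivity) zero_le_one
    calc (C_H * (c_d * e)) * ((γ * (r * n)) * ((ρ : ℝ) ^ α * Pw)) * P.eps ^ 2 * E * F
        ≤ (C_H * (c_d * e)) * (1 * ((ρ : ℝ) ^ α * n ^ (1 - α))) * P.eps ^ 2 * E * F := by gcongr
      _ = (C_H * (c_d * e)) * (W * P.eps ^ 2 * E * F) := by rw [hWdef]; ring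
  have q3 : P.eps⁻¹ ^ 2 * (γ * A * (Pw * S)) ≤ (C_H * (c_v * e ^ 3)) * (W * P.eps ^ 2 * E * F) := by
    have e1 : P.eps⁻¹ ^ 2 * (γ * A * (Pw * S)) = (C_H * (c_v * e ^ 3)) * ((γ * n ^ 2) * ((ρ : ℝ) ^ α * Pw)) * P.eps ^ 2 * E * F := by
      rw [hAdef, hSdef, hsp2]; field_simp
    rw [e1]
    have h2 : (γ * n ^ 2) * ((ρ : ℝ) ^ α * Pw) ≤ 1 * ((ρ : ℝ) ^ α * n ^ (1 - α)) :=
      mul_le_mul hγn (mul_le_mul_of_nonneg_left p1 hρα) (by positivity) zero_le_one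
    calc (C_H * (c_v * e ^ 3)) * ((γ * n ^ 2) * ((ρ : ℝ) ^ α * Pw)) * P.eps ^ 2 * E * F
        ≤ (C_H * (c_v * e ^ 3)) * (1 * ((ρ : ℝ) ^ α * n ^ (1 - α))) * P.eps ^ 2 * E * F := by gcongr
      _ = (C_H * (c_v * e ^ 3)) * (W * P.eps ^ 2 * E * F) := by rw [hWdef]; ring
  have q4 : P.eps⁻¹ ^ 2 * (A * S * ((r : ℝ) ^ (-α) / r)) ≤ (C_H * (256 * c_v * e ^ 3)) * (W * P.eps ^ 2 * E * F) := by
    have e1 : P.eps⁻¹ ^ 2 * (A * S * ((r : ℝ) ^ (-α) / r)) =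
        (C_H * (c_v * e ^ 3)) * ((ρ : ℝ) ^ α * ((r : ℝ) ^ (-α) * (n ^ 2 / r))) * P.eps ^ 2 * E * F := by
      rw [hAdef, hSdef, hsp2]; field_simp
    rw [e1]
    have h1 : n ^ 2 / r ≤ 16 * n := by
      rw [div_le_iff₀ hr0]
      calc n ^ 2 = n * n := sq n
        _ ≤ n * (16 * r) := mul_le_mul_of_nonneg_left hr16 hn.le
        _ = 16 * n * r := by ring
    have h2 : (r : ℝ) ^ (-α) * (n ^ 2 / r) ≤ (16 * n ^ (-α)) * (16 * n) :=
      mul_le_mul p3 h1 (by positivity) (by positivity)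
    have h3 : (ρ : ℝ) ^ α * ((r : ℝ) ^ (-α) * (n ^ 2 / r)) ≤ 256 * ((ρ : ℝ) ^ α * n ^ (1 - α)) := by
      calc (ρ : ℝ) ^ α * ((r : ℝ) ^ (-α) * (n ^ 2 / r)) ≤ (ρ : ℝ) ^ α * ((16 * n ^ (-α)) * (16 * n)) :=
            mul_le_mul_of_nonneg_left h2 hρα
        _ = 256 * ((ρ : ℝ) ^ α * (n ^ (-α) * n)) := by ring
        _ = 256 * ((ρ : ℝ) ^ α * n ^ (1 - α)) := by rw [p4]
    calc (C_H * (c_v * e ^ 3)) * ((ρ : ℝ) ^ α * ((r : ℝ) ^ (-α) * (n ^ 2 / r))) * P.eps ^ 2 * E * F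
        ≤ (C_H * (c_v * e ^ 3)) * (256 * ((ρ : ℝ) ^ α * n ^ (1 - α))) * P.eps ^ 2 * E * F := by gcongr
      _ = (C_H * (256 * c_v * e ^ 3)) * (W * P.eps ^ 2 * E * F) := by rw [hWdef]; ring
  have q5 : B1RG242Torus.α P a k * A * Qw * S ≤ (C_H * (2 * a * c_v * e ^ 3)) * (W * P.eps ^ 2 * E * F) := by
    have e1 : B1RG242Torus.α P a k * A * Qw * S =
        (C_H * (c_v * e ^ 3)) * ((B1RG242Torus.α P a k * P.spacing k ^ 2) * ((ρ : ℝ) ^ α * Qw)) * P.eps ^ 2 * E * F := by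
      rw [hAdef, hSdef]; ring
    rw [e1]
    have h2 : (B1RG242Torus.α P a k * P.spacing k ^ 2) * ((ρ : ℝ) ^ α * Qw) ≤ a * (2 * ((ρ : ℝ) ^ α * n ^ (1 - α))) := by
      refine mul_le_mul hαa ?_ (by positivity) ha.le
      calc (ρ : ℝ) ^ α * Qw ≤ (ρ : ℝ) ^ α * (2 * n ^ (1 - α)) := mul_le_mul_of_nonneg_left p2 hρα
        _ = _ := by ring
    calc (C_H * (c_v * e ^ 3)) * ((B1RG242Torus.α P a k * P.spacing k ^ 2) * ((ρ : ℝ) ^ α * Qw)) * P.eps ^ 2 * E * F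
        ≤ (C_H * (c_v * e ^ 3)) * (a * (2 * ((ρ : ℝ) ^ α * n ^ (1 - α)))) * P.eps ^ 2 * E * F := by gcongr
      _ = (C_H * (2 * a * c_v * e ^ 3)) * (W * P.eps ^ 2 * E * F) := by rw [hWdef]; ring
  have hsum : Floc * A * Pw + P.eps⁻¹ ^ 2 * (γ * A * (r * Pw * Mloc + Pw * S) + A * S * ((r : ℝ) ^ (-α) / r)) +
      B1RG242Torus.α P a k * A * Qw * S ≤
      (C_H * (e + c_d * e + c_v * e ^ 3 + 256 * c_v * e ^ 3 + 2 * a * c_v * e ^ 3)) * (W * P.eps ^ 2 * E * F) := by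
    have e1 : P.eps⁻¹ ^ 2 * (γ * A * (r * Pw * Mloc + Pw * S) + A * S * ((r : ℝ) ^ (-α) / r)) =
        P.eps⁻¹ ^ 2 * (γ * A * (r * Pw * Mloc)) + P.eps⁻¹ ^ 2 * (γ * A * (Pw * S)) + P.eps⁻¹ ^ 2 * (A * S * ((r : ℝ) ^ (-α) / r)) := by
      ring
    rw [e1]
    linarith only [q1, q2, q3, q4, q5]
  have hWε : W * P.eps ^ 2 * E * F = ((ρ : ℝ) / n) ^ α * P.spacing k * P.eps * E * F := by
    rw [← hWeq, hsp]; ring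
  have hfin : C_L * ((C_H * (e + c_d * e + c_v * e ^ 3 + 256 * c_v * e ^ 3 + 2 * a * c_v * e ^ 3)) * (W * P.eps ^ 2 * E * F)) =
      K₁ * (((ρ : ℝ) / n) ^ α * P.spacing k * P.eps * E * F) := by rw [hWε, hK₁]; ring
  have hunit : 0 ≤ ((ρ : ℝ) / n) ^ α * P.spacing k * P.eps * E * F := by positivity
  calc C_L * (Floc * A * Pw + P.eps⁻¹ ^ 2 * (γ * A * (r * Pw * Mloc + Pw * S) + A * S * ((r : ℝ) ^ (-α) / r)) +
        B1RG242Torus.α P a k * A * Qw * S)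
      ≤ C_L * ((C_H * (e + c_d * e + c_v * e ^ 3 + 256 * c_v * e ^ 3 + 2 * a * c_v * e ^ 3)) * (W * P.eps ^ 2 * E * F)) :=
        mul_le_mul_of_nonneg_left hsum hCL.le
    _ = K₁ * (((ρ : ℝ) / n) ^ α * P.spacing k * P.eps * E * F) := hfin
    _ ≤ (K₁ + 1) * (((ρ : ℝ) / n) ^ α * P.spacing k * P.eps * E * F) := by nlinarith only [hunit]
    _ = (K₁ + 1) * ((supDist x₀ x₁ : ℝ) / (P.L : ℝ) ^ k) ^ α * P.spacing k * P.eps * Real.exp (-(t * D / (P.L : ℝ) ^ k)) * F := by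
        rw [hρdef, hEdef, hndef]; ring

end LegGauged

/-! ## §D The gauge-invariant Hölder estimate at an axis-parallel deep pair, and ALL deep pairs, plaquettes NEAR `Ω` only -/

section Leg

variable {d : ℕ}

/-- **THE HÖLDER MEMBER OF [6] (1.9) FOR THE REGION PROPAGATOR AT AN AXIS-PARALLEL DEEP PAIR, GAUGE-INVARIANT FORM, PLAQUETTES SMALL NEAR `Ω`
ONLY** — p34's `holder19_region_leg` with the local plaquette hypothesis: `k`-uniformly, for every `k`-block union, every `x` with
`dist_∞(x, T∖Ω) ≥ 2L^k`, directions `i, μ`, every `1 ≤ ρ ≤ L^k/64`, every `f` with `|f| ≤ F` vanishing at sup-distance `< D` from `x`, with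
`x′ = x + ρe_i` and `Γ = [x, x′]`: `‖U(Γ)·(D_uG_k(Ω,u)f)(⟨x′, μ⟩) − (D_uG_k(Ω,u)f)(⟨x, μ⟩)‖ ≤ c₀(ρ/L^k)^α(L^kε)e^{−t₀D/L^k}F`.  Proof: §C and gauge
covariance (p30's `axisHol_gaugeAct`, `covD_gaugeAct`), verbatim.
[cite: Balaban1983RegularityDecay, Theorem p.573 (1.9)] [cite: BalabanImbrieJaffe1988, (2.31)/(2.32) p.263] [cite: BalabanImbrieJaffe1985, (2.7) p.303, p.326] -/
theorem holder19_smoothNear_region_leg (d L : ℕ) (hd1 : 1 ≤ d) (hd3 : d + 1 ≤ 3) (hL : Odd L ∧ 1 < L) {a : ℝ} (ha : 0 < a) {α : ℝ} (hα0 : 0 ≤ α)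
    (hα1 : α < 1) :
    ∃ t₀ c₀ : ℝ, 0 < t₀ ∧ 0 < c₀ ∧ ∀ (P : Params), P.d = d + 1 → P.L = L →
      ∀ k : ℕ, 1 ≤ k → k ≤ P.K → ∀ Ω : Finset (Balaban1983to89.Site P 0), IsBlockUnion k Ω →
        ∀ (U : GaugeField P 0 U1) (θ T δ : ℝ), 0 ≤ θ →
          (∀ p : Balaban1983to89.Plaq P 0, (∃ y ∈ Ω, supDist y p.src ≤ 2 * P.L ^ k) → ‖toC (plaqHol U p) - 1‖ ≤ θ) →
          2 * (P.d : ℝ) ^ 3 * (((P.L : ℝ) ^ k) ^ 2 * θ) ^ 2 ≤ 1 →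
          (∀ b ∈ starB Ω, blkIter k b.src = blkIter k b.tgt → ‖toC (U b) - 1‖ ≤ T) →
          (∀ y ∈ Ω, ‖holCK U k y - 1‖ ≤ δ) →
          2 * (((P.L : ℝ) ^ k - 1) * (P.L : ℝ) ^ k) * P.d * T ^ 2 + 2 * δ ^ 2 ≤ 1 / 2 →
        ∀ (x : Balaban1983to89.Site P 0) (i μ : Fin P.d) (ρ : ℕ), 1 ≤ ρ → 64 * ρ ≤ P.L ^ k →
          (∀ w, w ∉ Ω → 2 * P.L ^ k ≤ supDist x w) →
        ∀ (f : Balaban1983to89.Site P 0 → ℂ) (F D : ℝ),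
          (∀ z, ‖f z‖ ≤ F) → (∀ z, f z ≠ 0 → D ≤ (supDist x z : ℝ)) →
          ‖toC (axisHol U i ρ x) *
                covD P.eps⁻¹ (cfg U) (gBox (B1RG242Torus.α P a k * (P.L : ℝ) ^ (k * P.d)) P.eps⁻¹ U k Ω *ᵥ f) ⟨runSite x i ρ, μ⟩ -
              covD P.eps⁻¹ (cfg U) (gBox (B1RG242Torus.α P a k * (P.L : ℝ) ^ (k * P.d)) P.eps⁻¹ U k Ω *ᵥ f) ⟨x, μ⟩‖
            ≤ c₀ * ((ρ : ℝ) / (P.L : ℝ) ^ k) ^ α * P.spacing k * Real.exp (-(t₀ * D / (P.L : ℝ) ^ k)) * F := by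
  obtain ⟨t₀, c₀, ht₀, hc₀, hleg⟩ := holder19_smoothNear_region_leg_gauged d L hd1 hd3 hL ha hα0 hα1
  refine ⟨t₀, c₀, ht₀, hc₀, ?_⟩
  intro P hPd hPL k hk1 hkK Ω hΩ U θ T δ hθ0 hθ hsmall hInt hTree hsmallT x i μ ρ hρ1 hρ64 hdeep f F D hF hsupp
  have hk : k ≤ P.m + P.K := hkK.trans (Nat.le_add_left _ _)
  have hNN : 2 * P.L ^ k ≤ P.sitesPerDir 0 := BIJ85ScalarPropagatorSupDecayDeriv.two_mul_pow_le_sitesPerDir hk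
  set x₁ := runSite x i ρ with hx₁
  have hax : ∀ ν, ν ≠ i → x₁ ν = x ν := fun ν hν => runSite_apply_ne x hν ρ
  have hdist : supDist x x₁ = ρ := supDist_runSite_eq x i (by omega)
  have h1 : 1 ≤ supDist x x₁ := by rw [hdist]; exact hρ1
  have h64 : 64 * supDist x x₁ ≤ P.L ^ k := by rw [hdist]; exact hρ64
  obtain ⟨haxis, hest⟩ :=
    hleg P hPd hPL k hk1 hkK Ω hΩ U θ T δ hθ0 hθ hsmall hInt hTree hsmallT x x₁ i μ hax h1 h64 hdeep f F D hF hsupp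
  rw [hdist] at hest
  set hg := BIJ85BiCentredAxialGauge.centredGaugeDir U x (2 * (P.L ^ k / 8)) i with hhg
  set φ := gBox (B1RG242Torus.α P a k * (P.L : ℝ) ^ (k * P.d)) P.eps⁻¹ U k Ω *ᵥ f with hφ
  set U' := gaugeAct hg U with hU'
  set ψ : Balaban1983to89.Site P 0 → ℂ := fun z => toC (hg z) * φ z with hψ
  -- the transport and the two bond variables are trivial in the gauge
  have hseg : ∀ s, s < ρ → cfg U' ⟨runSite x i s, i⟩ = 1 := fun s hs =>
    haxis (runSite x i s) i (fun ν hν => runSite_apply_ne x hν s) (by rw [hdist]; exact (supDist_runSite_le x i s).trans hs.le)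
  have hA' : toC (axisHol U' i ρ x) = 1 := toC_axisHol_eq_one U' i ρ x hseg
  have hu0 : cfg U' ⟨x, μ⟩ = 1 := haxis x μ (fun _ _ => rfl) (by rw [(supDist_eq_zero_iff x x).2 rfl]; exact Nat.zero_le _)
  have hu1 : cfg U' ⟨x₁, μ⟩ = 1 := haxis x₁ μ hax le_rfl
  -- gauge covariance of the three factors
  have hAg : toC (axisHol U' i ρ x) = toC (hg x) * toC (axisHol U i ρ x) * conj (toC (hg x₁)) := by
    rw [hU', axisHol_gaugeAct, toC_mul, toC_mul, toC_inv]
  have hD0 : covD P.eps⁻¹ (cfg U') ψ ⟨x, μ⟩ = toC (hg x) * covD P.eps⁻¹ (cfg U) φ ⟨x, μ⟩ := covD_gaugeAct _ hg U φ _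
  have hD1 : covD P.eps⁻¹ (cfg U') ψ ⟨x₁, μ⟩ = toC (hg x₁) * covD P.eps⁻¹ (cfg U) φ ⟨x₁, μ⟩ := covD_gaugeAct _ hg U φ _
  -- the invariant quantity in the gauge
  have hkey : toC (hg x) * (toC (axisHol U i ρ x) * covD P.eps⁻¹ (cfg U) φ ⟨x₁, μ⟩ - covD P.eps⁻¹ (cfg U) φ ⟨x, μ⟩) =
      toC (axisHol U' i ρ x) * covD P.eps⁻¹ (cfg U') ψ ⟨x₁, μ⟩ - covD P.eps⁻¹ (cfg U') ψ ⟨x, μ⟩ := by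
    rw [hAg, hD0, hD1]
    have h1 : conj (toC (hg x₁)) * toC (hg x₁) = 1 := conj_mul_toC _
    linear_combination (-(toC (hg x) * toC (axisHol U i ρ x) * covD P.eps⁻¹ (cfg U) φ ⟨x₁, μ⟩)) * h1
  -- in the gauge: plain second difference divided by `ε`
  have hgauged : toC (axisHol U' i ρ x) * covD P.eps⁻¹ (cfg U') ψ ⟨x₁, μ⟩ - covD P.eps⁻¹ (cfg U') ψ ⟨x, μ⟩ =
      ((P.eps⁻¹ : ℝ) : ℂ) * ((ψ (x₁.shift μ) - ψ x₁) - (ψ (x.shift μ) - ψ x)) := by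
    rw [hA', one_mul]
    simp only [covD, hu0, hu1, one_mul]
    show ((P.eps⁻¹ : ℝ) : ℂ) * (ψ (x₁.shift μ) - ψ x₁) - ((P.eps⁻¹ : ℝ) : ℂ) * (ψ (x.shift μ) - ψ x) = _
    ring
  have hnorm : ‖toC (axisHol U i ρ x) * covD P.eps⁻¹ (cfg U) φ ⟨x₁, μ⟩ - covD P.eps⁻¹ (cfg U) φ ⟨x, μ⟩‖ =
      P.eps⁻¹ * ‖(ψ (x₁.shift μ) - ψ x₁) - (ψ (x.shift μ) - ψ x)‖ := by
    have h1 : ‖toC (hg x) * (toC (axisHol U i ρ x) * covD P.eps⁻¹ (cfg U) φ ⟨x₁, μ⟩ - covD P.eps⁻¹ (cfg U) φ ⟨x, μ⟩)‖ =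
        ‖toC (axisHol U i ρ x) * covD P.eps⁻¹ (cfg U) φ ⟨x₁, μ⟩ - covD P.eps⁻¹ (cfg U) φ ⟨x, μ⟩‖ := by
      rw [norm_mul, norm_toC, one_mul]
    rw [← h1, hkey, hgauged, norm_mul, Complex.norm_real, Real.norm_of_nonneg (inv_nonneg.2 P.eps_pos.le)]
  rw [hnorm]
  have hε : 0 < P.eps := P.eps_pos
  calc P.eps⁻¹ * ‖(ψ (x₁.shift μ) - ψ x₁) - (ψ (x.shift μ) - ψ x)‖
      ≤ P.eps⁻¹ * (c₀ * ((ρ : ℝ) / (P.L : ℝ) ^ k) ^ α * P.spacing k * P.eps * Real.exp (-(t₀ * D / (P.L : ℝ) ^ k)) * F) :=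
        mul_le_mul_of_nonneg_left hest (inv_nonneg.2 hε.le)
    _ = c₀ * ((ρ : ℝ) / (P.L : ℝ) ^ k) ^ α * P.spacing k * Real.exp (-(t₀ * D / (P.L : ℝ) ^ k)) * F := by field_simp

end Leg

section Main

variable {d : ℕ}

set_option maxHeartbeats 400000 in
/-- **THE HÖLDER MEMBER OF [Balaban1983RegularityDecay] (1.9) FOR THE COVARIANT DERIVATIVE OF THE REGION NEUMANN PROPAGATOR `G_k(Ω,u)` ON A
GENERAL `k`-BLOCK UNION, ALL DEEP PAIRS, WHEN `u` IS PLAQUETTE-SMALL ONLY NEAR `Ω`** ([BalabanImbrieJaffe1988] p. 263 *"Hölder derivatives … of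
order less than two"* under the printed LOCAL hypothesis (2.32)/(2.33)): p34's `holder19_smallField_region` VERBATIM with the plaquette hypothesis
restricted to the plaquettes based within `2L^k` of `Ω`.  For `1 ≤ d`, `d+1 ≤ 3`, `L` odd `> 1`, `a > 0`, `0 ≤ α < 1` there are `t₀, c₀ > 0` (on
`d, L, a, α`) such that for every volume, every `1 ≤ k ≤ K`, every `k`-block union `Ω`, every `U(1)` field with `‖u(∂p) − 1‖ ≤ θ` for the
plaquettes based within `2L^k` of `Ω`, `2(d+1)³(L^{2k}θ)² ≤ 1`, and the bondwise `(T, δ)` hypotheses inside `Ω`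
(`2(L^k−1)L^k(d+1)T² + 2δ² ≤ 1/2`), every pair of distinct sites `x₀, x₁` BOTH `3L^k`-deep in `Ω`, every `μ`, every `f` with `|f| ≤ F`
vanishing at sup-distance `< D` from `{x₀, x₁}`:
`(L^k/|x₀−x₁|_∞)^α·‖U(Γ_{x₀,x₁})(D_uG_k(Ω,u)f)(⟨x₁,μ⟩) − (D_uG_k(Ω,u)f)(⟨x₀,μ⟩)‖ ≤ c₀(L^kε)e^{−t₀D/L^k}F`, `Γ_{x₀,x₁}` p30's staircase (`stairHol`).
Near pairs: `d+1` axis-parallel legs (§D) telescoped; far pairs: §A at both bonds.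
[cite: Balaban1983RegularityDecay, Theorem p.573 (1.9)] [cite: BalabanImbrieJaffe1988, (2.31)/(2.32) p.263] [cite: BalabanImbrieJaffe1985, p.326] -/
theorem holder19_smoothNear_region (d L : ℕ) (hd1 : 1 ≤ d) (hd3 : d + 1 ≤ 3) (hL : Odd L ∧ 1 < L) {a : ℝ} (ha : 0 < a) {α : ℝ}
    (hα0 : 0 ≤ α) (hα1 : α < 1) :
    ∃ t₀ c₀ : ℝ, 0 < t₀ ∧ 0 < c₀ ∧ ∀ (P : Params), P.d = d + 1 → P.L = L →
      ∀ k : ℕ, 1 ≤ k → k ≤ P.K → ∀ Ω : Finset (Balaban1983to89.Site P 0), IsBlockUnion k Ω →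
        ∀ (U : GaugeField P 0 U1) (θ T δ : ℝ), 0 ≤ θ →
          (∀ p : Balaban1983to89.Plaq P 0, (∃ y ∈ Ω, supDist y p.src ≤ 2 * P.L ^ k) → ‖toC (plaqHol U p) - 1‖ ≤ θ) →
          2 * (P.d : ℝ) ^ 3 * (((P.L : ℝ) ^ k) ^ 2 * θ) ^ 2 ≤ 1 →
          (∀ b ∈ starB Ω, blkIter k b.src = blkIter k b.tgt → ‖toC (U b) - 1‖ ≤ T) →
          (∀ y ∈ Ω, ‖holCK U k y - 1‖ ≤ δ) →
          2 * (((P.L : ℝ) ^ k - 1) * (P.L : ℝ) ^ k) * P.d * T ^ 2 + 2 * δ ^ 2 ≤ 1 / 2 →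
        ∀ (x₀ x₁ : Balaban1983to89.Site P 0) (μ : Fin P.d), x₀ ≠ x₁ →
          (∀ w, w ∉ Ω → 3 * P.L ^ k ≤ supDist x₀ w) →
          (∀ w, w ∉ Ω → 3 * P.L ^ k ≤ supDist x₁ w) →
        ∀ (f : Balaban1983to89.Site P 0 → ℂ) (F D : ℝ),
          (∀ z, ‖f z‖ ≤ F) → (∀ z, f z ≠ 0 → D ≤ (supDist x₀ z : ℝ) ∧ D ≤ (supDist x₁ z : ℝ)) →
          (((P.L : ℝ) ^ k / (supDist x₀ x₁ : ℝ)) ^ α *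
            ‖stairHol U x₀ x₁ *
                covD P.eps⁻¹ (cfg U) (gBox (B1RG242Torus.α P a k * (P.L : ℝ) ^ (k * P.d)) P.eps⁻¹ U k Ω *ᵥ f) ⟨x₁, μ⟩ -
              covD P.eps⁻¹ (cfg U) (gBox (B1RG242Torus.α P a k * (P.L : ℝ) ^ (k * P.d)) P.eps⁻¹ U k Ω *ᵥ f) ⟨x₀, μ⟩‖
            ≤ c₀ * P.spacing k * Real.exp (-(t₀ * D / (P.L : ℝ) ^ k)) * F) := by
  classical
  obtain ⟨t₁, c₁, ht₁, hc₁, hleg⟩ := holder19_smoothNear_region_leg d L hd1 hd3 hL ha hα0 hα1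
  obtain ⟨t₂, c₂, ht₂, hc₂, hder⟩ := decay110_smoothNear_region_deriv d L hd1 hd3 hL ha
  set t : ℝ := min t₁ t₂ with htdef
  have ht : 0 < t := lt_min ht₁ ht₂
  have htt₁ : t ≤ t₁ := min_le_left _ _
  have htt₂ : t ≤ t₂ := min_le_right _ _
  set K : ℝ := ((d + 1 : ℕ) : ℝ) * (c₁ * Real.exp t₁) + 128 * c₂ with hKdef
  refine ⟨t, K + 1, ht, by positivity, ?_⟩
  intro P hPd hPL k hk1 hkK Ω hΩ U θ T δ hθ0 hθ hsmall hInt hTree hsmallT x₀ x₁ μ hne hdeep₀ hdeep₁ f F D hF hsupp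
  have hlegP := hleg P hPd hPL k hk1 hkK Ω hΩ U θ T δ hθ0 hθ hsmall hInt hTree hsmallT
  have hderP := hder P hPd hPL k hk1 hkK Ω hΩ U θ T δ hθ0 hθ hsmall hInt hTree hsmallT
  have hPdR : (P.d : ℝ) = ((d + 1 : ℕ) : ℝ) := by rw [hPd]
  -- basic quantities
  have hLpos : (0 : ℝ) < P.L := P.cast_L_pos
  set n : ℝ := (P.L : ℝ) ^ k with hndef
  have hn : 0 < n := pow_pos hLpos k
  have hnnat : ((P.L ^ k : ℕ) : ℝ) = n := by push_cast; rw [hndef]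
  have hsp0 : 0 < P.spacing k := P.spacing_pos k
  have hε : 0 < P.eps := P.eps_pos
  have hF0 : 0 ≤ F := (norm_nonneg _).trans (hF x₀)
  have hLk1 : 1 ≤ P.L ^ k := Nat.one_le_pow _ _ P.L_pos
  set ρ : ℕ := supDist x₀ x₁ with hρdef
  have hρ1 : 1 ≤ ρ := by
    by_contra h
    push Not at h
    exact hne ((supDist_eq_zero_iff x₀ x₁).1 (by omega))
  have hρ0 : (0 : ℝ) < ρ := by exact_mod_cast hρ1
  -- the end points are `L^k`-deep (for the far `D_u` members)
  have hdx₀ : ∀ w, w ∉ Ω → P.L ^ k ≤ supDist x₀ w := fun w hw => le_trans (by omega) (hdeep₀ w hw)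
  have hdx₁ : ∀ w, w ∉ Ω → P.L ^ k ≤ supDist x₁ w := fun w hw => le_trans (by omega) (hdeep₁ w hw)
  set φ := gBox (B1RG242Torus.α P a k * (P.L : ℝ) ^ (k * P.d)) P.eps⁻¹ U k Ω *ᵥ f with hφ
  set X : Balaban1983to89.Site P 0 → ℂ := fun w => covD P.eps⁻¹ (cfg U) φ ⟨w, μ⟩ with hX
  set E : ℝ := Real.exp (-(t * D / n)) with hEdef
  have hE0 : 0 < E := Real.exp_pos _
  have hexp_t : ∀ {s D' : ℝ}, t ≤ s → D ≤ D' → 0 ≤ D' → Real.exp (-(s * D' / n)) ≤ E := by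
    intro s D' hs hD hD'
    rw [hEdef]; refine Real.exp_le_exp.2 ?_
    rw [neg_le_neg_iff]
    exact div_le_div_of_nonneg_right ((mul_le_mul_of_nonneg_left hD ht.le).trans (mul_le_mul_of_nonneg_right hs hD')) hn.le
  -- the unit `W = (ρ/n)^α`
  set W : ℝ := ((ρ : ℝ) / n) ^ α with hWdef
  have hW0 : 0 < W := Real.rpow_pos_of_pos (div_pos hρ0 hn) α
  have hWinv : (n / (ρ : ℝ)) ^ α * W = 1 := by
    rw [hWdef, ← Real.mul_rpow (by positivity) (by positivity), div_mul_div_comm, mul_comm n, div_self (by positivity), Real.one_rpow]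
  have hK0 : 0 ≤ K := by positivity
  -- it suffices to bound the norm by `K·W·sp·E·F`
  suffices hmain : ‖stairHol U x₀ x₁ * X x₁ - X x₀‖ ≤ K * W * P.spacing k * E * F by
    have h1 : (n / (ρ : ℝ)) ^ α * ‖stairHol U x₀ x₁ * X x₁ - X x₀‖ ≤ (n / (ρ : ℝ)) ^ α * (K * W * P.spacing k * E * F) :=
      mul_le_mul_of_nonneg_left hmain (Real.rpow_nonneg (by positivity) α)
    have h2 : (n / (ρ : ℝ)) ^ α * (K * W * P.spacing k * E * F) = K * P.spacing k * E * F := by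
      calc (n / (ρ : ℝ)) ^ α * (K * W * P.spacing k * E * F) = ((n / (ρ : ℝ)) ^ α * W) * (K * P.spacing k * E * F) := by ring
        _ = K * P.spacing k * E * F := by rw [hWinv, one_mul]
    have h3 : K * P.spacing k * E * F ≤ (K + 1) * P.spacing k * E * F := by
      have : 0 ≤ P.spacing k * E * F := by positivity
      nlinarith
    simpa [hX, hρdef, hEdef, hndef] using (h1.trans (h2.le.trans h3))
  by_cases hfar : P.L ^ k < 64 * ρ
  · ----------------------------------------------------------------------------------------------------------------
    -- FAR PAIRS: the `D_u` member at both bonds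
    have hX0 : ‖X x₀‖ ≤ c₂ * P.spacing k * E * F := by
      have h := hderP x₀ μ f F (max D 0) hF (fun z hz => max_le (hsupp z hz).1 (Nat.cast_nonneg _)) hdx₀
      refine h.trans ?_
      have : Real.exp (-(t₂ * max D 0 / n)) ≤ E := hexp_t htt₂ (le_max_left _ _) (le_max_right _ _)
      gcongr
    have hX1 : ‖X x₁‖ ≤ c₂ * P.spacing k * E * F := by
      have h := hderP x₁ μ f F (max D 0) hF (fun z hz => max_le (hsupp z hz).2 (Nat.cast_nonneg _)) hdx₁
      refine h.trans ?_
      have : Real.exp (-(t₂ * max D 0 / n)) ≤ E := hexp_t htt₂ (le_max_left _ _) (le_max_right _ _)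
      gcongr
    have hW64 : 1 ≤ 64 * W := by
      have h1 : (1 : ℝ) / 64 ≤ (ρ : ℝ) / n := by
        rw [div_le_div_iff₀ (by norm_num) hn]
        have : ((P.L ^ k : ℕ) : ℝ) ≤ ((64 * ρ : ℕ) : ℝ) := by exact_mod_cast hfar.le
        rw [hnnat] at this; push_cast at this; linarith
      have h2 : ((1 : ℝ) / 64) ^ α ≤ W := Real.rpow_le_rpow (by norm_num) h1 hα0
      have h3 : (1 : ℝ) / 64 ≤ ((1 : ℝ) / 64) ^ α := by
        have := Real.rpow_le_rpow_of_exponent_ge (by norm_num : (0 : ℝ) < 1 / 64) (by norm_num : (1 : ℝ) / 64 ≤ 1) hα1.le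
        rwa [Real.rpow_one] at this
      linarith
    calc ‖stairHol U x₀ x₁ * X x₁ - X x₀‖ ≤ ‖stairHol U x₀ x₁ * X x₁‖ + ‖X x₀‖ := norm_sub_le _ _
      _ = ‖X x₁‖ + ‖X x₀‖ := by rw [norm_mul, norm_stairHol, one_mul]
      _ ≤ 2 * (c₂ * P.spacing k * E * F) := by linarith
      _ ≤ 2 * (c₂ * P.spacing k * E * F) * (64 * W) := le_mul_of_one_le_right (by positivity) hW64
      _ = (128 * c₂) * W * P.spacing k * E * F := by ring
      _ ≤ K * W * P.spacing k * E * F := by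
          have : 128 * c₂ ≤ K := by rw [hKdef]; linarith [show 0 ≤ ((d + 1 : ℕ) : ℝ) * (c₁ * Real.exp t₁) by positivity]
          gcongr
  ----------------------------------------------------------------------------------------------------------------
  -- NEAR PAIRS: the staircase
  push Not at hfar
  have hρn : 64 * (ρ : ℝ) ≤ n := by rw [← hnnat]; exact_mod_cast hfar
  -- every corner within `ρ` of `x₀` is `2L^k`-deep
  have hdeepw : ∀ w₀ : Balaban1983to89.Site P 0, supDist x₀ w₀ ≤ ρ → ∀ u, u ∉ Ω → 2 * P.L ^ k ≤ supDist w₀ u := by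
    intro w₀ hw₀ u hu
    have h1 := hdeep₀ u hu
    have h2 := supDist_triangle x₀ w₀ u
    omega
  -- the per-leg bound
  have hlegB : ∀ l, l < P.d → ‖legHol U x₀ x₁ l * X (stairPt x₀ x₁ (l + 1)) - X (stairPt x₀ x₁ l)‖ ≤
      (c₁ * Real.exp t₁) * W * P.spacing k * E * F := by
    intro l hl
    set m : Fin P.d := ⟨l, hl⟩ with hm
    set w := stairPt x₀ x₁ l with hw
    set w' := stairPt x₀ x₁ (l + 1) with hw'
    set sf : ℕ := (x₁ m - x₀ m).val with hsf
    set sb : ℕ := (x₀ m - x₁ m).val with hsb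
    have hmin : min sf sb ≤ ρ := min_val_le_supDist x₀ x₁ m
    -- distances from the corners to the support
    have hsuppw : ∀ w₀ : Balaban1983to89.Site P 0, supDist x₀ w₀ ≤ ρ → ∀ z, f z ≠ 0 → max (D - ρ) 0 ≤ (supDist w₀ z : ℝ) := by
      intro w₀ hw₀ z hz
      refine max_le ?_ (Nat.cast_nonneg _)
      have h1 := (hsupp z hz).1
      have h2 := supDist_triangle x₀ w₀ z
      have h3 : ((supDist x₀ z : ℕ) : ℝ) ≤ ((supDist x₀ w₀ + supDist w₀ z : ℕ) : ℝ) := by exact_mod_cast h2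
      have h4 : ((supDist x₀ w₀ : ℕ) : ℝ) ≤ ρ := by exact_mod_cast hw₀
      push_cast at h3; linarith
    have hEρ : Real.exp (-(t₁ * max (D - ρ) 0 / n)) ≤ Real.exp t₁ * E := by
      rw [hEdef, ← Real.exp_add]
      refine Real.exp_le_exp.2 ?_
      have hD'' : 0 ≤ max (D - (ρ : ℝ)) 0 := le_max_right _ _
      have h1 : t * max (D - ρ) 0 ≤ t₁ * max (D - ρ) 0 := mul_le_mul_of_nonneg_right htt₁ hD''
      have h2 : t * (D - ρ) ≤ t * max (D - ρ) 0 := mul_le_mul_of_nonneg_left (le_max_left _ _) ht.le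
      have h3 : t * (ρ : ℝ) / n ≤ t₁ := by
        rw [div_le_iff₀ hn]
        calc t * (ρ : ℝ) ≤ t * n := mul_le_mul_of_nonneg_left (by linarith) ht.le
          _ ≤ t₁ * n := mul_le_mul_of_nonneg_right htt₁ hn.le
      have h4 : (t * D - t * ρ) / n ≤ t₁ * max (D - ρ) 0 / n := div_le_div_of_nonneg_right (by linarith) hn.le
      have h5 : (t * D - t * ρ) / n = t * D / n - t * ρ / n := by ring
      rw [h5] at h4
      linarith
    have hsα : ∀ {s : ℕ}, s ≤ ρ → ((s : ℝ) / n) ^ α ≤ W := fun {s} hs =>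
      Real.rpow_le_rpow (by positivity) (div_le_div_of_nonneg_right (by exact_mod_cast hs) hn.le) hα0
    by_cases hcase : sf ≤ sb
    · -- forward leg (or trivial leg)
      have hlegdef : legHol U x₀ x₁ l = toC (axisHol U m sf w) := by
        rw [legHol, dif_pos hl]; simp only [← hm, ← hsf, ← hsb, if_pos hcase, hw]
      have hw'eq : w' = runSite w m sf := by rw [hw', hw, hsf, hm]; exact stairPt_succ_eq_runSite x₀ x₁ ⟨l, hl⟩
      rcases Nat.eq_zero_or_pos sf with h0 | hpos
      · -- trivial leg
        have : w' = w := by rw [hw'eq, h0, runSite_zero]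
        rw [hlegdef, h0, axisHol_zero, toC_one, one_mul, this, sub_self, norm_zero]; positivity
      · have hsfρ : sf ≤ ρ := by rw [min_eq_left hcase] at hmin; exact hmin
        have h := hlegP w m μ sf hpos (by omega) (hdeepw w (supDist_stairPt_le x₀ x₁ l)) f F (max (D - ρ) 0) hF
          (hsuppw w (supDist_stairPt_le x₀ x₁ l))
        rw [← hw'eq] at h
        rw [hlegdef]
        refine h.trans ?_
        calc c₁ * ((sf : ℝ) / (P.L : ℝ) ^ k) ^ α * P.spacing k * Real.exp (-(t₁ * max (D - ρ) 0 / (P.L : ℝ) ^ k)) * F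
            ≤ c₁ * W * P.spacing k * (Real.exp t₁ * E) * F := by rw [← hndef]; gcongr; exact hsα hsfρ
          _ = (c₁ * Real.exp t₁) * W * P.spacing k * E * F := by ring
    · -- backward leg
      push Not at hcase
      have hlegdef : legHol U x₀ x₁ l = conj (toC (axisHol U m sb w')) := by
        rw [legHol, dif_pos hl]; simp only [← hm, ← hsf, ← hsb, if_neg (not_le.2 hcase), hw']
      have hweq : w = runSite w' m sb := by rw [hw', hw, hsb, hm]; exact stairPt_eq_runSite_succ x₀ x₁ ⟨l, hl⟩
      have hsbρ : sb ≤ ρ := by rw [min_eq_right hcase.le] at hmin; exact hmin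
      have hsbpos : 0 < sb := by
        rcases Nat.eq_zero_or_pos sb with h0 | h
        · exfalso
          have hz : x₀ m - x₁ m = 0 := (ZMod.val_eq_zero _).1 h0
          have hsf0 : sf = 0 := by rw [hsf, show x₁ m - x₀ m = 0 by rw [← neg_sub, hz, neg_zero], ZMod.val_zero]
          omega
        · exact h
      have h := hlegP w' m μ sb hsbpos (by omega) (hdeepw w' (supDist_stairPt_le x₀ x₁ (l + 1))) f F (max (D - ρ) 0) hF
        (hsuppw w' (supDist_stairPt_le x₀ x₁ (l + 1)))
      rw [← hweq] at h
      -- `‖conj(a)·X(w′) − X(w)‖ = ‖a·X(w) − X(w′)‖`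
      have hnormeq : ‖conj (toC (axisHol U m sb w')) * X w' - X w‖ = ‖toC (axisHol U m sb w') * X w - X w'‖ := by
        set aa := toC (axisHol U m sb w') with haa
        have h1 : conj aa * aa = 1 := conj_mul_toC _
        have e : conj aa * X w' - X w = -(conj aa * (aa * X w - X w')) := by linear_combination (X w) * h1
        rw [e, norm_neg, norm_mul, Complex.norm_conj, haa, norm_toC, one_mul]
      rw [hlegdef, hnormeq]
      refine h.trans ?_
      calc c₁ * ((sb : ℝ) / (P.L : ℝ) ^ k) ^ α * P.spacing k * Real.exp (-(t₁ * max (D - ρ) 0 / (P.L : ℝ) ^ k)) * F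
          ≤ c₁ * W * P.spacing k * (Real.exp t₁ * E) * F := by rw [← hndef]; gcongr; exact hsα hsbρ
        _ = (c₁ * Real.exp t₁) * W * P.spacing k * E * F := by ring
  -- telescoping
  have htel := stair_telescope U x₀ x₁ X P.d
  rw [stairPt_zero, stairPt_of_le x₀ x₁ le_rfl] at htel
  calc ‖stairHol U x₀ x₁ * X x₁ - X x₀‖ = ‖(∏ l ∈ Finset.range P.d, legHol U x₀ x₁ l) * X x₁ - X x₀‖ := rfl
    _ ≤ ∑ l ∈ Finset.range P.d, ‖legHol U x₀ x₁ l * X (stairPt x₀ x₁ (l + 1)) - X (stairPt x₀ x₁ l)‖ := htel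
    _ ≤ ∑ _l ∈ Finset.range P.d, (c₁ * Real.exp t₁) * W * P.spacing k * E * F :=
        Finset.sum_le_sum fun l hl => hlegB l (Finset.mem_range.1 hl)
    _ = P.d * ((c₁ * Real.exp t₁) * W * P.spacing k * E * F) := by rw [Finset.sum_const, Finset.card_range, nsmul_eq_mul]
    _ = (P.d * (c₁ * Real.exp t₁)) * W * P.spacing k * E * F := by ring
    _ ≤ K * W * P.spacing k * E * F := by
        have : (P.d : ℝ) * (c₁ * Real.exp t₁) ≤ K := by
          rw [hKdef, hPdR]; linarith [show (0 : ℝ) ≤ 128 * c₂ by positivity]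
        gcongr

/-- **§D IN THE (H1.9)-INPUT SHAPE** (distance `B5Ineq137Torus.T = |·−·|_∞`, one power of the spacing, rate `e^{−t₀(L^k)^{−1}D}`, deep end
points as the ball conditions `T(x_i, y) < 3L^k → y ∈ Ω`), plaquettes small near `Ω` only; transport `stairHol`.
[cite: BalabanImbrieJaffe1988, (2.31)/(2.32) p.263] [cite: Balaban1983RegularityDecay, (1.9) p.573] -/
theorem holder19_smoothNear_region_input (d L : ℕ) (hd1 : 1 ≤ d) (hd3 : d + 1 ≤ 3) (hL : Odd L ∧ 1 < L) {a : ℝ} (ha : 0 < a)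
    {α : ℝ} (hα0 : 0 ≤ α) (hα1 : α < 1) :
    ∃ t₀ c₀ : ℝ, 0 < t₀ ∧ 0 < c₀ ∧ ∀ (P : Params), P.d = d + 1 → P.L = L →
      ∀ k : ℕ, 1 ≤ k → k ≤ P.K → ∀ Ω : Finset (Balaban1983to89.Site P 0), IsBlockUnion k Ω →
        ∀ (U : GaugeField P 0 U1) (θ T δ : ℝ), 0 ≤ θ →
          (∀ p : Balaban1983to89.Plaq P 0, (∃ y ∈ Ω, supDist y p.src ≤ 2 * P.L ^ k) → ‖toC (plaqHol U p) - 1‖ ≤ θ) →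
          2 * (P.d : ℝ) ^ 3 * (((P.L : ℝ) ^ k) ^ 2 * θ) ^ 2 ≤ 1 →
          (∀ b ∈ starB Ω, blkIter k b.src = blkIter k b.tgt → ‖toC (U b) - 1‖ ≤ T) →
          (∀ y ∈ Ω, ‖holCK U k y - 1‖ ≤ δ) →
          2 * (((P.L : ℝ) ^ k - 1) * (P.L : ℝ) ^ k) * P.d * T ^ 2 + 2 * δ ^ 2 ≤ 1 / 2 →
        ∀ (μ : Fin P.d) (x₀ x₁ : Balaban1983to89.Site P 0), x₁ ≠ x₀ →
          (∀ y, B5Ineq137Torus.T P 0 x₀ y < 3 * (P.L : ℝ) ^ k → y ∈ Ω) →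
          (∀ y, B5Ineq137Torus.T P 0 x₁ y < 3 * (P.L : ℝ) ^ k → y ∈ Ω) →
        ∀ (f : Balaban1983to89.Site P 0 → ℂ) (F D : ℝ), (∀ y, ‖f y‖ ≤ F) →
          (∀ y, f y ≠ 0 → D ≤ B5Ineq137Torus.T P 0 x₀ y) → (∀ y, f y ≠ 0 → D ≤ B5Ineq137Torus.T P 0 x₁ y) →
          ((P.L : ℝ) ^ k / B5Ineq137Torus.T P 0 x₀ x₁) ^ α *
              ‖stairHol U x₀ x₁ *
                  covD P.eps⁻¹ (cfg U) (gBox (B1RG242Torus.α P a k * (P.L : ℝ) ^ (k * P.d)) P.eps⁻¹ U k Ω *ᵥ f) ⟨x₁, μ⟩ -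
                covD P.eps⁻¹ (cfg U) (gBox (B1RG242Torus.α P a k * (P.L : ℝ) ^ (k * P.d)) P.eps⁻¹ U k Ω *ᵥ f) ⟨x₀, μ⟩‖
            ≤ P.spacing k * (c₀ * Real.exp (-(t₀ * (((P.L : ℝ) ^ k)⁻¹ * D))) * F) := by
  obtain ⟨t₀, c₀, ht₀, hc₀, H⟩ := holder19_smoothNear_region d L hd1 hd3 hL ha hα0 hα1
  refine ⟨t₀, c₀, ht₀, hc₀, ?_⟩
  intro P hPd hPL k hk1 hkK Ω hΩ U θ T δ hθ0 hθ hsmall hInt hTree hsmallT μ x₀ x₁ hne hdeep₀ hdeep₁ f F D hF hsupp₀ hsupp₁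
  have hball : ∀ {x : Balaban1983to89.Site P 0},
      (∀ y, B5Ineq137Torus.T P 0 x y < 3 * (P.L : ℝ) ^ k → y ∈ Ω) →
      ∀ w, w ∉ Ω → 3 * P.L ^ k ≤ supDist x w := by
    intro x hdeep w hw
    by_contra hlt
    exact hw (hdeep w (by rw [B3Bound323ZeroTorus.T_eq_supDist]; exact_mod_cast (not_le.1 hlt)))
  have h := H P hPd hPL k hk1 hkK Ω hΩ U θ T δ hθ0 hθ hsmall hInt hTree hsmallT x₀ x₁ μ hne.symm (hball hdeep₀) (hball hdeep₁)
    f F D hF (fun z hz => by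
      rw [← B3Bound323ZeroTorus.T_eq_supDist, ← B3Bound323ZeroTorus.T_eq_supDist]; exact ⟨hsupp₀ z hz, hsupp₁ z hz⟩)
  rw [← B3Bound323ZeroTorus.T_eq_supDist] at h
  calc _ ≤ c₀ * P.spacing k * Real.exp (-(t₀ * D / (P.L : ℝ) ^ k)) * F := h
    _ = P.spacing k * (c₀ * Real.exp (-(t₀ * (((P.L : ℝ) ^ k)⁻¹ * D))) * F) := by
        rw [show t₀ * D / (P.L : ℝ) ^ k = t₀ * (((P.L : ℝ) ^ k)⁻¹ * D) by ring]; ring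

/-- **§D IN THE (H6) BINDER SHAPE of p27's `BIJ88LocDerivHolder231RegionOfInputs.derivHolder231_region_of_inputs_of_smooth`**, plaquettes small
near `Ω` only: every depth `ρ ≥ 3L^k`, all `x₁ ≠ x₂` in `Ω` with `ρ ≤ T(x_i, w)` for `w ∉ Ω`, every `g` with `‖g‖ ≤ F`, `0 ≤ D ≤ T(x_i, ·)` on
`supp g`: `(L^k/T(x₁,x₂))^α·‖stairHol u x₁ x₂·(D_uG_k(Ω,u)g)(x₂,μ) − (D_uG_k(Ω,u)g)(x₁,μ)‖ ≤ (L^kε)·(c₀e^{−t₀(L^k)⁻¹D}F)`.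
[cite: Balaban1983RegularityDecay, Theorem p.573 (1.9)] [cite: BalabanImbrieJaffe1988, (2.31)/(2.32) p.263] -/
theorem holder19_smoothNear_region_H6 (d L : ℕ) (hd1 : 1 ≤ d) (hd3 : d + 1 ≤ 3) (hL : Odd L ∧ 1 < L) {a : ℝ} (ha : 0 < a)
    {α : ℝ} (hα0 : 0 ≤ α) (hα1 : α < 1) :
    ∃ t₀ c₀ : ℝ, 0 < t₀ ∧ 0 < c₀ ∧ ∀ (P : Params), P.d = d + 1 → P.L = L →
      ∀ k : ℕ, 1 ≤ k → k ≤ P.K → ∀ Ω : Finset (Balaban1983to89.Site P 0), IsBlockUnion k Ω →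
        ∀ (U : GaugeField P 0 U1) (θ T δ : ℝ), 0 ≤ θ →
          (∀ p : Balaban1983to89.Plaq P 0, (∃ y ∈ Ω, supDist y p.src ≤ 2 * P.L ^ k) → ‖toC (plaqHol U p) - 1‖ ≤ θ) →
          2 * (P.d : ℝ) ^ 3 * (((P.L : ℝ) ^ k) ^ 2 * θ) ^ 2 ≤ 1 →
          (∀ b ∈ starB Ω, blkIter k b.src = blkIter k b.tgt → ‖toC (U b) - 1‖ ≤ T) →
          (∀ y ∈ Ω, ‖holCK U k y - 1‖ ≤ δ) →
          2 * (((P.L : ℝ) ^ k - 1) * (P.L : ℝ) ^ k) * P.d * T ^ 2 + 2 * δ ^ 2 ≤ 1 / 2 →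
        ∀ (ρ : ℝ), 3 * (P.L : ℝ) ^ k ≤ ρ →
        ∀ (x₁ x₂ : Balaban1983to89.Site P 0) (μ : Fin P.d), x₁ ≠ x₂ → x₁ ∈ Ω → x₂ ∈ Ω →
          (∀ w, w ∉ Ω → ρ ≤ B5Ineq137Torus.T P 0 x₁ w) → (∀ w, w ∉ Ω → ρ ≤ B5Ineq137Torus.T P 0 x₂ w) →
        ∀ (g : Balaban1983to89.Site P 0 → ℂ) (F D : ℝ), (∀ y, ‖g y‖ ≤ F) → 0 ≤ D →
          (∀ y, g y ≠ 0 → D ≤ B5Ineq137Torus.T P 0 x₁ y) → (∀ y, g y ≠ 0 → D ≤ B5Ineq137Torus.T P 0 x₂ y) →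
          ((P.L : ℝ) ^ k / B5Ineq137Torus.T P 0 x₁ x₂) ^ α *
              ‖stairHol U x₁ x₂ * covD P.eps⁻¹ (cfg U) (gBox (B1RG242Torus.α P a k * (P.L : ℝ) ^ (k * P.d)) P.eps⁻¹ U k Ω *ᵥ g) ⟨x₂, μ⟩ -
                covD P.eps⁻¹ (cfg U) (gBox (B1RG242Torus.α P a k * (P.L : ℝ) ^ (k * P.d)) P.eps⁻¹ U k Ω *ᵥ g) ⟨x₁, μ⟩‖ ≤
            P.spacing k * (c₀ * Real.exp (-(t₀ * (((P.L : ℝ) ^ k)⁻¹ * D))) * F) := by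
  obtain ⟨t₀, c₀, ht₀, hc₀, H⟩ := holder19_smoothNear_region_input d L hd1 hd3 hL ha hα0 hα1
  refine ⟨t₀, c₀, ht₀, hc₀, ?_⟩
  intro P hPd hPL k hk1 hkK Ω hΩ U θ T δ hθ0 hθ hsmall hInt hTree hsmallT ρ hρ x₁ x₂ μ hne _hx₁ _hx₂ hdeep₁ hdeep₂ g F D hF _hD hsupp₁ hsupp₂
  have hball : ∀ {x : Balaban1983to89.Site P 0}, (∀ w, w ∉ Ω → ρ ≤ B5Ineq137Torus.T P 0 x w) →
      ∀ y, B5Ineq137Torus.T P 0 x y < 3 * (P.L : ℝ) ^ k → y ∈ Ω := by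
    intro x hdeep y hy
    by_contra hyΩ
    exact absurd ((hρ.trans (hdeep y hyΩ)).trans_lt hy) (lt_irrefl _)
  exact H P hPd hPL k hk1 hkK Ω hΩ U θ T δ hθ0 hθ hsmall hInt hTree hsmallT μ x₁ x₂ hne.symm (hball hdeep₁) (hball hdeep₂) g F D hF
    hsupp₁ hsupp₂

end Main

/-! ## §E The Hölder member under plaquette smallness NEAR `Ω` ONLY (no gauge condition), threshold in `(d, L^k)`: the blockwise tree gauge of B-I §2 -/

section Uniform

variable {d : ℕ}

/-- **THE HÖLDER MEMBER OF [6] (1.9) FOR THE REGION NEUMANN PROPAGATORS ON EVERY `k`-BLOCK UNION UNDER PLAQUETTE SMALLNESS NEAR `Ω` ONLY,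
THRESHOLD IN `(d, L^k)`, NO GAUGE CONDITION** — for [BalabanImbrieJaffe1985] p. 326 *"by change of gauge u_k can be transformed in a local region
Λ into a configuration of the form exp[ie_kηA], where A is smooth and small"* and [BalabanImbrieJaffe1988] (2.32): §D's
`holder19_smoothNear_region` with its bondwise `(T, δ)` hypotheses DISCHARGED by the blockwise tree gauge built from the plaquettes near `Ω`
only (B-I's `blockGauge_of_near`; `δ = (d+1)(L^k−1)T`).  For `1 ≤ d`, `d+1 ≤ 3`, `L` odd `> 1`, `a > 0`, `0 ≤ α < 1` there are `t₀, c₀ > 0` such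
that for every volume with `2(L^k−1)+4 < |T|`, every `1 ≤ k ≤ K`, EVERY `k`-block union `Ω`, every `U(1)` field with `‖u(∂p) − 1‖ ≤ θ` for the
plaquettes based within `2L^k` of `Ω` and `2(d+1)³(L^{2k}θ)² ≤ 1`, every `T ≥ d(L^k−1)θ` with `2(L^k−1)L^k(d+1)T² + 2((d+1)(L^k−1)T)² ≤ 1/2`,
every pair `x₀ ≠ x₁` both `3L^k`-deep in `Ω`, every `μ`, every `f` with `|f| ≤ F` vanishing at sup-distance `< D` from `{x₀, x₁}`:
`(L^k/|x₀−x₁|_∞)^α·‖U(Γ_{x₀,x₁})(D_uG_k(Ω,u)f)(⟨x₁,μ⟩) − (D_uG_k(Ω,u)f)(⟨x₀,μ⟩)‖ ≤ c₀(L^kε)e^{−t₀D/L^k}F`.  Gauge covariance of the three factors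
(`gBox_gaugeAct_mulVec`, `covD_gaugeAct`, `stairHol_gaugeAct`) as in p34's `holder19_smallPlaquette_region_uniform`, verbatim.
[cite: BalabanImbrieJaffe1985, p.326] [cite: Balaban1983RegularityDecay, Theorem p.573 (1.9)] [cite: BalabanImbrieJaffe1988, (2.31)/(2.32) p.263] -/
theorem holder19_smoothNear_region_uniform (d L : ℕ) (hd1 : 1 ≤ d) (hd3 : d + 1 ≤ 3) (hL : Odd L ∧ 1 < L) {a : ℝ} (ha : 0 < a)
    {α : ℝ} (hα0 : 0 ≤ α) (hα1 : α < 1) :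
    ∃ t₀ c₀ : ℝ, 0 < t₀ ∧ 0 < c₀ ∧ ∀ (P : Params), P.d = d + 1 → P.L = L →
      ∀ k : ℕ, 1 ≤ k → k ≤ P.K → 2 * (P.L ^ k - 1) + 4 < P.sitesPerDir 0 →
      ∀ Ω : Finset (Balaban1983to89.Site P 0), IsBlockUnion k Ω →
      ∀ (U : GaugeField P 0 U1) (θ : ℝ), 0 ≤ θ →
        (∀ p : Balaban1983to89.Plaq P 0, (∃ y ∈ Ω, supDist y p.src ≤ 2 * P.L ^ k) → ‖toC (plaqHol U p) - 1‖ ≤ θ) →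
        2 * (P.d : ℝ) ^ 3 * (((P.L : ℝ) ^ k) ^ 2 * θ) ^ 2 ≤ 1 →
        ∀ (T : ℝ), ((P.d - 1 : ℕ) : ℝ) * ((P.L : ℝ) ^ k - 1) * θ ≤ T →
          2 * (((P.L : ℝ) ^ k - 1) * (P.L : ℝ) ^ k) * P.d * T ^ 2 + 2 * (P.d * ((P.L : ℝ) ^ k - 1) * T) ^ 2 ≤ 1 / 2 →
        ∀ (x₀ x₁ : Balaban1983to89.Site P 0) (μ : Fin P.d), x₀ ≠ x₁ →
          (∀ w, w ∉ Ω → 3 * P.L ^ k ≤ supDist x₀ w) →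
          (∀ w, w ∉ Ω → 3 * P.L ^ k ≤ supDist x₁ w) →
        ∀ (f : Balaban1983to89.Site P 0 → ℂ) (F D : ℝ),
          (∀ z, ‖f z‖ ≤ F) → (∀ z, f z ≠ 0 → D ≤ (supDist x₀ z : ℝ) ∧ D ≤ (supDist x₁ z : ℝ)) →
          (((P.L : ℝ) ^ k / (supDist x₀ x₁ : ℝ)) ^ α *
            ‖stairHol U x₀ x₁ *
                covD P.eps⁻¹ (cfg U) (gBox (B1RG242Torus.α P a k * (P.L : ℝ) ^ (k * P.d)) P.eps⁻¹ U k Ω *ᵥ f) ⟨x₁, μ⟩ -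
              covD P.eps⁻¹ (cfg U) (gBox (B1RG242Torus.α P a k * (P.L : ℝ) ^ (k * P.d)) P.eps⁻¹ U k Ω *ᵥ f) ⟨x₀, μ⟩‖
            ≤ c₀ * P.spacing k * Real.exp (-(t₀ * D / (P.L : ℝ) ^ k)) * F) := by
  obtain ⟨t₀, c₀, ht₀, hc₀, H⟩ := holder19_smoothNear_region d L hd1 hd3 hL ha hα0 hα1
  refine ⟨t₀, c₀, ht₀, hc₀, ?_⟩
  intro P hPd hPL k hk1 hkK hR Ω hΩ U θ hθ0 hθ hsmall T hT hsmallT x₀ x₁ μ hne hdeep₀ hdeep₁ f F D hF hsupp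
  have hk : k ≤ P.m + P.K := hkK.trans (Nat.le_add_left _ _)
  have hk0 : 0 + k ≤ P.m + P.K := by omega
  have hL1 : (1 : ℝ) < P.L := B1RG242Torus.one_lt_cast_L P
  have ha' : 0 < B1RG242Torus.α P a k * (P.L : ℝ) ^ (k * P.d) :=
    mul_pos (mul_pos (B1.aSeq_pos ha hL1 hk1) (inv_pos.2 (pow_pos (P.spacing_pos k) 2))) (pow_pos P.cast_L_pos _)
  have hc' : P.eps⁻¹ ≠ 0 := inv_ne_zero P.eps_pos.ne'
  -- the blockwise centred gauge supplies p34's block-local hypotheses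
  set i₀ : Fin P.d := ⟨0, lt_of_lt_of_le Nat.zero_lt_one P.hd⟩ with hi₀
  set h : GaugeTransf P 0 U1 := fun z => centredGaugeDir U (cornerIter k (blkIter k z)) (P.L ^ k - 1) i₀ z with hh
  obtain ⟨hInt, hTree⟩ := blockGauge_of_near hk0 U hθ0 hΩ hθ hR hT i₀
  -- plaquettes of `u^h` are those of `u`
  set U' := gaugeAct h U with hU'
  have hθ' : ∀ p : Balaban1983to89.Plaq P 0, (∃ y ∈ Ω, supDist y p.src ≤ 2 * P.L ^ k) → ‖toC (plaqHol U' p) - 1‖ ≤ θ :=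
    fun p hp => by
    rw [hU', norm_toC_plaqHol_gaugeAct_sub_one]; exact hθ p hp
  have hS : stairHol U' x₀ x₁ = toC (h x₀) * stairHol U x₀ x₁ * conj (toC (h x₁)) := stairHol_gaugeAct h U x₀ x₁
  -- §3 at `u^h` for the rotated source `h·f`; its Hölder quantity is `h(x₀)` times the one for `(u, f)`
  have hF' : ∀ z, ‖(fun z => toC (h z) * f z) z‖ ≤ F := fun z => by
    show ‖toC (h z) * f z‖ ≤ F
    rw [norm_mul, norm_toC, one_mul]; exact hF z
  have hsupp' : ∀ z, (fun z => toC (h z) * f z) z ≠ 0 → D ≤ (supDist x₀ z : ℝ) ∧ D ≤ (supDist x₁ z : ℝ) := fun z hz =>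
    hsupp z (fun hf => hz (by show toC (h z) * f z = 0; rw [hf, mul_zero]))
  have hmain := H P hPd hPL k hk1 hkK Ω hΩ U' θ T (P.d * ((P.L : ℝ) ^ k - 1) * T) hθ0 hθ' hsmall
    hInt hTree hsmallT x₀ x₁ μ hne hdeep₀ hdeep₁ (fun z => toC (h z) * f z) F D hF' hsupp'
  -- the quantity for `(U', h·f)` is `h(x₀)` times the quantity for `(U, f)`
  set φf := gBox (B1RG242Torus.α P a k * (P.L : ℝ) ^ (k * P.d)) P.eps⁻¹ U k Ω *ᵥ f with hφf
  have hGf' : gBox (B1RG242Torus.α P a k * (P.L : ℝ) ^ (k * P.d)) P.eps⁻¹ U' k Ω *ᵥ (fun z => toC (h z) * f z) =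
      fun z => toC (h z) * φf z := gBox_gaugeAct_mulVec hk0 hc' ha' h U hΩ f
  have hD0' : covD P.eps⁻¹ (cfg U') (fun z => toC (h z) * φf z) ⟨x₀, μ⟩ = toC (h x₀) * covD P.eps⁻¹ (cfg U) φf ⟨x₀, μ⟩ :=
    covD_gaugeAct _ h U φf _
  have hD1' : covD P.eps⁻¹ (cfg U') (fun z => toC (h z) * φf z) ⟨x₁, μ⟩ = toC (h x₁) * covD P.eps⁻¹ (cfg U) φf ⟨x₁, μ⟩ :=
    covD_gaugeAct _ h U φf _
  have hkey' : stairHol U' x₀ x₁ * covD P.eps⁻¹ (cfg U') (fun z => toC (h z) * φf z) ⟨x₁, μ⟩ -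
      covD P.eps⁻¹ (cfg U') (fun z => toC (h z) * φf z) ⟨x₀, μ⟩ =
      toC (h x₀) * (stairHol U x₀ x₁ * covD P.eps⁻¹ (cfg U) φf ⟨x₁, μ⟩ - covD P.eps⁻¹ (cfg U) φf ⟨x₀, μ⟩) := by
    rw [hS, hD0', hD1']
    have h1 : conj (toC (h x₁)) * toC (h x₁) = 1 := conj_mul_toC _
    linear_combination (toC (h x₀) * stairHol U x₀ x₁ * covD P.eps⁻¹ (cfg U) φf ⟨x₁, μ⟩) * h1
  have hnorm' : ‖stairHol U' x₀ x₁ *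
        covD P.eps⁻¹ (cfg U') (gBox (B1RG242Torus.α P a k * (P.L : ℝ) ^ (k * P.d)) P.eps⁻¹ U' k Ω *ᵥ fun z => toC (h z) * f z) ⟨x₁, μ⟩ -
        covD P.eps⁻¹ (cfg U') (gBox (B1RG242Torus.α P a k * (P.L : ℝ) ^ (k * P.d)) P.eps⁻¹ U' k Ω *ᵥ fun z => toC (h z) * f z) ⟨x₀, μ⟩‖ =
      ‖stairHol U x₀ x₁ * covD P.eps⁻¹ (cfg U) φf ⟨x₁, μ⟩ - covD P.eps⁻¹ (cfg U) φf ⟨x₀, μ⟩‖ := by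
    rw [hGf', hkey', norm_mul, norm_toC, one_mul]
  rw [hnorm'] at hmain
  exact hmain

/-- **§E IN THE (H1.9)-INPUT SHAPE** (distance `B5Ineq137Torus.T`, `P.spacing k * (c₀ * exp(−t₀((L^k)⁻¹D)) * F)`, deep end points as
ball conditions), plaquettes small near `Ω` only, threshold in `(d, L^k)`, every `k`-block union.
[cite: BalabanImbrieJaffe1988, (2.31)/(2.32) p.263] [cite: Balaban1983RegularityDecay, (1.9) p.573] -/
theorem holder19_smoothNear_region_uniform_input (d L : ℕ) (hd1 : 1 ≤ d) (hd3 : d + 1 ≤ 3) (hL : Odd L ∧ 1 < L) {a : ℝ}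
    (ha : 0 < a) {α : ℝ} (hα0 : 0 ≤ α) (hα1 : α < 1) :
    ∃ t₀ c₀ : ℝ, 0 < t₀ ∧ 0 < c₀ ∧ ∀ (P : Params), P.d = d + 1 → P.L = L →
      ∀ k : ℕ, 1 ≤ k → k ≤ P.K → 2 * (P.L ^ k - 1) + 4 < P.sitesPerDir 0 →
      ∀ Ω : Finset (Balaban1983to89.Site P 0), IsBlockUnion k Ω →
      ∀ (U : GaugeField P 0 U1) (θ : ℝ), 0 ≤ θ →
        (∀ p : Balaban1983to89.Plaq P 0, (∃ y ∈ Ω, supDist y p.src ≤ 2 * P.L ^ k) → ‖toC (plaqHol U p) - 1‖ ≤ θ) →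
        2 * (P.d : ℝ) ^ 3 * (((P.L : ℝ) ^ k) ^ 2 * θ) ^ 2 ≤ 1 →
        ∀ (T : ℝ), ((P.d - 1 : ℕ) : ℝ) * ((P.L : ℝ) ^ k - 1) * θ ≤ T →
          2 * (((P.L : ℝ) ^ k - 1) * (P.L : ℝ) ^ k) * P.d * T ^ 2 + 2 * (P.d * ((P.L : ℝ) ^ k - 1) * T) ^ 2 ≤ 1 / 2 →
        ∀ (μ : Fin P.d) (x₀ x₁ : Balaban1983to89.Site P 0), x₁ ≠ x₀ →
          (∀ y, B5Ineq137Torus.T P 0 x₀ y < 3 * (P.L : ℝ) ^ k → y ∈ Ω) →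
          (∀ y, B5Ineq137Torus.T P 0 x₁ y < 3 * (P.L : ℝ) ^ k → y ∈ Ω) →
        ∀ (f : Balaban1983to89.Site P 0 → ℂ) (F D : ℝ), (∀ y, ‖f y‖ ≤ F) →
          (∀ y, f y ≠ 0 → D ≤ B5Ineq137Torus.T P 0 x₀ y) → (∀ y, f y ≠ 0 → D ≤ B5Ineq137Torus.T P 0 x₁ y) →
          ((P.L : ℝ) ^ k / B5Ineq137Torus.T P 0 x₀ x₁) ^ α *
              ‖stairHol U x₀ x₁ *
                  covD P.eps⁻¹ (cfg U) (gBox (B1RG242Torus.α P a k * (P.L : ℝ) ^ (k * P.d)) P.eps⁻¹ U k Ω *ᵥ f) ⟨x₁, μ⟩ -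
                covD P.eps⁻¹ (cfg U) (gBox (B1RG242Torus.α P a k * (P.L : ℝ) ^ (k * P.d)) P.eps⁻¹ U k Ω *ᵥ f) ⟨x₀, μ⟩‖
            ≤ P.spacing k * (c₀ * Real.exp (-(t₀ * (((P.L : ℝ) ^ k)⁻¹ * D))) * F) := by
  obtain ⟨t₀, c₀, ht₀, hc₀, H⟩ := holder19_smoothNear_region_uniform d L hd1 hd3 hL ha hα0 hα1
  refine ⟨t₀, c₀, ht₀, hc₀, ?_⟩
  intro P hPd hPL k hk1 hkK hR Ω hΩ U θ hθ0 hθ hsmall T hT hsmallT μ x₀ x₁ hne hdeep₀ hdeep₁ f F D hF hsupp₀ hsupp₁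
  have hball : ∀ {x : Balaban1983to89.Site P 0},
      (∀ y, B5Ineq137Torus.T P 0 x y < 3 * (P.L : ℝ) ^ k → y ∈ Ω) →
      ∀ w, w ∉ Ω → 3 * P.L ^ k ≤ supDist x w := by
    intro x hdeep w hw
    by_contra hlt
    exact hw (hdeep w (by rw [B3Bound323ZeroTorus.T_eq_supDist]; exact_mod_cast (not_le.1 hlt)))
  have h := H P hPd hPL k hk1 hkK hR Ω hΩ U θ hθ0 hθ hsmall T hT hsmallT x₀ x₁ μ hne.symm (hball hdeep₀) (hball hdeep₁)
    f F D hF (fun z hz => by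
      rw [← B3Bound323ZeroTorus.T_eq_supDist, ← B3Bound323ZeroTorus.T_eq_supDist]; exact ⟨hsupp₀ z hz, hsupp₁ z hz⟩)
  rw [← B3Bound323ZeroTorus.T_eq_supDist] at h
  calc _ ≤ c₀ * P.spacing k * Real.exp (-(t₀ * D / (P.L : ℝ) ^ k)) * F := h
    _ = P.spacing k * (c₀ * Real.exp (-(t₀ * (((P.L : ℝ) ^ k)⁻¹ * D))) * F) := by
        rw [show t₀ * D / (P.L : ℝ) ^ k = t₀ * (((P.L : ℝ) ^ k)⁻¹ * D) by ring]; ring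

/-- **§E IN THE (H6) BINDER SHAPE of p27's `derivHolder231_region_of_inputs_of_smooth`**, plaquettes small near `Ω` only, threshold in
`(d, L^k)`, every `k`-block union, every depth `ρ ≥ 3L^k`.
[cite: BalabanImbrieJaffe1988, (2.31)/(2.32) p.263] [cite: Balaban1983RegularityDecay, Theorem p.573 (1.9)] -/
theorem holder19_smoothNear_region_uniform_H6 (d L : ℕ) (hd1 : 1 ≤ d) (hd3 : d + 1 ≤ 3) (hL : Odd L ∧ 1 < L) {a : ℝ}
    (ha : 0 < a) {α : ℝ} (hα0 : 0 ≤ α) (hα1 : α < 1) :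
    ∃ t₀ c₀ : ℝ, 0 < t₀ ∧ 0 < c₀ ∧ ∀ (P : Params), P.d = d + 1 → P.L = L →
      ∀ k : ℕ, 1 ≤ k → k ≤ P.K → 2 * (P.L ^ k - 1) + 4 < P.sitesPerDir 0 →
      ∀ Ω : Finset (Balaban1983to89.Site P 0), IsBlockUnion k Ω →
      ∀ (U : GaugeField P 0 U1) (θ : ℝ), 0 ≤ θ →
        (∀ p : Balaban1983to89.Plaq P 0, (∃ y ∈ Ω, supDist y p.src ≤ 2 * P.L ^ k) → ‖toC (plaqHol U p) - 1‖ ≤ θ) →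
        2 * (P.d : ℝ) ^ 3 * (((P.L : ℝ) ^ k) ^ 2 * θ) ^ 2 ≤ 1 →
        ∀ (T : ℝ), ((P.d - 1 : ℕ) : ℝ) * ((P.L : ℝ) ^ k - 1) * θ ≤ T →
          2 * (((P.L : ℝ) ^ k - 1) * (P.L : ℝ) ^ k) * P.d * T ^ 2 + 2 * (P.d * ((P.L : ℝ) ^ k - 1) * T) ^ 2 ≤ 1 / 2 →
        ∀ (ρ : ℝ), 3 * (P.L : ℝ) ^ k ≤ ρ →
        ∀ (x₁ x₂ : Balaban1983to89.Site P 0) (μ : Fin P.d), x₁ ≠ x₂ → x₁ ∈ Ω → x₂ ∈ Ω →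
          (∀ w, w ∉ Ω → ρ ≤ B5Ineq137Torus.T P 0 x₁ w) → (∀ w, w ∉ Ω → ρ ≤ B5Ineq137Torus.T P 0 x₂ w) →
        ∀ (g : Balaban1983to89.Site P 0 → ℂ) (F D : ℝ), (∀ y, ‖g y‖ ≤ F) → 0 ≤ D →
          (∀ y, g y ≠ 0 → D ≤ B5Ineq137Torus.T P 0 x₁ y) → (∀ y, g y ≠ 0 → D ≤ B5Ineq137Torus.T P 0 x₂ y) →
          ((P.L : ℝ) ^ k / B5Ineq137Torus.T P 0 x₁ x₂) ^ α *
              ‖stairHol U x₁ x₂ * covD P.eps⁻¹ (cfg U) (gBox (B1RG242Torus.α P a k * (P.L : ℝ) ^ (k * P.d)) P.eps⁻¹ U k Ω *ᵥ g) ⟨x₂, μ⟩ -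
                covD P.eps⁻¹ (cfg U) (gBox (B1RG242Torus.α P a k * (P.L : ℝ) ^ (k * P.d)) P.eps⁻¹ U k Ω *ᵥ g) ⟨x₁, μ⟩‖ ≤
            P.spacing k * (c₀ * Real.exp (-(t₀ * (((P.L : ℝ) ^ k)⁻¹ * D))) * F) := by
  obtain ⟨t₀, c₀, ht₀, hc₀, H⟩ := holder19_smoothNear_region_uniform_input d L hd1 hd3 hL ha hα0 hα1
  refine ⟨t₀, c₀, ht₀, hc₀, ?_⟩
  intro P hPd hPL k hk1 hkK hR Ω hΩ U θ hθ0 hθ hsmall T hT hsmallT ρ hρ x₁ x₂ μ hne _hx₁ _hx₂ hdeep₁ hdeep₂ g F D hF _hD hsupp₁ hsupp₂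
  have hball : ∀ {x : Balaban1983to89.Site P 0}, (∀ w, w ∉ Ω → ρ ≤ B5Ineq137Torus.T P 0 x w) →
      ∀ y, B5Ineq137Torus.T P 0 x y < 3 * (P.L : ℝ) ^ k → y ∈ Ω := by
    intro x hdeep y hy
    by_contra hyΩ
    exact absurd ((hρ.trans (hdeep y hyΩ)).trans_lt hy) (lt_irrefl _)
  exact H P hPd hPL k hk1 hkK hR Ω hΩ U θ hθ0 hθ hsmall T hT hsmallT μ x₁ x₂ hne.symm (hball hdeep₁) (hball hdeep₂) g F D hF hsupp₁ hsupp₂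

/-- kernel (the arithmetic of p31's `BIJ88DeltaLocSmallPlaquetteTorusCwt.smallness_of_threshold` — the statement of record — repeated
PRIVATELY to keep this propagator-level file below the (2.30)–(2.41) chain in the import order, exactly as p30 did in
`BIJ88NeumannPropagatorSmallFieldCloseRegion`): the block-scale plaquette threshold `(L^{2k}θ)² ≤ 1/500` implies, for `1 ≤ d′ ≤ 3`,
`2d′³(L^{2k}θ)² ≤ 1` and, with `T = (d′−1)(L^k−1)θ`, `2(L^k−1)L^k·d′·T² + 2(d′(L^k−1)T)² ≤ ½`. [cite: BalabanImbrieJaffe1985, (7.3.1) p.326] -/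
private theorem threshold_smallness' {dr n θ : ℝ} (hd1 : 1 ≤ dr) (hd3 : dr ≤ 3) (hn : 1 ≤ n) (hθ : 0 ≤ θ)
    (hτ : (n ^ 2 * θ) ^ 2 ≤ 1 / 500) :
    2 * dr ^ 3 * (n ^ 2 * θ) ^ 2 ≤ 1 ∧
      2 * ((n - 1) * n) * dr * ((dr - 1) * (n - 1) * θ) ^ 2 + 2 * (dr * (n - 1) * ((dr - 1) * (n - 1) * θ)) ^ 2 ≤ 1 / 2 := by
  have hd0 : 0 ≤ dr := by linarith
  have hn0 : 0 ≤ n := by linarith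
  have hd27 : dr ^ 3 ≤ 27 := by
    have h := pow_le_pow_left₀ hd0 hd3 3
    norm_num at h
    exact h
  have hd81 : dr ^ 4 ≤ 81 := by
    have h := pow_le_pow_left₀ hd0 hd3 4
    norm_num at h
    exact h
  have hτ0 : 0 ≤ (n ^ 2 * θ) ^ 2 := sq_nonneg _
  refine ⟨?_, ?_⟩
  · calc 2 * dr ^ 3 * (n ^ 2 * θ) ^ 2 ≤ 2 * 27 * (1 / 500) :=
          mul_le_mul (mul_le_mul_of_nonneg_left hd27 (by norm_num)) hτ hτ0 (by norm_num)
      _ ≤ 1 := by norm_num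
  · have hn1 : n - 1 ≤ n := by linarith
    have hdr1 : dr - 1 ≤ dr := by linarith
    have hn10 : 0 ≤ n - 1 := by linarith
    have hdr10 : 0 ≤ dr - 1 := by linarith
    calc 2 * ((n - 1) * n) * dr * ((dr - 1) * (n - 1) * θ) ^ 2 + 2 * (dr * (n - 1) * ((dr - 1) * (n - 1) * θ)) ^ 2
        ≤ 2 * (n * n) * dr * (dr * n * θ) ^ 2 + 2 * (dr * n * (dr * n * θ)) ^ 2 := by gcongr
      _ = (2 * dr ^ 3 + 2 * dr ^ 4) * (n ^ 2 * θ) ^ 2 := by ring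
      _ ≤ (2 * 27 + 2 * 81) * (1 / 500) := mul_le_mul (by linarith) hτ hτ0 (by norm_num)
      _ ≤ 1 / 2 := by norm_num

/-- **§E IN THE (H6) BINDER SHAPE, IN THE `((L^k)²θ)² ≤ 1/500` / `plaqC` CURRENCY OF THE HYPOTHESIS-FREE REGION CHAIN**, with the
plaquette hypothesis LOCAL: `‖plaqC u y μ ν − 1‖ ≤ θ` only at the sites `y` within `2L^k` of `Ω` (parameters `(d ℓ)`, `P.L = ℓ + 1` odd,
`1 ≤ k ≤ K`, `2(L^k−1)+4 < |T|`, `0 ≤ θ`, `((L^k)²θ)² ≤ 1/500`; the two side conditions derived inside) — the local twin of p34's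
`holder19_smallPlaquette_region_H6_of500`, for local-hypothesis instances of the order-`1+θ` Hölder member of (2.31).
[cite: BalabanImbrieJaffe1988, (2.31)/(2.32) p.263] [cite: Balaban1983RegularityDecay, Theorem p.573 (1.9)] -/
theorem holder19_smoothNear_region_H6_of500 (d ℓ : ℕ) (hd1 : 1 ≤ d) (hd3 : d + 1 ≤ 3) (hℓ : 1 ≤ ℓ) (hodd : Odd (ℓ + 1))
    {a : ℝ} (ha : 0 < a) {α : ℝ} (hα0 : 0 ≤ α) (hα1 : α < 1) :
    ∃ t₀ c₀ : ℝ, 0 < t₀ ∧ 0 < c₀ ∧ ∀ (P : Params), P.d = d + 1 → P.L = ℓ + 1 →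
      ∀ k : ℕ, 1 ≤ k → k ≤ P.K → 2 * (P.L ^ k - 1) + 4 < P.sitesPerDir 0 →
      ∀ Ω : Finset (Balaban1983to89.Site P 0), IsBlockUnion k Ω →
      ∀ (U : GaugeField P 0 U1) (θ : ℝ), 0 ≤ θ →
        (∀ (y : Balaban1983to89.Site P 0) (μ ν : Fin P.d), (∃ w ∈ Ω, supDist w y ≤ 2 * P.L ^ k) →
          ‖BIJ85AbelianStokes.plaqC U y μ ν - 1‖ ≤ θ) →
        (((P.L : ℝ) ^ k) ^ 2 * θ) ^ 2 ≤ 1 / 500 →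
        ∀ (ρ : ℝ), 3 * (P.L : ℝ) ^ k ≤ ρ →
        ∀ (x₁ x₂ : Balaban1983to89.Site P 0) (μ : Fin P.d), x₁ ≠ x₂ → x₁ ∈ Ω → x₂ ∈ Ω →
          (∀ w, w ∉ Ω → ρ ≤ B5Ineq137Torus.T P 0 x₁ w) → (∀ w, w ∉ Ω → ρ ≤ B5Ineq137Torus.T P 0 x₂ w) →
        ∀ (g : Balaban1983to89.Site P 0 → ℂ) (F D : ℝ), (∀ y, ‖g y‖ ≤ F) → 0 ≤ D →
          (∀ y, g y ≠ 0 → D ≤ B5Ineq137Torus.T P 0 x₁ y) → (∀ y, g y ≠ 0 → D ≤ B5Ineq137Torus.T P 0 x₂ y) →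
          ((P.L : ℝ) ^ k / B5Ineq137Torus.T P 0 x₁ x₂) ^ α *
              ‖stairHol U x₁ x₂ * covD P.eps⁻¹ (cfg U) (gBox (B1RG242Torus.α P a k * (P.L : ℝ) ^ (k * P.d)) P.eps⁻¹ U k Ω *ᵥ g) ⟨x₂, μ⟩ -
                covD P.eps⁻¹ (cfg U) (gBox (B1RG242Torus.α P a k * (P.L : ℝ) ^ (k * P.d)) P.eps⁻¹ U k Ω *ᵥ g) ⟨x₁, μ⟩‖ ≤
            P.spacing k * (c₀ * Real.exp (-(t₀ * (((P.L : ℝ) ^ k)⁻¹ * D))) * F) := by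
  obtain ⟨t₀, c₀, ht₀, hc₀, H⟩ := holder19_smoothNear_region_uniform_H6 d (ℓ + 1) hd1 hd3 ⟨hodd, by omega⟩ ha hα0 hα1
  refine ⟨t₀, c₀, ht₀, hc₀, ?_⟩
  intro P hPd hPL k hk1 hkK hbig Ω hΩ U θ hθ0 hθ hτ ρ hρ x₁ x₂ μ hne hx₁ hx₂ hdeep₁ hdeep₂ g F D hF hD hsupp₁ hsupp₂
  have hLr : (1 : ℝ) ≤ (P.L : ℝ) ^ k := one_le_pow₀ (B1RG242Torus.one_lt_cast_L P).le
  have hdr : (P.d : ℝ) = (d : ℝ) + 1 := by rw [hPd]; push_cast; ring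
  have hd1r : (1 : ℝ) ≤ P.d := by rw [hdr]; linarith [(Nat.cast_nonneg d : (0 : ℝ) ≤ d)]
  have hd3r : (P.d : ℝ) ≤ 3 := by rw [hPd]; exact_mod_cast hd3
  obtain ⟨hsm1, hsm2⟩ := threshold_smallness' hd1r hd3r hLr hθ0 hτ
  have hplaq : ∀ p : Balaban1983to89.Plaq P 0, (∃ w ∈ Ω, supDist w p.src ≤ 2 * P.L ^ k) → ‖toC (plaqHol U p) - 1‖ ≤ θ := by
    rintro ⟨y, μ', ν, hμν⟩ hy
    rw [← BIJ85AbelianStokes.plaqC_eq_toC_plaqHol U y hμν]; exact hθ y μ' ν hy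
  have hT : ((P.d - 1 : ℕ) : ℝ) * ((P.L : ℝ) ^ k - 1) * θ ≤ ((P.d : ℝ) - 1) * ((P.L : ℝ) ^ k - 1) * θ := by
    rw [Nat.cast_sub P.hd, Nat.cast_one]
  exact H P hPd hPL k hk1 hkK hbig Ω hΩ U θ hθ0 hplaq hsm1 _ hT hsm2 ρ hρ x₁ x₂ μ hne hx₁ hx₂ hdeep₁ hdeep₂ g F D hF hD hsupp₁ hsupp₂

end Uniform


/-! ## §F The Hölder member under the printed smoothness (2.32) near `Ω` -/

section Smooth

variable {d : ℕ}

open BIJ88Sect2Statements (SmoothOn)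

/-- **THE HÖLDER MEMBER OF [6] (1.9) FOR THE REGION PROPAGATORS UNDER THE PRINTED (2.32) NEAR `Ω`** — `holder19_smoothNear_region_uniform` at
`θ = e_kη²C𝓅` from `SmoothOn e_k η C 𝓅 X B Pl (cfg u)` with `Pl ⊇` the plaquettes based within `2L^k` of `Ω` and `B ⊇` their bonds (B-I's
`plaqSmall_near_of_smoothOn`), every `k`-block union, all `3L^k`-deep pairs, transport `stairHol`:
`(L^k/|x₀−x₁|_∞)^α‖U(Γ_{x₀,x₁})(D_uG_k(Ω,u)f)(x₁,μ) − (D_uG_k(Ω,u)f)(x₀,μ)‖ ≤ c₀(L^kε)e^{−t₀D/L^k}F`.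
[cite: BalabanImbrieJaffe1988, p.263 «Hölder derivatives … of order less than two», (2.32)] [cite: Balaban1983RegularityDecay, Thm p.573 (1.9)] -/
theorem holder19_smoothOn_region_uniform (d L : ℕ) (hd1 : 1 ≤ d) (hd3 : d + 1 ≤ 3) (hL : Odd L ∧ 1 < L) {a : ℝ} (ha : 0 < a)
    {α : ℝ} (hα0 : 0 ≤ α) (hα1 : α < 1) :
    ∃ t₀ c₀ : ℝ, 0 < t₀ ∧ 0 < c₀ ∧ ∀ (P : Params), P.d = d + 1 → P.L = L →
      ∀ k : ℕ, 1 ≤ k → k ≤ P.K → 2 * (P.L ^ k - 1) + 4 < P.sitesPerDir 0 →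
      ∀ Ω : Finset (Balaban1983to89.Site P 0), IsBlockUnion k Ω →
      ∀ (U : GaugeField P 0 U1) (ek η C pek : ℝ), 0 ≤ ek → 0 ≤ C * pek →
      ∀ (X : Finset (Balaban1983to89.Site P 0)) (B : Finset (PBond P 0)) (Pl : Finset (Balaban1983to89.Plaq P 0)),
        SmoothOn ek η C pek X B Pl (cfg U) →
        (∀ p : Balaban1983to89.Plaq P 0, (∃ y ∈ Ω, supDist y p.src ≤ 2 * P.L ^ k) → p ∈ Pl) →
        (∀ p ∈ Pl, (⟨p.src, p.μ⟩ : PBond P 0) ∈ B ∧ (⟨p.src.shift p.μ, p.ν⟩ : PBond P 0) ∈ B ∧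
          (⟨p.src.shift p.ν, p.μ⟩ : PBond P 0) ∈ B ∧ (⟨p.src, p.ν⟩ : PBond P 0) ∈ B) →
        2 * (P.d : ℝ) ^ 3 * (((P.L : ℝ) ^ k) ^ 2 * (ek * η ^ 2 * (C * pek))) ^ 2 ≤ 1 →
        ∀ (T : ℝ), ((P.d - 1 : ℕ) : ℝ) * ((P.L : ℝ) ^ k - 1) * (ek * η ^ 2 * (C * pek)) ≤ T →
          2 * (((P.L : ℝ) ^ k - 1) * (P.L : ℝ) ^ k) * P.d * T ^ 2 + 2 * (P.d * ((P.L : ℝ) ^ k - 1) * T) ^ 2 ≤ 1 / 2 →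
        ∀ (x₀ x₁ : Balaban1983to89.Site P 0) (μ : Fin P.d), x₀ ≠ x₁ →
          (∀ w, w ∉ Ω → 3 * P.L ^ k ≤ supDist x₀ w) →
          (∀ w, w ∉ Ω → 3 * P.L ^ k ≤ supDist x₁ w) →
        ∀ (f : Balaban1983to89.Site P 0 → ℂ) (F D : ℝ),
          (∀ z, ‖f z‖ ≤ F) → (∀ z, f z ≠ 0 → D ≤ (supDist x₀ z : ℝ) ∧ D ≤ (supDist x₁ z : ℝ)) →
          (((P.L : ℝ) ^ k / (supDist x₀ x₁ : ℝ)) ^ α *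
            ‖stairHol U x₀ x₁ *
                covD P.eps⁻¹ (cfg U) (gBox (B1RG242Torus.α P a k * (P.L : ℝ) ^ (k * P.d)) P.eps⁻¹ U k Ω *ᵥ f) ⟨x₁, μ⟩ -
              covD P.eps⁻¹ (cfg U) (gBox (B1RG242Torus.α P a k * (P.L : ℝ) ^ (k * P.d)) P.eps⁻¹ U k Ω *ᵥ f) ⟨x₀, μ⟩‖
            ≤ c₀ * P.spacing k * Real.exp (-(t₀ * D / (P.L : ℝ) ^ k)) * F) := by
  obtain ⟨t₀, c₀, ht₀, hc₀, H⟩ := holder19_smoothNear_region_uniform d L hd1 hd3 hL ha hα0 hα1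
  refine ⟨t₀, c₀, ht₀, hc₀, ?_⟩
  intro P hPd hPL k hk1 hkK hR Ω hΩ U ek η C pek hek hCp X B Pl hS hPl hB hsmall T hT hsmallT x₀ x₁ μ hne hdeep₀ hdeep₁ f F D hF hsupp
  exact H P hPd hPL k hk1 hkK hR Ω hΩ U (ek * η ^ 2 * (C * pek)) (by positivity) (plaqSmall_near_of_smoothOn hek hS hPl hB) hsmall T hT
    hsmallT x₀ x₁ μ hne hdeep₀ hdeep₁ f F D hF hsupp

/-- **THE SAME IN THE (H6) BINDER SHAPE of p27's `derivHolder231_region_of_inputs_of_smooth`, UNDER THE PRINTED (2.32) NEAR `Ω`** (every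
`ρ ≥ 3L^k`, distance `B5Ineq137Torus.T`, `P.spacing k * (c₀ * exp(−t₀((L^k)⁻¹D)) * F)`).
[cite: BalabanImbrieJaffe1988, (2.31)/(2.32) p.263] [cite: Balaban1983RegularityDecay, Thm p.573 (1.9)] -/
theorem holder19_smoothOn_region_uniform_H6 (d L : ℕ) (hd1 : 1 ≤ d) (hd3 : d + 1 ≤ 3) (hL : Odd L ∧ 1 < L) {a : ℝ}
    (ha : 0 < a) {α : ℝ} (hα0 : 0 ≤ α) (hα1 : α < 1) :
    ∃ t₀ c₀ : ℝ, 0 < t₀ ∧ 0 < c₀ ∧ ∀ (P : Params), P.d = d + 1 → P.L = L →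
      ∀ k : ℕ, 1 ≤ k → k ≤ P.K → 2 * (P.L ^ k - 1) + 4 < P.sitesPerDir 0 →
      ∀ Ω : Finset (Balaban1983to89.Site P 0), IsBlockUnion k Ω →
      ∀ (U : GaugeField P 0 U1) (ek η C pek : ℝ), 0 ≤ ek → 0 ≤ C * pek →
      ∀ (X : Finset (Balaban1983to89.Site P 0)) (B : Finset (PBond P 0)) (Pl : Finset (Balaban1983to89.Plaq P 0)),
        SmoothOn ek η C pek X B Pl (cfg U) →
        (∀ p : Balaban1983to89.Plaq P 0, (∃ y ∈ Ω, supDist y p.src ≤ 2 * P.L ^ k) → p ∈ Pl) →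
        (∀ p ∈ Pl, (⟨p.src, p.μ⟩ : PBond P 0) ∈ B ∧ (⟨p.src.shift p.μ, p.ν⟩ : PBond P 0) ∈ B ∧
          (⟨p.src.shift p.ν, p.μ⟩ : PBond P 0) ∈ B ∧ (⟨p.src, p.ν⟩ : PBond P 0) ∈ B) →
        2 * (P.d : ℝ) ^ 3 * (((P.L : ℝ) ^ k) ^ 2 * (ek * η ^ 2 * (C * pek))) ^ 2 ≤ 1 →
        ∀ (T : ℝ), ((P.d - 1 : ℕ) : ℝ) * ((P.L : ℝ) ^ k - 1) * (ek * η ^ 2 * (C * pek)) ≤ T →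
          2 * (((P.L : ℝ) ^ k - 1) * (P.L : ℝ) ^ k) * P.d * T ^ 2 + 2 * (P.d * ((P.L : ℝ) ^ k - 1) * T) ^ 2 ≤ 1 / 2 →
        ∀ (ρ : ℝ), 3 * (P.L : ℝ) ^ k ≤ ρ →
        ∀ (x₁ x₂ : Balaban1983to89.Site P 0) (μ : Fin P.d), x₁ ≠ x₂ → x₁ ∈ Ω → x₂ ∈ Ω →
          (∀ w, w ∉ Ω → ρ ≤ B5Ineq137Torus.T P 0 x₁ w) → (∀ w, w ∉ Ω → ρ ≤ B5Ineq137Torus.T P 0 x₂ w) →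
        ∀ (g : Balaban1983to89.Site P 0 → ℂ) (F D : ℝ), (∀ y, ‖g y‖ ≤ F) → 0 ≤ D →
          (∀ y, g y ≠ 0 → D ≤ B5Ineq137Torus.T P 0 x₁ y) → (∀ y, g y ≠ 0 → D ≤ B5Ineq137Torus.T P 0 x₂ y) →
          ((P.L : ℝ) ^ k / B5Ineq137Torus.T P 0 x₁ x₂) ^ α *
              ‖stairHol U x₁ x₂ * covD P.eps⁻¹ (cfg U) (gBox (B1RG242Torus.α P a k * (P.L : ℝ) ^ (k * P.d)) P.eps⁻¹ U k Ω *ᵥ g) ⟨x₂, μ⟩ -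
                covD P.eps⁻¹ (cfg U) (gBox (B1RG242Torus.α P a k * (P.L : ℝ) ^ (k * P.d)) P.eps⁻¹ U k Ω *ᵥ g) ⟨x₁, μ⟩‖ ≤
            P.spacing k * (c₀ * Real.exp (-(t₀ * (((P.L : ℝ) ^ k)⁻¹ * D))) * F) := by
  obtain ⟨t₀, c₀, ht₀, hc₀, H⟩ := holder19_smoothNear_region_uniform_H6 d L hd1 hd3 hL ha hα0 hα1
  refine ⟨t₀, c₀, ht₀, hc₀, ?_⟩
  intro P hPd hPL k hk1 hkK hR Ω hΩ U ek η C pek hek hCp X B Pl hS hPl hB hsmall T hT hsmallT ρ hρ x₁ x₂ μ hne hx₁ hx₂ hdeep₁ hdeep₂ g F D hF hD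
    hsupp₁ hsupp₂
  exact H P hPd hPL k hk1 hkK hR Ω hΩ U (ek * η ^ 2 * (C * pek)) (by positivity) (plaqSmall_near_of_smoothOn hek hS hPl hB) hsmall T hT
    hsmallT ρ hρ x₁ x₂ μ hne hx₁ hx₂ hdeep₁ hdeep₂ g F D hF hD
    hsupp₁ hsupp₂

end Smooth

end Holder

end

end Literature.MathematicalPhysics.QuantumFieldTheory.BalabanImbrieJaffe1984to88.BIJ88NeumannPropagatorSmoothNearRegionHolder
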